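import Literature.MathematicalPhysics.QuantumFieldTheory.Balaban1983to89.B9SectBGpFrameCodedYR
import Literature.MathematicalPhysics.QuantumFieldTheory.Balaban1983to89.B9Thm314WholeExpansionReads
import Literature.MathematicalPhysics.QuantumFieldTheory.Balaban1983to89.B9Ineq349SiteComposite
import Literature.MathematicalPhysics.QuantumFieldTheory.Balaban1983to89.B9SectBGpReadingsY
import Literature.MathematicalPhysics.QuantumFieldTheory.Balaban1983to89.B9SectBCodedClassR
import Literature.MathematicalPhysics.QuantumFieldTheory.Balaban1983to89.B9SectBGpReadingsYProd
import Literature.MathematicalPhysics.QuantumFieldTheory.Balaban1983to89.Node00.OpsYRead342Cross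
import Literature.MathematicalPhysics.QuantumFieldTheory.Balaban1983to89.B9SectBGpTransferInY
import Literature.MathematicalPhysics.QuantumFieldTheory.Balaban1983to89.B9SectBGpTransferOutY
import Literature.MathematicalPhysics.QuantumFieldTheory.Balaban1983to89.B9Eq370LetterConversion
import Literature.MathematicalPhysics.QuantumFieldTheory.Balaban1983to89.B9SectBGpTransferConvY
import Literature.MathematicalPhysics.QuantumFieldTheory.Balaban1983to89.B9SectBStepFamilyTransfer
import Literature.MathematicalPhysics.QuantumFieldTheory.Balaban1983to89.B9SectBCodedChainOnSubfamily
import Literature.MathematicalPhysics.QuantumFieldTheory.Balaban1983to89.B9Eq358TaxiLettersY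
import Literature.MathematicalPhysics.QuantumFieldTheory.Balaban1983to89.B9RWSumsCompleteGeo9YNbr
import Literature.MathematicalPhysics.QuantumFieldTheory.Balaban1983to89.B9BetaRangeKLevelV1
import Literature.MathematicalPhysics.QuantumFieldTheory.Balaban1983to89.B9SectBCodedClassY

/-!
# `Balaban1983to89.B9SectBCodedChainR1` — CASCADE-R BUNDLE 1∕7 (director-ym №279 GO-R; №277 (3) `hunitA` cure): the class-parametric twins
# `B9SectBGpReadingsYR`, `B9SectBGpReadingsYProdR`, `B9SectBGpTransferInYR`, `B9SectBGpTransferOutYR`, `B9SectBGpTransferConvYR`, `B9SectBCodedChainOnSubfamilyR`, `B9SectBCodedClassYR`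

statement-level skeleton of published theorems with citation tags; proofs where landed; nothing here is a claim about the
Yang–Mills mass gap

WHY A BUNDLE.  The minimal R-sub-path of №279 (3) is a 47-module dependency chain; post-accept olean builds are the latency of record today, so the
chain is filed as 7 layered modules instead of 47.  This module is the VERBATIM concatenation, in dependency order, of the 7 generated twin files
named above (each keeps its own namespace `…<Original>R`, its own honest twin header and a pointer to the original module documentation; consumers `open` the
namespaces exactly as they would the per-file twins).  Generated by dag-n06-c g16 (`mkbundle.py`, HOME `pub-ymgap-dag-n06-c/lean/g16/`).

HONEST SCOPE.  Re-typing bookkeeping; nothing of [B9] asserted beyond the originals; COUNT-NEUTRAL; N06 NOT discharged; nothing continuum ∕ OS ∕ mass gap ∕ Clay.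
-/

/-!
# `Balaban1983to89.B9SectBGpReadingsYR` — THE CLASS-PARAMETRIC TWIN of `B9SectBGpReadingsY` (CASCADE-R, director-ym №279 GO-R; №277 (3) `hunitA` cure; dag-n06-d SOCKET-(α) class question)

statement-level skeleton of published theorems with citation tags; proofs where landed; nothing here is a claim about the
Yang–Mills mass gap

WHAT THIS FILE IS.  The original module `B9SectBGpReadingsY` types its objects over MODULE 3's member carrier `bg9Y 𝔸 G x` (MODULE 2's small-cube class (3.35)).  This file RE-DECLARES, with UNCHANGED NAMES inside the namespace `…B9SectBGpReadingsYR`, exactly its 8 class-dependent declarations over the CLASS-PARAMETRIC carrier `B9SectBCodedClassR.bg9YC 𝔸 G P x` (`P : RegExtraY …` = the two cube conditions of (3.35)∕(3.36) as a parameter; `bg9Y 𝔸 G x = bg9YC 𝔸 G (extraY 𝔸 G) x` by `rfl`, so every declaration here specialises definitionally to its original; at the record's reading of PRINT's class, `P := extraYPb 𝔸 G`, the displayed laws `hreg335P` ((3.35) on plaquettes) and the class-keyed `hunitA` become theorems).  The text is the original's VERBATIM under the token surgery `bg9Y 𝔸 G ↦ bg9YC 𝔸 G P`, `NAME ↦ NAME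 P` for the class-dependent names (P the first explicit argument), and — №277 — the binder `hunitA` re-keyed from «all G-valued U» to «all (3.35)-regular U of the carrier» (`∀ j α₀ U, (bg9YC 𝔸 G P (f j)).Reg335 c35 α₀ U → IsUnit (deltaAY …)`).  Class-free declarations of the original are NOT copied: they are imported and used BY NAME (`open … hiding` the re-declared ones).  Generated by dag-n06-c g16's `gen.py` (HOME `pub-ymgap-dag-n06-c/lean/g16/`); the ORIGINAL MODULE DOCUMENTATION FOLLOWS VERBATIM and describes the mathematics.

HONEST SCOPE.  Re-typing bookkeeping; nothing of [B9] asserted beyond the original; COUNT-NEUTRAL; N06 NOT discharged; nothing continuum ∕ OS ∕ mass gap ∕ Clay.  Cell `pub-ymgap` (D-0062), Track A node N06 [B9], seat `pub-ymgap-dag-n06-c` g16, 2026-08-29.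
-/

/-! Module documentation: that of the original `Balaban1983to89.B9SectBGpReadingsY` applies verbatim to this twin (not repeated here). -/

noncomputable section

namespace Literature.MathematicalPhysics.QuantumFieldTheory.Balaban1983to89.B9SectBGpReadingsYR

open Literature.MathematicalPhysics.QuantumFieldTheory.Balaban1983to89.B9SectBCodedClassR (RegExtraY bg9YC)
open Literature.MathematicalPhysics.QuantumFieldTheory.Balaban1983to89.B9SectBGpReadingsY hiding KSC liftY_bound_zero eLatSC_le_of_eBlock liftY_bound_one liftY_bound_two liftY_bound_three read342Y_KSC write342Y_KSC

open Literature.MathematicalPhysics.QuantumFieldTheory.Balaban1983to89.B6RandomWalk (HasMajorant BlockSupp)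
open Literature.MathematicalPhysics.QuantumFieldTheory.Balaban1983to89.B9Eq352DivFormLetters (conj conj_apply coordEquiv coordEquiv_apply coordEquiv_symm_apply)
open Literature.MathematicalPhysics.QuantumFieldTheory.Balaban1983to89.Node00 (liftY liftY_apply)

variable {𝔸 : Type} [NormedRing 𝔸] [NormedAlgebra ℂ 𝔸]

/-! ## §0 The abstract dictionary: sup-over-directions readings of `T` on product-form inputs ↔ block majorants of `conj b T` -/

section Abstract

variable {ι : Type} [Fintype ι] (b : Module.Basis ι ℝ 𝔸) {S : Type} {g : B6.Geometry} (blk : S → g.Site)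

end Abstract

/-! ## §1 The AUGMENTED reading family of a site-sector letter over the coded configurations -/

section Family

open Literature.MathematicalPhysics.QuantumFieldTheory.Balaban1983to89.B6KLevelCensusIndexV1 (KIdx kGeo)
open Literature.MathematicalPhysics.QuantumFieldTheory.Balaban1983to89.B6Ineq2142KLevelV1 (β)
open Literature.MathematicalPhysics.QuantumFieldTheory.Balaban1983to89.B6Prop22KLevelCensusEta (epow)
open Literature.MathematicalPhysics.QuantumFieldTheory.Balaban1983to89.B9Eq39Adjoint (fluct)
open Literature.MathematicalPhysics.QuantumFieldTheory.Balaban1983to89.B9SectBCodedCarrier (CCfg)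
open Literature.MathematicalPhysics.QuantumFieldTheory.Balaban1983to89.B9Eq360DeltaPrimeAY (AfldY)
open Literature.MathematicalPhysics.QuantumFieldTheory.Balaban1983to89.B9SectBGpLettersY (decY)
open Literature.MathematicalPhysics.QuantumFieldTheory.Balaban1983to89.Node00 (SiteY BlkY IBondY CfgY BallY SiteOpY SiteParY cdS cdsS lapS etaS supBlkS
  supBlkS' kernelFamilyS)

variable {d ℓ : ℕ} {hd : 1 ≤ d + 1} {hL : Odd (ℓ + 1) ∧ 1 < ℓ + 1} {b₀ b₁ : ℝ} {Mstar : ℕ} (P : RegExtraY d ℓ hd hL b₀ b₁ Mstar 𝔸) [CompleteSpace 𝔸] (i : KIdx d ℓ hd hL b₀ b₁)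

end Family

/-! ## §2 The record family and the tools at the record -/

section Record

open Literature.MathematicalPhysics.QuantumFieldTheory.Balaban1983to89.B6KLevelCensusIndexV1 (KIdx kGeo)
open Literature.MathematicalPhysics.QuantumFieldTheory.Balaban1983to89.B6Ineq2142KLevelV1 (β)
open Literature.MathematicalPhysics.QuantumFieldTheory.Balaban1983to89.B6Prop22KLevelCensusEta (epow)
open Literature.MathematicalPhysics.QuantumFieldTheory.Balaban1983to89.B9Thm34Ext (toB6)
open Literature.MathematicalPhysics.QuantumFieldTheory.Balaban1983to89.B9FromB6 (EBlock)
open Literature.MathematicalPhysics.QuantumFieldTheory.Balaban1983to89.B9Eq352GradLetters (diffLetter)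
open Literature.MathematicalPhysics.QuantumFieldTheory.Balaban1983to89.B9SectBCodedCarrier (CCfg)
open Literature.MathematicalPhysics.QuantumFieldTheory.Balaban1983to89.B9Eq360DeltaPrimeAY (AfldY blkY blkY_apply)
open Literature.MathematicalPhysics.QuantumFieldTheory.Balaban1983to89.B9PinMembersKLevelV1 (MemberY geo9Y bg9Y)
open Literature.MathematicalPhysics.QuantumFieldTheory.Balaban1983to89.B9SectBGpLettersY (decY GVal coordC blkC ΔpC GopC LapC)
open Literature.MathematicalPhysics.QuantumFieldTheory.Balaban1983to89.B9SectBGpFrameCodedYR (codingYx Read342Y Write342Y)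
open Literature.MathematicalPhysics.QuantumFieldTheory.Balaban1983to89.B9Thm314WholeExpansionReads (le_iSup_ball)
open Literature.MathematicalPhysics.QuantumFieldTheory.Balaban1983to89.Node00 (SiteY BlkY IBondY CfgY BallY SiteOpY SiteParY UboxY shiftY cdS cdsS lapS
  etaS supBlkS supBlkS' GpY)

variable {d ℓ : ℕ} {hd : 1 ≤ d + 1} {hL : Odd (ℓ + 1) ∧ 1 < ℓ + 1} {b₀ b₁ : ℝ} {Mstar : ℕ} (P : RegExtraY d ℓ hd hL b₀ b₁ Mstar 𝔸) [CompleteSpace 𝔸] [FiniteDimensional ℝ 𝔸]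
  (G : Subgroup 𝔸ˣ) (x : MemberY d ℓ hd hL b₀ b₁ Mstar) (par : SiteParY 𝔸 x.toKIdx) {ι : Type} [Fintype ι] (b : Module.Basis ι ℝ 𝔸)
  (ιB : BlkY x.toKIdx → IBondY x.toKIdx) (C37 C38 : ℝ → CfgY 𝔸 x.toKIdx → AfldY 𝔸 x.toKIdx → Prop)

/-- ★ **THE FAMILY OF RECORD FOR THE G′ ROOT FRAME**: the augmented coded readings of NODE 00's genuine letter `G′(U) = GpY par` over the coding of `bg9Y`.
[cite: Balaban1985BackgroundPropagators, (3.25) p.394, Thm 3.1 (3.42) p.397] -/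
def KSC : B9.KernelFamily (geo9Y x) (codingYx P G x C37 C38).bg :=
  kernelFamilySC x.toKIdx (codingYx P G x C37 C38).bg (fun c => c) (GpY x.toKIdx par) par

/-- ★ **ENTRY 0 OF THE READING**: the (3.42) block of the augmented family at `base U` bounds `η²‖(G′(U)(f ⊗ E))(z)‖` for `f` supported in the labelled
block `y′`, `|f| ≦ B`, `‖E‖ ≦ 1`, by `(η/η_S)²·B₀·(Lʲη)²e^{−δd(y(z),y′)}·B`. [cite: Balaban1985BackgroundPropagators, (3.42) p.397 (first entry)] -/
theorem liftY_bound_zero (hι : ∀ s : BlkY x.toKIdx, β x.toKIdx.hN x.toKIdx.D x.toKIdx.hk (ιB s) = s) {U : CfgY 𝔸 x.toKIdx} {B₀ δ : ℝ}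
    (hB₀ : 0 ≤ B₀) (hE : EBlock (KSC P G x par C37 C38) B₀ δ (.base U))
    (f : SiteY x.toKIdx → ℝ) (E : 𝔸) (y' : IBondY x.toKIdx) (B : ℝ) (hE1 : ‖E‖ ≤ 1) (hB : 0 ≤ B)
    (hoff : ∀ z, blkC x.toKIdx ιB z ≠ y' → f z = 0) (hbd : ∀ z, |f z| ≤ B) (z : SiteY x.toKIdx) :
    ‖(((kGeo x.toKIdx).eta ^ 2) • (GpY x.toKIdx par U).restrictScalars ℝ) (liftY f E) z‖
      ≤ (B₀ * (geo9Y x).len (blkC x.toKIdx ιB z) ^ 2 * Real.exp (-(δ * (geo9Y x).dist (blkC x.toKIdx ιB z) y'))) * B := by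
  set η := (kGeo x.toKIdx).eta with hηdef
  have hη0 : 0 < η := B9GeoLemma21KLevelV1.geo9K_eta_pos x.toKIdx
  have hblk : β x.toKIdx.hN x.toKIdx.D x.toKIdx.hk (blkC x.toKIdx ιB z) = blkY x.toKIdx z := by rw [blkC, hι]
  -- the reading at the labelled block of `z`
  have hread := hE 0 (.inl f) (blkC x.toKIdx ιB z) y' (suppIn_inl_of_blkC x ιB hι hoff)
  rw [KSC, kernelFamilySC_e_inl, hblk] at hread
  have hpref : B9.pref4 ((geo9Y x).len (blkC x.toKIdx ιB z)) 0 = (geo9Y x).len (blkC x.toKIdx ιB z) ^ 2 := rfl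
  have hep : epow 0 = 2 := rfl
  rw [hpref, hep, etaS_eq_eta] at hread
  -- the term: η²·‖(G′(U)(f ⊗ E))(z)‖
  have hval : (((kGeo x.toKIdx).eta ^ 2) • (GpY x.toKIdx par U).restrictScalars ℝ) (liftY f E) z = (η ^ 2 : ℝ) • GpY x.toKIdx par U (liftY f E) z := rfl
  rw [hval, norm_smul, Real.norm_eq_abs, abs_of_nonneg (by positivity)]
  -- ‖(G′(U)(f ⊗ E))(z)‖ ≤ the block sup ≤ the sup over the ball
  obtain ⟨C, -, hC⟩ := exists_ball_bound x ((GpY x.toKIdx par U).restrictScalars ℝ) f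
  have h1 : ‖GpY x.toKIdx par U (liftY f E) z‖ ≤ supBlkS x.toKIdx (blkY x.toKIdx z) (GpY x.toKIdx par U (liftY f E)) :=
    norm_le_supBlkS x.toKIdx _ _ rfl
  have h2 : supBlkS x.toKIdx (blkY x.toKIdx z) (GpY x.toKIdx par U (liftY f E))
      ≤ ⨆ E' : BallY 𝔸, eLatSC x.toKIdx (GpY x.toKIdx par) U U (liftY f (E' : 𝔸)) (blkY x.toKIdx z) 0 := by
    have := le_iSup_ball (A := fun E' : BallY 𝔸 => eLatSC x.toKIdx (GpY x.toKIdx par) U U (liftY f (E' : 𝔸)) (blkY x.toKIdx z) 0)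
      ⟨C, fun E' => B9Ineq349SiteComposite.supBlkS_le x.toKIdx _ _ (le_trans (norm_nonneg _) (hC E' z)) fun w _ => hC E' w⟩
      ⟨E, mem_closedBall_zero_iff.2 hE1⟩
    exact this
  have hsup : (geo9Y x).supNorm (.inl f) ≤ B := supNorm_inl_le x hB hbd
  have h3 : η ^ 2 * (⨆ E' : BallY 𝔸, eLatSC x.toKIdx (GpY x.toKIdx par) U U (liftY f (E' : 𝔸)) (blkY x.toKIdx z) 0)
      ≤ B₀ * (geo9Y x).len (blkC x.toKIdx ιB z) ^ 2 * Real.exp (-(δ * (geo9Y x).dist (blkC x.toKIdx ιB z) y')) * B :=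
    hread.trans (mul_le_mul_of_nonneg_left hsup (by positivity))
  calc η ^ 2 * ‖GpY x.toKIdx par U (liftY f E) z‖
      ≤ η ^ 2 * ⨆ E' : BallY 𝔸, eLatSC x.toKIdx (GpY x.toKIdx par) U U (liftY f (E' : 𝔸)) (blkY x.toKIdx z) 0 :=
        mul_le_mul_of_nonneg_left (h1.trans h2) (by positivity)
    _ ≤ _ := h3


/-- the reading of the augmented family at `base U`, read at the labelled block of `z`, unfolded and bounded by the (3.42) block hypothesis.
[cite: Balaban1985BackgroundPropagators, (3.42) p.397, bookkeeping] -/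
theorem eLatSC_le_of_eBlock (hι : ∀ s : BlkY x.toKIdx, β x.toKIdx.hN x.toKIdx.D x.toKIdx.hk (ιB s) = s) {U : CfgY 𝔸 x.toKIdx} {B₀ δ : ℝ}
    (hB₀ : 0 ≤ B₀) (hE : EBlock (KSC P G x par C37 C38) B₀ δ (.base U)) (n : Fin 4)
    (f : SiteY x.toKIdx → ℝ) (E : 𝔸) (y' : IBondY x.toKIdx) (B : ℝ) (hE1 : ‖E‖ ≤ 1) (hB : 0 ≤ B)
    (hoff : ∀ z, blkC x.toKIdx ιB z ≠ y' → f z = 0) (hbd : ∀ z, |f z| ≤ B) (z : SiteY x.toKIdx) :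
    (kGeo x.toKIdx).eta ^ (epow n) * eLatSC x.toKIdx (GpY x.toKIdx par) U U (liftY f E) (blkY x.toKIdx z) n
      ≤ B₀ * B9.pref4 ((geo9Y x).len (blkC x.toKIdx ιB z)) n * Real.exp (-(δ * (geo9Y x).dist (blkC x.toKIdx ιB z) y')) * B := by
  have hη0 : 0 < (kGeo x.toKIdx).eta := B9GeoLemma21KLevelV1.geo9K_eta_pos x.toKIdx
  have hblk : β x.toKIdx.hN x.toKIdx.D x.toKIdx.hk (blkC x.toKIdx ιB z) = blkY x.toKIdx z := by rw [blkC, hι]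
  have hread := hE n (.inl f) (blkC x.toKIdx ιB z) y' (suppIn_inl_of_blkC x ιB hι hoff)
  rw [KSC, kernelFamilySC_e_inl, hblk, etaS_eq_eta] at hread
  obtain ⟨C, hC⟩ := exists_ball_bound_eLatSC x (GpY x.toKIdx par) U U f (blkY x.toKIdx z) n
  have h2 : eLatSC x.toKIdx (GpY x.toKIdx par) U U (liftY f E) (blkY x.toKIdx z) n
      ≤ ⨆ E' : BallY 𝔸, eLatSC x.toKIdx (GpY x.toKIdx par) U U (liftY f (E' : 𝔸)) (blkY x.toKIdx z) n :=
    le_iSup_ball (A := fun E' : BallY 𝔸 => eLatSC x.toKIdx (GpY x.toKIdx par) U U (liftY f (E' : 𝔸)) (blkY x.toKIdx z) n) ⟨C, hC⟩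
      ⟨E, mem_closedBall_zero_iff.2 hE1⟩
  have hpref : 0 ≤ B9.pref4 ((geo9Y x).len (blkC x.toKIdx ιB z)) n := by
    have hl := (B9GeoLemma21KLevelV1.geo9Y_len_pos x (blkC x.toKIdx ιB z)).le
    match n with
    | 0 => exact pow_nonneg hl 2
    | 1 => exact hl
    | 2 => exact hl
    | 3 => exact zero_le_one
  calc (kGeo x.toKIdx).eta ^ (epow n) * eLatSC x.toKIdx (GpY x.toKIdx par) U U (liftY f E) (blkY x.toKIdx z) n
      ≤ (kGeo x.toKIdx).eta ^ (epow n) * ⨆ E' : BallY 𝔸, eLatSC x.toKIdx (GpY x.toKIdx par) U U (liftY f (E' : 𝔸)) (blkY x.toKIdx z) n :=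
        mul_le_mul_of_nonneg_left h2 (by positivity)
    _ ≤ B₀ * B9.pref4 ((geo9Y x).len (blkC x.toKIdx ιB z)) n * Real.exp (-(δ * (geo9Y x).dist (blkC x.toKIdx ιB z) y')) *
          (geo9Y x).supNorm (.inl f) := hread
    _ ≤ _ := mul_le_mul_of_nonneg_left (supNorm_inl_le x hB hbd) (by positivity)

/-- ★ **ENTRY 1 OF THE READING** (left difference letters, forward AND backward): `‖(∇♯_k·η²G′(U))(f ⊗ E)(z)‖ ≦ B₀(Lʲη)e^{−δd}·B`.
[cite: Balaban1985BackgroundPropagators, (3.42) p.397 (second entry), (3.3) p.390, (3.8) p.392] -/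
theorem liftY_bound_one (hι : ∀ s : BlkY x.toKIdx, β x.toKIdx.hN x.toKIdx.D x.toKIdx.hk (ιB s) = s) {U : CfgY 𝔸 x.toKIdx} {B₀ δ : ℝ}
    (hB₀ : 0 ≤ B₀) (hE : EBlock (KSC P G x par C37 C38) B₀ δ (.base U)) (k : Fin (d + 1) ⊕ Fin (d + 1))
    (f : SiteY x.toKIdx → ℝ) (E : 𝔸) (y' : IBondY x.toKIdx) (B : ℝ) (hE1 : ‖E‖ ≤ 1) (hB : 0 ≤ B)
    (hoff : ∀ z, blkC x.toKIdx ιB z ≠ y' → f z = 0) (hbd : ∀ z, |f z| ≤ B) (z : SiteY x.toKIdx) :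
    ‖(diffLetter (shiftY x.toKIdx) (UboxY x.toKIdx U) ((((kGeo x.toKIdx).eta : ℂ))⁻¹) k *
        (((kGeo x.toKIdx).eta ^ 2) • (GpY x.toKIdx par U).restrictScalars ℝ)) (liftY f E) z‖
      ≤ (B₀ * (geo9Y x).len (blkC x.toKIdx ιB z) * Real.exp (-(δ * (geo9Y x).dist (blkC x.toKIdx ιB z) y'))) * B := by
  set η := (kGeo x.toKIdx).eta with hηdef
  have hη0 : 0 < η := B9GeoLemma21KLevelV1.geo9K_eta_pos x.toKIdx
  have key := eLatSC_le_of_eBlock P G x par ιB C37 C38 hι hB₀ hE 1 f E y' B hE1 hB hoff hbd z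
  have hep : epow 1 = 1 := rfl
  have hpref : B9.pref4 ((geo9Y x).len (blkC x.toKIdx ιB z)) 1 = (geo9Y x).len (blkC x.toKIdx ιB z) := rfl
  rw [hep, pow_one, hpref] at key
  -- the value of the letter product on `f ⊗ E` at `z`
  set Λ := GpY x.toKIdx par U (liftY f E) with hΛ
  have hval : ∀ μ, (diffLetter (shiftY x.toKIdx) (UboxY x.toKIdx U) (((η : ℂ))⁻¹) (Sum.inl μ) *
        ((η ^ 2) • (GpY x.toKIdx par U).restrictScalars ℝ)) (liftY f E) z = ((η : ℂ))⁻¹ • ((((η ^ 2 : ℝ)) : ℂ) • cdS x.toKIdx U μ Λ z) := by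
    intro μ
    rw [Module.End.mul_apply, B9Eq352GradLetters.diffLetter_inl, B9Eq352DivFormLetters.gradLetterF_apply, LinearMap.smul_apply,
      LinearMap.restrictScalars_apply, real_smul_fun, B9Eq39Adjoint.covD_smul]
    rfl
  have hval' : ∀ μ, (diffLetter (shiftY x.toKIdx) (UboxY x.toKIdx U) (((η : ℂ))⁻¹) (Sum.inr μ) *
        ((η ^ 2) • (GpY x.toKIdx par U).restrictScalars ℝ)) (liftY f E) z = -(((η : ℂ))⁻¹ • ((((η ^ 2 : ℝ)) : ℂ) • cdsS x.toKIdx U μ Λ z)) := by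
    intro μ
    rw [Module.End.mul_apply, B9Eq352GradLetters.diffLetter_inr, LinearMap.neg_apply, Pi.neg_apply, B9Eq352DivFormLetters.gradLetterB_apply,
      LinearMap.smul_apply, LinearMap.restrictScalars_apply, real_smul_fun, B9Eq39Adjoint.covDstar_smul]
    rfl
  have hnorm : ∀ v : 𝔸, ‖((η : ℂ))⁻¹ • ((((η ^ 2 : ℝ)) : ℂ) • v)‖ = η * ‖v‖ := fun v => by
    rw [norm_smul, norm_smul, norm_inv, Complex.norm_real, Complex.norm_real, Real.norm_eq_abs, Real.norm_eq_abs, abs_of_pos hη0,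
      abs_of_nonneg (by positivity)]
    field_simp
  rcases k with μ | μ
  · rw [hval μ, hnorm]
    have h1 : ‖cdS x.toKIdx U μ Λ z‖ ≤ eLatSC x.toKIdx (GpY x.toKIdx par) U U (liftY f E) (blkY x.toKIdx z) 1 :=
      (norm_le_supBlkS' x.toKIdx (blkY x.toKIdx z) (fun μ => cdS x.toKIdx U μ Λ) μ rfl).trans (le_max_left _ _)
    exact (mul_le_mul_of_nonneg_left h1 hη0.le).trans key
  · rw [hval' μ, norm_neg, hnorm]
    have h1 : ‖cdsS x.toKIdx U μ Λ z‖ ≤ eLatSC x.toKIdx (GpY x.toKIdx par) U U (liftY f E) (blkY x.toKIdx z) 1 :=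
      (norm_le_supBlkS' x.toKIdx (blkY x.toKIdx z) (fun μ => cdsS x.toKIdx U μ Λ) μ rfl).trans (le_max_right _ _)
    exact (mul_le_mul_of_nonneg_left h1 hη0.le).trans key


/-- ★ **ENTRY 2 OF THE READING** (right difference letters, forward AND backward): `‖(η²G′(U)·∇♯_k)(f ⊗ E)(z)‖ ≦ B₀(Lʲη)e^{−δd}·B`.
[cite: Balaban1985BackgroundPropagators, (3.42) p.397 (third entry), (3.3) p.390, (3.8) p.392] -/
theorem liftY_bound_two (hι : ∀ s : BlkY x.toKIdx, β x.toKIdx.hN x.toKIdx.D x.toKIdx.hk (ιB s) = s) {U : CfgY 𝔸 x.toKIdx} {B₀ δ : ℝ}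
    (hB₀ : 0 ≤ B₀) (hE : EBlock (KSC P G x par C37 C38) B₀ δ (.base U)) (k : Fin (d + 1) ⊕ Fin (d + 1))
    (f : SiteY x.toKIdx → ℝ) (E : 𝔸) (y' : IBondY x.toKIdx) (B : ℝ) (hE1 : ‖E‖ ≤ 1) (hB : 0 ≤ B)
    (hoff : ∀ z, blkC x.toKIdx ιB z ≠ y' → f z = 0) (hbd : ∀ z, |f z| ≤ B) (z : SiteY x.toKIdx) :
    ‖((((kGeo x.toKIdx).eta ^ 2) • (GpY x.toKIdx par U).restrictScalars ℝ) *
        diffLetter (shiftY x.toKIdx) (UboxY x.toKIdx U) ((((kGeo x.toKIdx).eta : ℂ))⁻¹) k) (liftY f E) z‖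
      ≤ (B₀ * (geo9Y x).len (blkC x.toKIdx ιB z) * Real.exp (-(δ * (geo9Y x).dist (blkC x.toKIdx ιB z) y'))) * B := by
  set η := (kGeo x.toKIdx).eta with hηdef
  have hη0 : 0 < η := B9GeoLemma21KLevelV1.geo9K_eta_pos x.toKIdx
  have key := eLatSC_le_of_eBlock P G x par ιB C37 C38 hι hB₀ hE 2 f E y' B hE1 hB hoff hbd z
  have hep : epow 2 = 1 := rfl
  have hpref : B9.pref4 ((geo9Y x).len (blkC x.toKIdx ιB z)) 2 = (geo9Y x).len (blkC x.toKIdx ιB z) := rfl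
  rw [hep, pow_one, hpref] at key
  set Λ₀ := liftY f E with hΛ₀
  have hF : ∀ μ, diffLetter (shiftY x.toKIdx) (UboxY x.toKIdx U) (((η : ℂ))⁻¹) (Sum.inl μ) Λ₀ = ((η : ℂ))⁻¹ • cdS x.toKIdx U μ Λ₀ := by
    intro μ; funext w; rw [B9Eq352GradLetters.diffLetter_inl, B9Eq352DivFormLetters.gradLetterF_apply]; rfl
  have hB' : ∀ μ, diffLetter (shiftY x.toKIdx) (UboxY x.toKIdx U) (((η : ℂ))⁻¹) (Sum.inr μ) Λ₀ = -(((η : ℂ))⁻¹ • cdsS x.toKIdx U μ Λ₀) := by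
    intro μ; funext w
    rw [B9Eq352GradLetters.diffLetter_inr, LinearMap.neg_apply, Pi.neg_apply, Pi.neg_apply, B9Eq352DivFormLetters.gradLetterB_apply]; rfl
  have hval : ∀ μ, ((((η ^ 2)) • (GpY x.toKIdx par U).restrictScalars ℝ) * diffLetter (shiftY x.toKIdx) (UboxY x.toKIdx U) (((η : ℂ))⁻¹) (Sum.inl μ))
        Λ₀ z = (η ^ 2 : ℝ) • (((η : ℂ))⁻¹ • GpY x.toKIdx par U (cdS x.toKIdx U μ Λ₀) z) := by
    intro μ
    simp only [Module.End.mul_apply, hF, map_smul, LinearMap.smul_apply, LinearMap.restrictScalars_apply, Pi.smul_apply]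
  have hval' : ∀ μ, ((((η ^ 2)) • (GpY x.toKIdx par U).restrictScalars ℝ) * diffLetter (shiftY x.toKIdx) (UboxY x.toKIdx U) (((η : ℂ))⁻¹) (Sum.inr μ))
        Λ₀ z = -((η ^ 2 : ℝ) • (((η : ℂ))⁻¹ • GpY x.toKIdx par U (cdsS x.toKIdx U μ Λ₀) z)) := by
    intro μ
    simp only [Module.End.mul_apply, hB', map_neg, map_smul, LinearMap.smul_apply, LinearMap.restrictScalars_apply, Pi.neg_apply, Pi.smul_apply]
  have hnorm : ∀ v : 𝔸, ‖(η ^ 2 : ℝ) • (((η : ℂ))⁻¹ • v)‖ = η * ‖v‖ := fun v => by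
    rw [norm_smul, norm_smul, norm_inv, Complex.norm_real, Real.norm_eq_abs, Real.norm_eq_abs, abs_of_pos hη0, abs_of_nonneg (by positivity)]
    field_simp
  rcases k with μ | μ
  · rw [hval μ, hnorm]
    have h1 : ‖GpY x.toKIdx par U (cdS x.toKIdx U μ Λ₀) z‖ ≤ eLatSC x.toKIdx (GpY x.toKIdx par) U U Λ₀ (blkY x.toKIdx z) 2 :=
      (norm_le_supBlkS' x.toKIdx (blkY x.toKIdx z) (fun μ => GpY x.toKIdx par U (cdS x.toKIdx U μ Λ₀)) μ rfl).trans (le_max_left _ _)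
    exact (mul_le_mul_of_nonneg_left h1 hη0.le).trans key
  · rw [hval' μ, norm_neg, hnorm]
    have h1 : ‖GpY x.toKIdx par U (cdsS x.toKIdx U μ Λ₀) z‖ ≤ eLatSC x.toKIdx (GpY x.toKIdx par) U U Λ₀ (blkY x.toKIdx z) 2 :=
      (norm_le_supBlkS' x.toKIdx (blkY x.toKIdx z) (fun μ => GpY x.toKIdx par U (cdsS x.toKIdx U μ Λ₀)) μ rfl).trans (le_max_right _ _)
    exact (mul_le_mul_of_nonneg_left h1 hη0.le).trans key

/-- ★ **ENTRY 3 OF THE READING** (the Laplacian letter): `‖(η⁻²Δ_U·η²G′(U))(f ⊗ E)(z)‖ ≦ B₀e^{−δd}·B`. [cite: Balaban1985BackgroundPropagators, (3.42) p.397 (fourth entry), (3.23) p.394] -/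
theorem liftY_bound_three (hι : ∀ s : BlkY x.toKIdx, β x.toKIdx.hN x.toKIdx.D x.toKIdx.hk (ιB s) = s) {U : CfgY 𝔸 x.toKIdx} {B₀ δ : ℝ}
    (hB₀ : 0 ≤ B₀) (hE : EBlock (KSC P G x par C37 C38) B₀ δ (.base U))
    (f : SiteY x.toKIdx → ℝ) (E : 𝔸) (y' : IBondY x.toKIdx) (B : ℝ) (hE1 : ‖E‖ ≤ 1) (hB : 0 ≤ B)
    (hoff : ∀ z, blkC x.toKIdx ιB z ≠ y' → f z = 0) (hbd : ∀ z, |f z| ≤ B) (z : SiteY x.toKIdx) :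
    ‖((((kGeo x.toKIdx).eta ^ 2)⁻¹ • (Node00.lapSL x.toKIdx U).restrictScalars ℝ) *
        (((kGeo x.toKIdx).eta ^ 2) • (GpY x.toKIdx par U).restrictScalars ℝ)) (liftY f E) z‖
      ≤ (B₀ * 1 * Real.exp (-(δ * (geo9Y x).dist (blkC x.toKIdx ιB z) y'))) * B := by
  set η := (kGeo x.toKIdx).eta with hηdef
  have hη0 : 0 < η := B9GeoLemma21KLevelV1.geo9K_eta_pos x.toKIdx
  have hη2 : (η ^ 2 : ℝ) ≠ 0 := pow_ne_zero 2 hη0.ne'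
  have key := eLatSC_le_of_eBlock P G x par ιB C37 C38 hι hB₀ hE 3 f E y' B hE1 hB hoff hbd z
  have hep : epow 3 = 0 := rfl
  have hpref : B9.pref4 ((geo9Y x).len (blkC x.toKIdx ιB z)) 3 = 1 := rfl
  rw [hep, pow_zero, one_mul, hpref] at key
  set Λ := GpY x.toKIdx par U (liftY f E) with hΛ
  have hval : ((((η ^ 2))⁻¹ • (Node00.lapSL x.toKIdx U).restrictScalars ℝ) * (((η ^ 2)) • (GpY x.toKIdx par U).restrictScalars ℝ)) (liftY f E) z
      = lapS x.toKIdx U Λ z := by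
    rw [Module.End.mul_apply, LinearMap.smul_apply, LinearMap.restrictScalars_apply, LinearMap.smul_apply, LinearMap.restrictScalars_apply,
      real_smul_fun (η ^ 2) (GpY x.toKIdx par U (liftY f E)), LinearMap.map_smul_of_tower, Node00.lapSL_apply, ← hΛ, Pi.smul_apply, Pi.smul_apply,
      ← Complex.coe_smul, smul_smul, ← Complex.ofReal_mul, inv_mul_cancel₀ hη2, Complex.ofReal_one, one_smul]
  rw [hval]
  have h1 : ‖lapS x.toKIdx U Λ z‖ ≤ eLatSC x.toKIdx (GpY x.toKIdx par) U U (liftY f E) (blkY x.toKIdx z) 3 :=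
    norm_le_supBlkS x.toKIdx (blkY x.toKIdx z) (lapS x.toKIdx U Λ) rfl
  exact h1.trans key

end Record


/-! ## §3 ★★ THE READING DICTIONARY `Read342Y` PROVED for the augmented family of record -/

section Read

open Literature.MathematicalPhysics.QuantumFieldTheory.Balaban1983to89.B6KLevelCensusIndexV1 (KIdx kGeo)
open Literature.MathematicalPhysics.QuantumFieldTheory.Balaban1983to89.B6Ineq2142KLevelV1 (β)
open Literature.MathematicalPhysics.QuantumFieldTheory.Balaban1983to89.B9Thm34Ext (toB6)
open Literature.MathematicalPhysics.QuantumFieldTheory.Balaban1983to89.B9FromB6 (EBlock)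
open Literature.MathematicalPhysics.QuantumFieldTheory.Balaban1983to89.B9Eq352GradLetters (diffLetter)
open Literature.MathematicalPhysics.QuantumFieldTheory.Balaban1983to89.B9SectBCodedCarrier (CCfg)
open Literature.MathematicalPhysics.QuantumFieldTheory.Balaban1983to89.B9Eq360DeltaPrimeAY (AfldY blkY)
open Literature.MathematicalPhysics.QuantumFieldTheory.Balaban1983to89.B9PinMembersKLevelV1 (MemberY geo9Y bg9Y)
open Literature.MathematicalPhysics.QuantumFieldTheory.Balaban1983to89.B9SectBGpLettersY (decY GVal coordC blkC ΔpC GopC LapC letters_base_of_gVal)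
open Literature.MathematicalPhysics.QuantumFieldTheory.Balaban1983to89.B9SectBGpFrameCodedYR (codingYx Read342Y Write342Y)
open Literature.MathematicalPhysics.QuantumFieldTheory.Balaban1983to89.Node00 (SiteY BlkY IBondY CfgY BallY SiteOpY SiteParY UboxY shiftY GpY)

variable {d ℓ : ℕ} {hd : 1 ≤ d + 1} {hL : Odd (ℓ + 1) ∧ 1 < ℓ + 1} {b₀ b₁ : ℝ} {Mstar : ℕ} (P : RegExtraY d ℓ hd hL b₀ b₁ Mstar 𝔸) [CompleteSpace 𝔸] [FiniteDimensional ℝ 𝔸]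
  (G : Subgroup 𝔸ˣ) (x : MemberY d ℓ hd hL b₀ b₁ Mstar) (par : SiteParY 𝔸 x.toKIdx) {ι : Type} [Fintype ι] (b : Module.Basis ι ℝ 𝔸)
  (ιB : BlkY x.toKIdx → IBondY x.toKIdx) [Fintype (geo9Y x).Site] (C37 C38 : ℝ → CfgY 𝔸 x.toKIdx → AfldY 𝔸 x.toKIdx → Prop)

/-- ★★ **THE (3.42) READING DICTIONARY OF THE ROOT FRAME, PROVED** for the augmented coded readings `KSC` of NODE 00's G′ (reading constant `c_R = M₂·Σ_j‖b_j‖`):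
the hypothesis `hread` of `B9SectBGpFrameCodedY.gpFrame₂Coded` at `KC := KSC G x par C37 C38`.
[cite: Balaban1985BackgroundPropagators, (3.42) p.397, (3.39) p.397; Balaban1984PropagatorsII, (2.51) p.232] -/
theorem read342Y_KSC (hι : ∀ s : BlkY x.toKIdx, β x.toKIdx.hN x.toKIdx.D x.toKIdx.hk (ιB s) = s)
    (M₂ : ℝ) (hM₂ : 0 ≤ M₂) (hrepr : ∀ (v : 𝔸) (j : ι), |b.repr v j| ≤ M₂ * ‖v‖) (c35 MInv aInv : ℝ) :
    Read342Y P G x par b ιB C37 C38 (KSC P G x par C37 C38) c35 (M₂ * ∑ j, ‖b j‖) MInv aInv 0 True := by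
  intro α₀ U B₀ δ _ _ _ hreg hB₀ _ hE
  have hU : GVal G x.toKIdx U := hreg.1.1
  have hco : coordC G x.toKIdx (.base U) = UboxY x.toKIdx U := (letters_base_of_gVal G x.toKIdx par hU).1
  set η := (kGeo x.toKIdx).eta with hηdef
  have hGop : GopC x.toKIdx par b (.base U) = conj b ((η ^ 2) • (GpY x.toKIdx par U).restrictScalars ℝ) := rfl
  have hLap : LapC x.toKIdx b (.base U) = conj b ((η ^ 2)⁻¹ • (Node00.lapSL x.toKIdx U).restrictScalars ℝ) := rfl
  refine ⟨?_, fun k => ?_, fun k => ?_, ?_⟩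
  · have h := hasMajorant_conj_of_liftY_bound b (g := toB6 (geo9Y x) 0 True) (fun z => blkC x.toKIdx ιB z)
      ((η ^ 2) • (GpY x.toKIdx par U).restrictScalars ℝ)
      (fun a a' => B₀ * (geo9Y x).len a ^ 2 * Real.exp (-(δ * (geo9Y x).dist a a'))) M₂ hM₂ hrepr
      (fun f E y' B hE1 hB hoff hbd z => liftY_bound_zero P G x par ιB C37 C38 hι hB₀.le hE f E y' B hE1 hB hoff hbd z)
    rw [hGop]
    intro y' μ B hμ p
    exact (h y' μ B hμ p).trans (le_of_eq (by ring))
  · have h := hasMajorant_conj_of_liftY_bound b (g := toB6 (geo9Y x) 0 True) (fun z => blkC x.toKIdx ιB z)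
      (diffLetter (shiftY x.toKIdx) (UboxY x.toKIdx U) (((η : ℂ))⁻¹) k * ((η ^ 2) • (GpY x.toKIdx par U).restrictScalars ℝ))
      (fun a a' => B₀ * (geo9Y x).len a * Real.exp (-(δ * (geo9Y x).dist a a'))) M₂ hM₂ hrepr
      (fun f E y' B hE1 hB hoff hbd z => liftY_bound_one P G x par ιB C37 C38 hι hB₀.le hE k f E y' B hE1 hB hoff hbd z)
    rw [hco, hGop, ← B9Eq352DivFormLetters.conj_mul]
    intro y' μ B hμ p
    exact (h y' μ B hμ p).trans (le_of_eq (by ring))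
  · have h := hasMajorant_conj_of_liftY_bound b (g := toB6 (geo9Y x) 0 True) (fun z => blkC x.toKIdx ιB z)
      (((η ^ 2) • (GpY x.toKIdx par U).restrictScalars ℝ) * diffLetter (shiftY x.toKIdx) (UboxY x.toKIdx U) (((η : ℂ))⁻¹) k)
      (fun a a' => B₀ * (geo9Y x).len a * Real.exp (-(δ * (geo9Y x).dist a a'))) M₂ hM₂ hrepr
      (fun f E y' B hE1 hB hoff hbd z => liftY_bound_two P G x par ιB C37 C38 hι hB₀.le hE k f E y' B hE1 hB hoff hbd z)
    rw [hco, hGop, ← B9Eq352DivFormLetters.conj_mul]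
    intro y' μ B hμ p
    exact (h y' μ B hμ p).trans (le_of_eq (by ring))
  · have h := hasMajorant_conj_of_liftY_bound b (g := toB6 (geo9Y x) 0 True) (fun z => blkC x.toKIdx ιB z)
      ((((η ^ 2))⁻¹ • (Node00.lapSL x.toKIdx U).restrictScalars ℝ) * ((η ^ 2) • (GpY x.toKIdx par U).restrictScalars ℝ))
      (fun a a' => B₀ * 1 * Real.exp (-(δ * (geo9Y x).dist a a'))) M₂ hM₂ hrepr
      (fun f E y' B hE1 hB hoff hbd z => liftY_bound_three P G x par ιB C37 C38 hι hB₀.le hE f E y' B hE1 hB hoff hbd z)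
    rw [hLap, hGop, ← B9Eq352DivFormLetters.conj_mul]
    intro y' μ B hμ p
    exact (h y' μ B hμ p).trans (le_of_eq (by ring))

end Read

/-! ## §4 ★★ THE WRITING DICTIONARY `Write342Y` PROVED for the augmented family of record -/

section Write

open Literature.MathematicalPhysics.QuantumFieldTheory.Balaban1983to89.B6KLevelCensusIndexV1 (KIdx kGeo)
open Literature.MathematicalPhysics.QuantumFieldTheory.Balaban1983to89.B6Ineq2142KLevelV1 (β lvl beta_level)
open Literature.MathematicalPhysics.QuantumFieldTheory.Balaban1983to89.B6Prop22KLevelCensusEta (epow)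
open Literature.MathematicalPhysics.QuantumFieldTheory.Balaban1983to89.B9Thm34Ext (toB6)
open Literature.MathematicalPhysics.QuantumFieldTheory.Balaban1983to89.B9FromB6 (EBlock)
open Literature.MathematicalPhysics.QuantumFieldTheory.Balaban1983to89.B9Eq39Adjoint (fluct)
open Literature.MathematicalPhysics.QuantumFieldTheory.Balaban1983to89.B9Eq352GradLetters (diffLetter)
open Literature.MathematicalPhysics.QuantumFieldTheory.Balaban1983to89.B9SectBCodedCarrier (CCfg)
open Literature.MathematicalPhysics.QuantumFieldTheory.Balaban1983to89.B9Eq360DeltaPrimeAY (AfldY blkY blkY_apply mulY)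
open Literature.MathematicalPhysics.QuantumFieldTheory.Balaban1983to89.B9PinMembersKLevelV1 (MemberY geo9Y bg9Y)
open Literature.MathematicalPhysics.QuantumFieldTheory.Balaban1983to89.B9SectBGpLettersY (decY GVal coordC blkC ΔpC GopC LapC letters_base_of_gVal)
open Literature.MathematicalPhysics.QuantumFieldTheory.Balaban1983to89.B9SectBGpFrameCodedYR (codingYx Read342Y Write342Y)
open Literature.MathematicalPhysics.QuantumFieldTheory.Balaban1983to89.Node00 (SiteY BlkY IBondY CfgY BallY SiteOpY SiteParY UboxY shiftY cdS cdsS lapS etaS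
  supBlkS supBlkS' GpY)

variable {d ℓ : ℕ} {hd : 1 ≤ d + 1} {hL : Odd (ℓ + 1) ∧ 1 < ℓ + 1} {b₀ b₁ : ℝ} {Mstar : ℕ} (P : RegExtraY d ℓ hd hL b₀ b₁ Mstar 𝔸) [CompleteSpace 𝔸] [FiniteDimensional ℝ 𝔸]
  (G : Subgroup 𝔸ˣ) (x : MemberY d ℓ hd hL b₀ b₁ Mstar) (par : SiteParY 𝔸 x.toKIdx) {ι : Type} [Fintype ι] (b : Module.Basis ι ℝ 𝔸)
  (ιB : BlkY x.toKIdx → IBondY x.toKIdx) (C37 C38 : ℝ → CfgY 𝔸 x.toKIdx → AfldY 𝔸 x.toKIdx → Prop)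

variable [Fintype (geo9Y x).Site]

omit [FiniteDimensional ℝ 𝔸] in
/-- ★★ **THE (3.42) WRITING DICTIONARY OF THE ROOT FRAME, PROVED** for the augmented coded readings `KSC` of NODE 00's G′ (writing functions
`w_B(B,δ) = (M₂Σ_j‖b_j‖)·B + 1`, `w_δ(δ) = δ`; any `a_W`): the hypothesis `hwrite` of `B9SectBGpFrameCodedY.gpFrame₂Coded` at `KC := KSC G x par C37 C38`.
The differences and the Laplacian of the reading at the coded product `prod U a` are taken AT THE BASE `U`, as the frame's letters are.
[cite: Balaban1985BackgroundPropagators, (3.42) p.397, p.403 («of course with different constants»); Balaban1984PropagatorsII, (2.51) p.232] -/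
theorem write342Y_KSC (hι : ∀ s : BlkY x.toKIdx, β x.toKIdx.hN x.toKIdx.D x.toKIdx.hk (ιB s) = s)
    (M₂ : ℝ) (hM₂ : 0 ≤ M₂) (hrepr : ∀ (v : 𝔸) (j : ι), |b.repr v j| ≤ M₂ * ‖v‖) (aW : ℝ)
    (hC37 : ∀ β U a, C37 β U a → GVal G x.toKIdx U) :
    Write342Y P G x par b ιB C37 C38 (KSC P G x par C37 C38) (fun B _ => (M₂ * ∑ j, ‖b j‖) * B + 1) (fun δ => δ) aW 0 True := by
  intro U a α₁ B δ _ _ h37 hB hδ hG hDG hGD hLG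
  have hU : GVal G x.toKIdx U := hC37 α₁ U a h37
  have hco : coordC G x.toKIdx (.base U) = UboxY x.toKIdx U := (letters_base_of_gVal G x.toKIdx par hU).1
  set η := (kGeo x.toKIdx).eta with hηdef
  have hη0 : 0 < η := B9GeoLemma21KLevelV1.geo9K_eta_pos x.toKIdx
  set c₀ : ℝ := M₂ * ∑ j, ‖b j‖ with hc₀
  have hc₀0 : 0 ≤ c₀ := mul_nonneg hM₂ (Finset.sum_nonneg fun j _ => norm_nonneg _)
  set V := mulY x.toKIdx (fluct (kGeo x.toKIdx).eta a) U with hV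
  have hGop : GopC x.toKIdx par b (.prod U a) = conj b ((η ^ 2) • (GpY x.toKIdx par V).restrictScalars ℝ) := rfl
  have hLap : LapC x.toKIdx b (.base U) = conj b ((η ^ 2)⁻¹ • (Node00.lapSL x.toKIdx U).restrictScalars ℝ) := rfl
  rw [hco] at hDG hGD
  rw [hGop] at hG hDG hGD hLG
  rw [hLap] at hLG
  intro n lam y y' hsupp
  have hlen : 0 ≤ (geo9Y x).len y := (B9GeoLemma21KLevelV1.geo9Y_len_pos x y).le
  have hp : 0 ≤ B9.pref4 ((geo9Y x).len y) n := by
    match n with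
    | 0 => exact pow_nonneg hlen 2
    | 1 => exact hlen
    | 2 => exact hlen
    | 3 => exact zero_le_one
  have hRHS : 0 ≤ (c₀ * B + 1) * B9.pref4 ((geo9Y x).len y) n * Real.exp (-(δ * (geo9Y x).dist y y')) * (geo9Y x).supNorm lam := by
    have := supNorm_nonneg x lam
    positivity
  cases lam with
  | inr J => rw [KSC, kernelFamilySC_e_inr]; exact hRHS
  | inl f =>
    set B' := (geo9Y x).supNorm (.inl f) with hB'
    have hB'0 : 0 ≤ B' := supNorm_nonneg x (.inl f)
    have hbd : ∀ w, |f w| ≤ B' := abs_le_supNorm_inl x f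
    have hoff : ∀ w, blkC x.toKIdx ιB w ≠ ιB (β x.toKIdx.hN x.toKIdx.D x.toKIdx.hk y') → f w = 0 := off_of_suppIn_inl x ιB hsupp
    have hlab : ∀ w, B6Geom246MultiLevelBox.blkOf x.toKIdx.D.toDomains w = β x.toKIdx.hN x.toKIdx.D x.toKIdx.hk y →
        blkC x.toKIdx ιB w = ιB (β x.toKIdx.hN x.toKIdx.D x.toKIdx.hk y) := fun w hw => by rw [blkC, blkY_apply, hw]
    set ex := Real.exp (-(δ * (geo9Y x).dist y y')) with hex
    have hex0 : 0 ≤ ex := (Real.exp_pos _).le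
    rw [KSC, kernelFamilySC_e_inl, etaS_eq_eta x]
    show η ^ (epow n) * (⨆ E : BallY 𝔸, eLatSC x.toKIdx (GpY x.toKIdx par) U V (liftY f (E : 𝔸)) (β x.toKIdx.hN x.toKIdx.D x.toKIdx.hk y) n)
      ≤ (c₀ * B + 1) * B9.pref4 ((geo9Y x).len y) n * ex * B'
    -- the pointwise bounds at a direction `E` of the ball and a site `w` of the block `y`
    have pw : ∀ (E : BallY 𝔸) (w : SiteY x.toKIdx), B6Geom246MultiLevelBox.blkOf x.toKIdx.D.toDomains w = β x.toKIdx.hN x.toKIdx.D x.toKIdx.hk y →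
        η ^ 2 * ‖GpY x.toKIdx par V (liftY f (E : 𝔸)) w‖ ≤ c₀ * (B * (geo9Y x).len y ^ 2 * ex) * B' ∧
        (∀ μ, η * ‖cdS x.toKIdx U μ (GpY x.toKIdx par V (liftY f (E : 𝔸))) w‖ ≤ c₀ * (B * (geo9Y x).len y * ex) * B') ∧
        (∀ μ, η * ‖cdsS x.toKIdx U μ (GpY x.toKIdx par V (liftY f (E : 𝔸))) w‖ ≤ c₀ * (B * (geo9Y x).len y * ex) * B') ∧
        (∀ μ, η * ‖GpY x.toKIdx par V (cdS x.toKIdx U μ (liftY f (E : 𝔸))) w‖ ≤ c₀ * (B * (geo9Y x).len y * ex) * B') ∧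
        (∀ μ, η * ‖GpY x.toKIdx par V (cdsS x.toKIdx U μ (liftY f (E : 𝔸))) w‖ ≤ c₀ * (B * (geo9Y x).len y * ex) * B') ∧
        ‖lapS x.toKIdx U (GpY x.toKIdx par V (liftY f (E : 𝔸))) w‖ ≤ c₀ * (B * 1 * ex) * B' := by
      intro E w hw
      have hE1 : ‖(E : 𝔸)‖ ≤ 1 := mem_closedBall_zero_iff.1 E.2
      have hL := norm_letters x par U V (liftY f (E : 𝔸)) w
      have W := fun (T : Module.End ℝ (SiteY x.toKIdx → 𝔸)) (K : IBondY x.toKIdx → IBondY x.toKIdx → ℝ)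
        (h : HasMajorant (g := toB6 (geo9Y x) 0 True) (fun p : SiteY x.toKIdx × ι => blkC x.toKIdx ιB p.1) (conj b T) K) =>
        liftY_bound_of_hasMajorant_conj b (g := toB6 (geo9Y x) 0 True) (fun z => blkC x.toKIdx ιB z) T K M₂ hM₂ hrepr h f (E : 𝔸)
          (ιB (β x.toKIdx.hN x.toKIdx.D x.toKIdx.hk y')) B' hE1 hB'0 hoff hbd w
      refine ⟨?_, fun μ => ?_, fun μ => ?_, fun μ => ?_, fun μ => ?_, ?_⟩
      · have h := W _ _ hG
        rw [(hL 0).1, hlab w hw, len_label x ιB hι, dist_label x ιB hι] at h; exact h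
      · have h := W _ _ (by rw [B9Eq352DivFormLetters.conj_mul]; exact hDG (Sum.inl μ))
        rw [(hL μ).2.1, hlab w hw, len_label x ιB hι, dist_label x ιB hι] at h; exact h
      · have h := W _ _ (by rw [B9Eq352DivFormLetters.conj_mul]; exact hDG (Sum.inr μ))
        rw [(hL μ).2.2.1, hlab w hw, len_label x ιB hι, dist_label x ιB hι] at h; exact h
      · have h := W _ _ (by rw [B9Eq352DivFormLetters.conj_mul]; exact hGD (Sum.inl μ))
        rw [(hL μ).2.2.2.1, hlab w hw, len_label x ιB hι, dist_label x ιB hι] at h; exact h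
      · have h := W _ _ (by rw [B9Eq352DivFormLetters.conj_mul]; exact hGD (Sum.inr μ))
        rw [(hL μ).2.2.2.2.1, hlab w hw, len_label x ιB hι, dist_label x ιB hι] at h; exact h
      · have h := W _ _ (by rw [B9Eq352DivFormLetters.conj_mul]; exact hLG)
        rw [(hL 0).2.2.2.2.2, hlab w hw, dist_label x ιB hι] at h; exact h
    -- the bound of every direction, per entry
    have hdir : ∀ E : BallY 𝔸, η ^ (epow n) * eLatSC x.toKIdx (GpY x.toKIdx par) U V (liftY f (E : 𝔸)) (β x.toKIdx.hN x.toKIdx.D x.toKIdx.hk y) n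
        ≤ c₀ * B * B9.pref4 ((geo9Y x).len y) n * ex * B' := by
      intro E
      set Λ₀ := liftY f (E : 𝔸) with hΛ₀
      set s₀ := β x.toKIdx.hN x.toKIdx.D x.toKIdx.hk y with hs₀
      match n with
      | 0 =>
        show η ^ 2 * supBlkS x.toKIdx s₀ (GpY x.toKIdx par V Λ₀) ≤ c₀ * B * ((geo9Y x).len y ^ 2) * ex * B'
        have hC : 0 ≤ c₀ * B * ((geo9Y x).len y ^ 2) * ex * B' / η ^ 2 := by positivity
        have hs : supBlkS x.toKIdx s₀ (GpY x.toKIdx par V Λ₀) ≤ c₀ * B * ((geo9Y x).len y ^ 2) * ex * B' / η ^ 2 :=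
          B9Ineq349SiteComposite.supBlkS_le x.toKIdx _ _ hC fun w hw => by
            rw [le_div_iff₀ (by positivity), mul_comm]; exact ((pw E w hw).1).trans (le_of_eq (by ring))
        calc η ^ 2 * supBlkS x.toKIdx s₀ (GpY x.toKIdx par V Λ₀) ≤ η ^ 2 * (c₀ * B * ((geo9Y x).len y ^ 2) * ex * B' / η ^ 2) :=
              mul_le_mul_of_nonneg_left hs (by positivity)
          _ = _ := mul_div_cancel₀ _ (by positivity)
      | 1 =>
        show η ^ 1 * max (supBlkS' x.toKIdx s₀ (fun μ => cdS x.toKIdx U μ (GpY x.toKIdx par V Λ₀)))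
            (supBlkS' x.toKIdx s₀ (fun μ => cdsS x.toKIdx U μ (GpY x.toKIdx par V Λ₀))) ≤ c₀ * B * (geo9Y x).len y * ex * B'
        rw [pow_one]
        have hC : 0 ≤ c₀ * B * (geo9Y x).len y * ex * B' / η := by positivity
        have hs : max (supBlkS' x.toKIdx s₀ (fun μ => cdS x.toKIdx U μ (GpY x.toKIdx par V Λ₀)))
            (supBlkS' x.toKIdx s₀ (fun μ => cdsS x.toKIdx U μ (GpY x.toKIdx par V Λ₀))) ≤ c₀ * B * (geo9Y x).len y * ex * B' / η :=
          max_le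
            (B9Ineq349SiteComposite.supBlkS'_le x.toKIdx _ _ hC fun w μ hw => by
              rw [le_div_iff₀ hη0, mul_comm]; exact ((pw E w hw).2.1 μ).trans (le_of_eq (by ring)))
            (B9Ineq349SiteComposite.supBlkS'_le x.toKIdx _ _ hC fun w μ hw => by
              rw [le_div_iff₀ hη0, mul_comm]; exact ((pw E w hw).2.2.1 μ).trans (le_of_eq (by ring)))
        calc η * max _ _ ≤ η * (c₀ * B * (geo9Y x).len y * ex * B' / η) := mul_le_mul_of_nonneg_left hs hη0.le
          _ = _ := mul_div_cancel₀ _ hη0.ne'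
      | 2 =>
        show η ^ 1 * max (supBlkS' x.toKIdx s₀ (fun μ => GpY x.toKIdx par V (cdS x.toKIdx U μ Λ₀)))
            (supBlkS' x.toKIdx s₀ (fun μ => GpY x.toKIdx par V (cdsS x.toKIdx U μ Λ₀))) ≤ c₀ * B * (geo9Y x).len y * ex * B'
        rw [pow_one]
        have hC : 0 ≤ c₀ * B * (geo9Y x).len y * ex * B' / η := by positivity
        have hs : max (supBlkS' x.toKIdx s₀ (fun μ => GpY x.toKIdx par V (cdS x.toKIdx U μ Λ₀)))
            (supBlkS' x.toKIdx s₀ (fun μ => GpY x.toKIdx par V (cdsS x.toKIdx U μ Λ₀))) ≤ c₀ * B * (geo9Y x).len y * ex * B' / η :=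
          max_le
            (B9Ineq349SiteComposite.supBlkS'_le x.toKIdx _ _ hC fun w μ hw => by
              rw [le_div_iff₀ hη0, mul_comm]; exact ((pw E w hw).2.2.2.1 μ).trans (le_of_eq (by ring)))
            (B9Ineq349SiteComposite.supBlkS'_le x.toKIdx _ _ hC fun w μ hw => by
              rw [le_div_iff₀ hη0, mul_comm]; exact ((pw E w hw).2.2.2.2.1 μ).trans (le_of_eq (by ring)))
        calc η * max _ _ ≤ η * (c₀ * B * (geo9Y x).len y * ex * B' / η) := mul_le_mul_of_nonneg_left hs hη0.le
          _ = _ := mul_div_cancel₀ _ hη0.ne'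
      | 3 =>
        show η ^ 0 * supBlkS x.toKIdx s₀ (lapS x.toKIdx U (GpY x.toKIdx par V Λ₀)) ≤ c₀ * B * 1 * ex * B'
        rw [pow_zero, one_mul]
        exact B9Ineq349SiteComposite.supBlkS_le x.toKIdx _ _ (by positivity) fun w hw => ((pw E w hw).2.2.2.2.2).trans (le_of_eq (by ring))
    have hsup : (⨆ E : BallY 𝔸, eLatSC x.toKIdx (GpY x.toKIdx par) U V (liftY f (E : 𝔸)) (β x.toKIdx.hN x.toKIdx.D x.toKIdx.hk y) n)
        ≤ c₀ * B * B9.pref4 ((geo9Y x).len y) n * ex * B' / η ^ (epow n) := by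
      have hηn : 0 < η ^ (epow n) := pow_pos hη0 _
      exact Node00.iSup_ball_le (fun E => by rw [le_div_iff₀ hηn, mul_comm]; exact hdir E) (by positivity)
    have hηn : 0 < η ^ (epow n) := pow_pos hη0 _
    calc η ^ (epow n) * (⨆ E : BallY 𝔸, eLatSC x.toKIdx (GpY x.toKIdx par) U V (liftY f (E : 𝔸)) (β x.toKIdx.hN x.toKIdx.D x.toKIdx.hk y) n)
        ≤ η ^ (epow n) * (c₀ * B * B9.pref4 ((geo9Y x).len y) n * ex * B' / η ^ (epow n)) := mul_le_mul_of_nonneg_left hsup hηn.le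
      _ = c₀ * B * B9.pref4 ((geo9Y x).len y) n * ex * B' := mul_div_cancel₀ _ hηn.ne'
      _ ≤ (c₀ * B + 1) * B9.pref4 ((geo9Y x).len y) n * ex * B' := by
          have : 0 ≤ B9.pref4 ((geo9Y x).len y) n * ex * B' := by positivity
          nlinarith

end Write

end Literature.MathematicalPhysics.QuantumFieldTheory.Balaban1983to89.B9SectBGpReadingsYR

/-!
# `Balaban1983to89.B9SectBGpReadingsYProdR` — THE CLASS-PARAMETRIC TWIN of `B9SectBGpReadingsYProd` (CASCADE-R, director-ym №279 GO-R; №277 (3) `hunitA` cure; dag-n06-d SOCKET-(α) class question)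

statement-level skeleton of published theorems with citation tags; proofs where landed; nothing here is a claim about the
Yang–Mills mass gap

WHAT THIS FILE IS.  The original module `B9SectBGpReadingsYProd` types its objects over MODULE 3's member carrier `bg9Y 𝔸 G x` (MODULE 2's small-cube class (3.35)).  This file RE-DECLARES, with UNCHANGED NAMES inside the namespace `…B9SectBGpReadingsYProdR`, exactly its 7 class-dependent declarations over the CLASS-PARAMETRIC carrier `B9SectBCodedClassR.bg9YC 𝔸 G P x` (`P : RegExtraY …` = the two cube conditions of (3.35)∕(3.36) as a parameter; `bg9Y 𝔸 G x = bg9YC 𝔸 G (extraY 𝔸 G) x` by `rfl`, so every declaration here specialises definitionally to its original; at the record's reading of PRINT's class, `P := extraYPb 𝔸 G`, the displayed laws `hreg335P` ((3.35) on plaquettes) and the class-keyed `hunitA` become theorems).  The text is the original's VERBATIM under the token surgery `bg9Y 𝔸 G ↦ bg9YC 𝔸 G P`, `NAME ↦ NAME P` for the class-dependent names (P the first explicit argument), and — №277 — the binder `hunitA` re-keyed from «all G-valued U» to «all (3.35)-regular U of the carrier» (`∀ j α₀ U, (bg9YC 𝔸 G P (f j)).Reg335 c35 α₀ U → IsUnit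 (deltaAY …)`).  Class-free declarations of the original are NOT copied: they are imported and used BY NAME (`open … hiding` the re-declared ones).  Generated by dag-n06-c g16's `gen.py` (HOME `pub-ymgap-dag-n06-c/lean/g16/`); the ORIGINAL MODULE DOCUMENTATION FOLLOWS VERBATIM and describes the mathematics.

HONEST SCOPE.  Re-typing bookkeeping; nothing of [B9] asserted beyond the original; COUNT-NEUTRAL; N06 NOT discharged; nothing continuum ∕ OS ∕ mass gap ∕ Clay.  Cell `pub-ymgap` (D-0062), Track A node N06 [B9], seat `pub-ymgap-dag-n06-c` g16, 2026-08-29.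
-/

/-! Module documentation: that of the original `Balaban1983to89.B9SectBGpReadingsYProd` applies verbatim to this twin (not repeated here). -/

noncomputable section

namespace Literature.MathematicalPhysics.QuantumFieldTheory.Balaban1983to89.B9SectBGpReadingsYProdR

open Literature.MathematicalPhysics.QuantumFieldTheory.Balaban1983to89.B9SectBCodedClassR (RegExtraY bg9YC)
open Literature.MathematicalPhysics.QuantumFieldTheory.Balaban1983to89.B9SectBGpReadingsYProd hiding liftY_bound_zero_cc eLatSC_le_of_eBlock_cc liftY_bound_one_cc liftY_bound_two_cc liftY_bound_three_cc hasMajorant_letters_cc_of_eBlock hasMajorant_letters_prod_of_eBlock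

open Literature.MathematicalPhysics.QuantumFieldTheory.Balaban1983to89.B6RandomWalk (HasMajorant BlockSupp)
open Literature.MathematicalPhysics.QuantumFieldTheory.Balaban1983to89.B9Eq352DivFormLetters (conj)
open Literature.MathematicalPhysics.QuantumFieldTheory.Balaban1983to89.Node00 (liftY liftY_apply)
open Literature.MathematicalPhysics.QuantumFieldTheory.Balaban1983to89.B6KLevelCensusIndexV1 (KIdx kGeo)
open Literature.MathematicalPhysics.QuantumFieldTheory.Balaban1983to89.B6Ineq2142KLevelV1 (β)
open Literature.MathematicalPhysics.QuantumFieldTheory.Balaban1983to89.B6Prop22KLevelCensusEta (epow)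
open Literature.MathematicalPhysics.QuantumFieldTheory.Balaban1983to89.B9Thm34Ext (toB6)
open Literature.MathematicalPhysics.QuantumFieldTheory.Balaban1983to89.B9FromB6 (EBlock)
open Literature.MathematicalPhysics.QuantumFieldTheory.Balaban1983to89.B9Eq39Adjoint (fluct)
open Literature.MathematicalPhysics.QuantumFieldTheory.Balaban1983to89.B9Eq352GradLetters (diffLetter)
open Literature.MathematicalPhysics.QuantumFieldTheory.Balaban1983to89.B9SectBCodedCarrier (CCfg)
open Literature.MathematicalPhysics.QuantumFieldTheory.Balaban1983to89.B9Eq360DeltaPrimeAY (AfldY blkY blkY_apply mulY)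
open Literature.MathematicalPhysics.QuantumFieldTheory.Balaban1983to89.B9PinMembersKLevelV1 (MemberY geo9Y bg9Y)
open Literature.MathematicalPhysics.QuantumFieldTheory.Balaban1983to89.B9SectBGpLettersY (decY GVal coordC blkC ΔpC GopC LapC)
open Literature.MathematicalPhysics.QuantumFieldTheory.Balaban1983to89.B9SectBGpFrameCodedYR (codingYx)
open Literature.MathematicalPhysics.QuantumFieldTheory.Balaban1983to89.B9Thm314WholeExpansionReads (le_iSup_ball)
open Literature.MathematicalPhysics.QuantumFieldTheory.Balaban1983to89.B9SectBGpReadingsYR (KSC)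
open Literature.MathematicalPhysics.QuantumFieldTheory.Balaban1983to89.B9SectBGpReadingsY (baseY eLatSC kernelFamilySC_e_inl etaS_eq_eta suppIn_inl_of_blkC supNorm_inl_le exists_ball_bound exists_ball_bound_eLatSC real_smul_fun norm_le_supBlkS norm_le_supBlkS' hasMajorant_conj_of_liftY_bound)
open Literature.MathematicalPhysics.QuantumFieldTheory.Balaban1983to89.Node00 (SiteY BlkY IBondY CfgY BallY SiteOpY SiteParY UboxY shiftY cdS cdsS lapS
  etaS supBlkS supBlkS' GpY)

variable {𝔸 : Type} [NormedRing 𝔸] [NormedAlgebra ℂ 𝔸]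

/-! ## §1 The four pointwise readings at an arbitrary coded configuration -/

section Record

variable {d ℓ : ℕ} {hd : 1 ≤ d + 1} {hL : Odd (ℓ + 1) ∧ 1 < ℓ + 1} {b₀ b₁ : ℝ} {Mstar : ℕ} (P : RegExtraY d ℓ hd hL b₀ b₁ Mstar 𝔸) [CompleteSpace 𝔸] [FiniteDimensional ℝ 𝔸]
  (G : Subgroup 𝔸ˣ) (x : MemberY d ℓ hd hL b₀ b₁ Mstar) (par : SiteParY 𝔸 x.toKIdx) {ι : Type} [Fintype ι] (b : Module.Basis ι ℝ 𝔸)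
  (ιB : BlkY x.toKIdx → IBondY x.toKIdx) (C37 C38 : ℝ → CfgY 𝔸 x.toKIdx → AfldY 𝔸 x.toKIdx → Prop)

/-- ★ **ENTRY 0 OF THE READING**: the (3.42) block of the augmented family at ANY coded configuration `c` bounds `η²‖(G′(dec c)(f ⊗ E))(z)‖` for `f` supported in the labelled
block `y′`, `|f| ≦ B`, `‖E‖ ≦ 1`, by `(η/η_S)²·B₀·(Lʲη)²e^{−δd(y(z),y′)}·B`. [cite: Balaban1985BackgroundPropagators, (3.42) p.397 (first entry)] -/
theorem liftY_bound_zero_cc (hι : ∀ s : BlkY x.toKIdx, β x.toKIdx.hN x.toKIdx.D x.toKIdx.hk (ιB s) = s) {c : CCfg (CfgY 𝔸 x.toKIdx) (AfldY 𝔸 x.toKIdx)} {B₀ δ : ℝ}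
    (hB₀ : 0 ≤ B₀) (hE : EBlock (KSC P G x par C37 C38) B₀ δ c)
    (f : SiteY x.toKIdx → ℝ) (E : 𝔸) (y' : IBondY x.toKIdx) (B : ℝ) (hE1 : ‖E‖ ≤ 1) (hB : 0 ≤ B)
    (hoff : ∀ z, blkC x.toKIdx ιB z ≠ y' → f z = 0) (hbd : ∀ z, |f z| ≤ B) (z : SiteY x.toKIdx) :
    ‖(((kGeo x.toKIdx).eta ^ 2) • (GpY x.toKIdx par (decY x.toKIdx c)).restrictScalars ℝ) (liftY f E) z‖
      ≤ (B₀ * (geo9Y x).len (blkC x.toKIdx ιB z) ^ 2 * Real.exp (-(δ * (geo9Y x).dist (blkC x.toKIdx ιB z) y'))) * B := by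
  set η := (kGeo x.toKIdx).eta with hηdef
  have hη0 : 0 < η := B9GeoLemma21KLevelV1.geo9K_eta_pos x.toKIdx
  have hblk : β x.toKIdx.hN x.toKIdx.D x.toKIdx.hk (blkC x.toKIdx ιB z) = blkY x.toKIdx z := by rw [blkC, hι]
  -- the reading at the labelled block of `z`
  have hread := hE 0 (.inl f) (blkC x.toKIdx ιB z) y' (suppIn_inl_of_blkC x ιB hι hoff)
  rw [KSC, kernelFamilySC_e_inl, hblk] at hread
  have hpref : B9.pref4 ((geo9Y x).len (blkC x.toKIdx ιB z)) 0 = (geo9Y x).len (blkC x.toKIdx ιB z) ^ 2 := rfl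
  have hep : epow 0 = 2 := rfl
  rw [hpref, hep, etaS_eq_eta] at hread
  -- the term: η²·‖(G′(U)(f ⊗ E))(z)‖
  have hval : (((kGeo x.toKIdx).eta ^ 2) • (GpY x.toKIdx par (decY x.toKIdx c)).restrictScalars ℝ) (liftY f E) z = (η ^ 2 : ℝ) • GpY x.toKIdx par (decY x.toKIdx c) (liftY f E) z := rfl
  rw [hval, norm_smul, Real.norm_eq_abs, abs_of_nonneg (by positivity)]
  -- ‖(G′(U)(f ⊗ E))(z)‖ ≤ the block sup ≤ the sup over the ball
  obtain ⟨C, -, hC⟩ := exists_ball_bound x ((GpY x.toKIdx par (decY x.toKIdx c)).restrictScalars ℝ) f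
  have h1 : ‖GpY x.toKIdx par (decY x.toKIdx c) (liftY f E) z‖ ≤ supBlkS x.toKIdx (blkY x.toKIdx z) (GpY x.toKIdx par (decY x.toKIdx c) (liftY f E)) :=
    norm_le_supBlkS x.toKIdx _ _ rfl
  have h2 : supBlkS x.toKIdx (blkY x.toKIdx z) (GpY x.toKIdx par (decY x.toKIdx c) (liftY f E))
      ≤ ⨆ E' : BallY 𝔸, eLatSC x.toKIdx (GpY x.toKIdx par) (baseY x.toKIdx c) (decY x.toKIdx c) (liftY f (E' : 𝔸)) (blkY x.toKIdx z) 0 := by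
    have := le_iSup_ball (A := fun E' : BallY 𝔸 => eLatSC x.toKIdx (GpY x.toKIdx par) (baseY x.toKIdx c) (decY x.toKIdx c) (liftY f (E' : 𝔸)) (blkY x.toKIdx z) 0)
      ⟨C, fun E' => B9Ineq349SiteComposite.supBlkS_le x.toKIdx _ _ (le_trans (norm_nonneg _) (hC E' z)) fun w _ => hC E' w⟩
      ⟨E, mem_closedBall_zero_iff.2 hE1⟩
    exact this
  have hsup : (geo9Y x).supNorm (.inl f) ≤ B := supNorm_inl_le x hB hbd
  have h3 : η ^ 2 * (⨆ E' : BallY 𝔸, eLatSC x.toKIdx (GpY x.toKIdx par) (baseY x.toKIdx c) (decY x.toKIdx c) (liftY f (E' : 𝔸)) (blkY x.toKIdx z) 0)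
      ≤ B₀ * (geo9Y x).len (blkC x.toKIdx ιB z) ^ 2 * Real.exp (-(δ * (geo9Y x).dist (blkC x.toKIdx ιB z) y')) * B :=
    hread.trans (mul_le_mul_of_nonneg_left hsup (by positivity))
  calc η ^ 2 * ‖GpY x.toKIdx par (decY x.toKIdx c) (liftY f E) z‖
      ≤ η ^ 2 * ⨆ E' : BallY 𝔸, eLatSC x.toKIdx (GpY x.toKIdx par) (baseY x.toKIdx c) (decY x.toKIdx c) (liftY f (E' : 𝔸)) (blkY x.toKIdx z) 0 :=
        mul_le_mul_of_nonneg_left (h1.trans h2) (by positivity)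
    _ ≤ _ := h3


/-- the reading of the augmented family at a coded configuration `c` (letters at `baseY c`, operator at `decY c`), read at the labelled block of `z`, unfolded and bounded by the (3.42) block hypothesis.
[cite: Balaban1985BackgroundPropagators, (3.42) p.397, bookkeeping] -/
theorem eLatSC_le_of_eBlock_cc (hι : ∀ s : BlkY x.toKIdx, β x.toKIdx.hN x.toKIdx.D x.toKIdx.hk (ιB s) = s) {c : CCfg (CfgY 𝔸 x.toKIdx) (AfldY 𝔸 x.toKIdx)} {B₀ δ : ℝ}
    (hB₀ : 0 ≤ B₀) (hE : EBlock (KSC P G x par C37 C38) B₀ δ c) (n : Fin 4)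
    (f : SiteY x.toKIdx → ℝ) (E : 𝔸) (y' : IBondY x.toKIdx) (B : ℝ) (hE1 : ‖E‖ ≤ 1) (hB : 0 ≤ B)
    (hoff : ∀ z, blkC x.toKIdx ιB z ≠ y' → f z = 0) (hbd : ∀ z, |f z| ≤ B) (z : SiteY x.toKIdx) :
    (kGeo x.toKIdx).eta ^ (epow n) * eLatSC x.toKIdx (GpY x.toKIdx par) (baseY x.toKIdx c) (decY x.toKIdx c) (liftY f E) (blkY x.toKIdx z) n
      ≤ B₀ * B9.pref4 ((geo9Y x).len (blkC x.toKIdx ιB z)) n * Real.exp (-(δ * (geo9Y x).dist (blkC x.toKIdx ιB z) y')) * B := by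
  have hη0 : 0 < (kGeo x.toKIdx).eta := B9GeoLemma21KLevelV1.geo9K_eta_pos x.toKIdx
  have hblk : β x.toKIdx.hN x.toKIdx.D x.toKIdx.hk (blkC x.toKIdx ιB z) = blkY x.toKIdx z := by rw [blkC, hι]
  have hread := hE n (.inl f) (blkC x.toKIdx ιB z) y' (suppIn_inl_of_blkC x ιB hι hoff)
  rw [KSC, kernelFamilySC_e_inl, hblk, etaS_eq_eta] at hread
  obtain ⟨C, hC⟩ := exists_ball_bound_eLatSC x (GpY x.toKIdx par) (baseY x.toKIdx c) (decY x.toKIdx c) f (blkY x.toKIdx z) n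
  have h2 : eLatSC x.toKIdx (GpY x.toKIdx par) (baseY x.toKIdx c) (decY x.toKIdx c) (liftY f E) (blkY x.toKIdx z) n
      ≤ ⨆ E' : BallY 𝔸, eLatSC x.toKIdx (GpY x.toKIdx par) (baseY x.toKIdx c) (decY x.toKIdx c) (liftY f (E' : 𝔸)) (blkY x.toKIdx z) n :=
    le_iSup_ball (A := fun E' : BallY 𝔸 => eLatSC x.toKIdx (GpY x.toKIdx par) (baseY x.toKIdx c) (decY x.toKIdx c) (liftY f (E' : 𝔸)) (blkY x.toKIdx z) n) ⟨C, hC⟩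
      ⟨E, mem_closedBall_zero_iff.2 hE1⟩
  have hpref : 0 ≤ B9.pref4 ((geo9Y x).len (blkC x.toKIdx ιB z)) n := by
    have hl := (B9GeoLemma21KLevelV1.geo9Y_len_pos x (blkC x.toKIdx ιB z)).le
    match n with
    | 0 => exact pow_nonneg hl 2
    | 1 => exact hl
    | 2 => exact hl
    | 3 => exact zero_le_one
  calc (kGeo x.toKIdx).eta ^ (epow n) * eLatSC x.toKIdx (GpY x.toKIdx par) (baseY x.toKIdx c) (decY x.toKIdx c) (liftY f E) (blkY x.toKIdx z) n
      ≤ (kGeo x.toKIdx).eta ^ (epow n) * ⨆ E' : BallY 𝔸, eLatSC x.toKIdx (GpY x.toKIdx par) (baseY x.toKIdx c) (decY x.toKIdx c) (liftY f (E' : 𝔸)) (blkY x.toKIdx z) n :=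
        mul_le_mul_of_nonneg_left h2 (by positivity)
    _ ≤ B₀ * B9.pref4 ((geo9Y x).len (blkC x.toKIdx ιB z)) n * Real.exp (-(δ * (geo9Y x).dist (blkC x.toKIdx ιB z) y')) *
          (geo9Y x).supNorm (.inl f) := hread
    _ ≤ _ := mul_le_mul_of_nonneg_left (supNorm_inl_le x hB hbd) (by positivity)

/-- ★ **ENTRY 1 OF THE READING** (left difference letters, forward AND backward): `‖(∇♯_{base c,k}·η²G′(dec c))(f ⊗ E)(z)‖ ≦ B₀(Lʲη)e^{−δd}·B` at any coded `c`.
[cite: Balaban1985BackgroundPropagators, (3.42) p.397 (second entry), (3.3) p.390, (3.8) p.392] -/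
theorem liftY_bound_one_cc (hι : ∀ s : BlkY x.toKIdx, β x.toKIdx.hN x.toKIdx.D x.toKIdx.hk (ιB s) = s) {c : CCfg (CfgY 𝔸 x.toKIdx) (AfldY 𝔸 x.toKIdx)} {B₀ δ : ℝ}
    (hB₀ : 0 ≤ B₀) (hE : EBlock (KSC P G x par C37 C38) B₀ δ c) (k : Fin (d + 1) ⊕ Fin (d + 1))
    (f : SiteY x.toKIdx → ℝ) (E : 𝔸) (y' : IBondY x.toKIdx) (B : ℝ) (hE1 : ‖E‖ ≤ 1) (hB : 0 ≤ B)
    (hoff : ∀ z, blkC x.toKIdx ιB z ≠ y' → f z = 0) (hbd : ∀ z, |f z| ≤ B) (z : SiteY x.toKIdx) :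
    ‖(diffLetter (shiftY x.toKIdx) (UboxY x.toKIdx (baseY x.toKIdx c)) ((((kGeo x.toKIdx).eta : ℂ))⁻¹) k *
        (((kGeo x.toKIdx).eta ^ 2) • (GpY x.toKIdx par (decY x.toKIdx c)).restrictScalars ℝ)) (liftY f E) z‖
      ≤ (B₀ * (geo9Y x).len (blkC x.toKIdx ιB z) * Real.exp (-(δ * (geo9Y x).dist (blkC x.toKIdx ιB z) y'))) * B := by
  set η := (kGeo x.toKIdx).eta with hηdef
  have hη0 : 0 < η := B9GeoLemma21KLevelV1.geo9K_eta_pos x.toKIdx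
  have key := eLatSC_le_of_eBlock_cc P G x par ιB C37 C38 hι hB₀ hE 1 f E y' B hE1 hB hoff hbd z
  have hep : epow 1 = 1 := rfl
  have hpref : B9.pref4 ((geo9Y x).len (blkC x.toKIdx ιB z)) 1 = (geo9Y x).len (blkC x.toKIdx ιB z) := rfl
  rw [hep, pow_one, hpref] at key
  -- the value of the letter product on `f ⊗ E` at `z`
  set Λ := GpY x.toKIdx par (decY x.toKIdx c) (liftY f E) with hΛ
  have hval : ∀ μ, (diffLetter (shiftY x.toKIdx) (UboxY x.toKIdx (baseY x.toKIdx c)) (((η : ℂ))⁻¹) (Sum.inl μ) *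
        ((η ^ 2) • (GpY x.toKIdx par (decY x.toKIdx c)).restrictScalars ℝ)) (liftY f E) z = ((η : ℂ))⁻¹ • ((((η ^ 2 : ℝ)) : ℂ) • cdS x.toKIdx (baseY x.toKIdx c) μ Λ z) := by
    intro μ
    rw [Module.End.mul_apply, B9Eq352GradLetters.diffLetter_inl, B9Eq352DivFormLetters.gradLetterF_apply, LinearMap.smul_apply,
      LinearMap.restrictScalars_apply, real_smul_fun, B9Eq39Adjoint.covD_smul]
    rfl
  have hval' : ∀ μ, (diffLetter (shiftY x.toKIdx) (UboxY x.toKIdx (baseY x.toKIdx c)) (((η : ℂ))⁻¹) (Sum.inr μ) *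
        ((η ^ 2) • (GpY x.toKIdx par (decY x.toKIdx c)).restrictScalars ℝ)) (liftY f E) z = -(((η : ℂ))⁻¹ • ((((η ^ 2 : ℝ)) : ℂ) • cdsS x.toKIdx (baseY x.toKIdx c) μ Λ z)) := by
    intro μ
    rw [Module.End.mul_apply, B9Eq352GradLetters.diffLetter_inr, LinearMap.neg_apply, Pi.neg_apply, B9Eq352DivFormLetters.gradLetterB_apply,
      LinearMap.smul_apply, LinearMap.restrictScalars_apply, real_smul_fun, B9Eq39Adjoint.covDstar_smul]
    rfl
  have hnorm : ∀ v : 𝔸, ‖((η : ℂ))⁻¹ • ((((η ^ 2 : ℝ)) : ℂ) • v)‖ = η * ‖v‖ := fun v => by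
    rw [norm_smul, norm_smul, norm_inv, Complex.norm_real, Complex.norm_real, Real.norm_eq_abs, Real.norm_eq_abs, abs_of_pos hη0,
      abs_of_nonneg (by positivity)]
    field_simp
  rcases k with μ | μ
  · rw [hval μ, hnorm]
    have h1 : ‖cdS x.toKIdx (baseY x.toKIdx c) μ Λ z‖ ≤ eLatSC x.toKIdx (GpY x.toKIdx par) (baseY x.toKIdx c) (decY x.toKIdx c) (liftY f E) (blkY x.toKIdx z) 1 :=
      (norm_le_supBlkS' x.toKIdx (blkY x.toKIdx z) (fun μ => cdS x.toKIdx (baseY x.toKIdx c) μ Λ) μ rfl).trans (le_max_left _ _)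
    exact (mul_le_mul_of_nonneg_left h1 hη0.le).trans key
  · rw [hval' μ, norm_neg, hnorm]
    have h1 : ‖cdsS x.toKIdx (baseY x.toKIdx c) μ Λ z‖ ≤ eLatSC x.toKIdx (GpY x.toKIdx par) (baseY x.toKIdx c) (decY x.toKIdx c) (liftY f E) (blkY x.toKIdx z) 1 :=
      (norm_le_supBlkS' x.toKIdx (blkY x.toKIdx z) (fun μ => cdsS x.toKIdx (baseY x.toKIdx c) μ Λ) μ rfl).trans (le_max_right _ _)
    exact (mul_le_mul_of_nonneg_left h1 hη0.le).trans key


/-- ★ **ENTRY 2 OF THE READING** (right difference letters, forward AND backward): `‖(η²G′(dec c)·∇♯_{base c,k})(f ⊗ E)(z)‖ ≦ B₀(Lʲη)e^{−δd}·B` at any coded `c`.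
[cite: Balaban1985BackgroundPropagators, (3.42) p.397 (third entry), (3.3) p.390, (3.8) p.392] -/
theorem liftY_bound_two_cc (hι : ∀ s : BlkY x.toKIdx, β x.toKIdx.hN x.toKIdx.D x.toKIdx.hk (ιB s) = s) {c : CCfg (CfgY 𝔸 x.toKIdx) (AfldY 𝔸 x.toKIdx)} {B₀ δ : ℝ}
    (hB₀ : 0 ≤ B₀) (hE : EBlock (KSC P G x par C37 C38) B₀ δ c) (k : Fin (d + 1) ⊕ Fin (d + 1))
    (f : SiteY x.toKIdx → ℝ) (E : 𝔸) (y' : IBondY x.toKIdx) (B : ℝ) (hE1 : ‖E‖ ≤ 1) (hB : 0 ≤ B)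
    (hoff : ∀ z, blkC x.toKIdx ιB z ≠ y' → f z = 0) (hbd : ∀ z, |f z| ≤ B) (z : SiteY x.toKIdx) :
    ‖((((kGeo x.toKIdx).eta ^ 2) • (GpY x.toKIdx par (decY x.toKIdx c)).restrictScalars ℝ) *
        diffLetter (shiftY x.toKIdx) (UboxY x.toKIdx (baseY x.toKIdx c)) ((((kGeo x.toKIdx).eta : ℂ))⁻¹) k) (liftY f E) z‖
      ≤ (B₀ * (geo9Y x).len (blkC x.toKIdx ιB z) * Real.exp (-(δ * (geo9Y x).dist (blkC x.toKIdx ιB z) y'))) * B := by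
  set η := (kGeo x.toKIdx).eta with hηdef
  have hη0 : 0 < η := B9GeoLemma21KLevelV1.geo9K_eta_pos x.toKIdx
  have key := eLatSC_le_of_eBlock_cc P G x par ιB C37 C38 hι hB₀ hE 2 f E y' B hE1 hB hoff hbd z
  have hep : epow 2 = 1 := rfl
  have hpref : B9.pref4 ((geo9Y x).len (blkC x.toKIdx ιB z)) 2 = (geo9Y x).len (blkC x.toKIdx ιB z) := rfl
  rw [hep, pow_one, hpref] at key
  set Λ₀ := liftY f E with hΛ₀
  have hF : ∀ μ, diffLetter (shiftY x.toKIdx) (UboxY x.toKIdx (baseY x.toKIdx c)) (((η : ℂ))⁻¹) (Sum.inl μ) Λ₀ = ((η : ℂ))⁻¹ • cdS x.toKIdx (baseY x.toKIdx c) μ Λ₀ := by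
    intro μ; funext w; rw [B9Eq352GradLetters.diffLetter_inl, B9Eq352DivFormLetters.gradLetterF_apply]; rfl
  have hB' : ∀ μ, diffLetter (shiftY x.toKIdx) (UboxY x.toKIdx (baseY x.toKIdx c)) (((η : ℂ))⁻¹) (Sum.inr μ) Λ₀ = -(((η : ℂ))⁻¹ • cdsS x.toKIdx (baseY x.toKIdx c) μ Λ₀) := by
    intro μ; funext w
    rw [B9Eq352GradLetters.diffLetter_inr, LinearMap.neg_apply, Pi.neg_apply, Pi.neg_apply, B9Eq352DivFormLetters.gradLetterB_apply]; rfl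
  have hval : ∀ μ, ((((η ^ 2)) • (GpY x.toKIdx par (decY x.toKIdx c)).restrictScalars ℝ) * diffLetter (shiftY x.toKIdx) (UboxY x.toKIdx (baseY x.toKIdx c)) (((η : ℂ))⁻¹) (Sum.inl μ))
        Λ₀ z = (η ^ 2 : ℝ) • (((η : ℂ))⁻¹ • GpY x.toKIdx par (decY x.toKIdx c) (cdS x.toKIdx (baseY x.toKIdx c) μ Λ₀) z) := by
    intro μ
    simp only [Module.End.mul_apply, hF, map_smul, LinearMap.smul_apply, LinearMap.restrictScalars_apply, Pi.smul_apply]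
  have hval' : ∀ μ, ((((η ^ 2)) • (GpY x.toKIdx par (decY x.toKIdx c)).restrictScalars ℝ) * diffLetter (shiftY x.toKIdx) (UboxY x.toKIdx (baseY x.toKIdx c)) (((η : ℂ))⁻¹) (Sum.inr μ))
        Λ₀ z = -((η ^ 2 : ℝ) • (((η : ℂ))⁻¹ • GpY x.toKIdx par (decY x.toKIdx c) (cdsS x.toKIdx (baseY x.toKIdx c) μ Λ₀) z)) := by
    intro μ
    simp only [Module.End.mul_apply, hB', map_neg, map_smul, LinearMap.smul_apply, LinearMap.restrictScalars_apply, Pi.neg_apply, Pi.smul_apply]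
  have hnorm : ∀ v : 𝔸, ‖(η ^ 2 : ℝ) • (((η : ℂ))⁻¹ • v)‖ = η * ‖v‖ := fun v => by
    rw [norm_smul, norm_smul, norm_inv, Complex.norm_real, Real.norm_eq_abs, Real.norm_eq_abs, abs_of_pos hη0, abs_of_nonneg (by positivity)]
    field_simp
  rcases k with μ | μ
  · rw [hval μ, hnorm]
    have h1 : ‖GpY x.toKIdx par (decY x.toKIdx c) (cdS x.toKIdx (baseY x.toKIdx c) μ Λ₀) z‖ ≤ eLatSC x.toKIdx (GpY x.toKIdx par) (baseY x.toKIdx c) (decY x.toKIdx c) Λ₀ (blkY x.toKIdx z) 2 :=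
      (norm_le_supBlkS' x.toKIdx (blkY x.toKIdx z) (fun μ => GpY x.toKIdx par (decY x.toKIdx c) (cdS x.toKIdx (baseY x.toKIdx c) μ Λ₀)) μ rfl).trans (le_max_left _ _)
    exact (mul_le_mul_of_nonneg_left h1 hη0.le).trans key
  · rw [hval' μ, norm_neg, hnorm]
    have h1 : ‖GpY x.toKIdx par (decY x.toKIdx c) (cdsS x.toKIdx (baseY x.toKIdx c) μ Λ₀) z‖ ≤ eLatSC x.toKIdx (GpY x.toKIdx par) (baseY x.toKIdx c) (decY x.toKIdx c) Λ₀ (blkY x.toKIdx z) 2 :=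
      (norm_le_supBlkS' x.toKIdx (blkY x.toKIdx z) (fun μ => GpY x.toKIdx par (decY x.toKIdx c) (cdsS x.toKIdx (baseY x.toKIdx c) μ Λ₀)) μ rfl).trans (le_max_right _ _)
    exact (mul_le_mul_of_nonneg_left h1 hη0.le).trans key

/-- ★ **ENTRY 3 OF THE READING** (the Laplacian letter): `‖(η⁻²Δ_{base c}·η²G′(dec c))(f ⊗ E)(z)‖ ≦ B₀e^{−δd}·B` at any coded `c`. [cite: Balaban1985BackgroundPropagators, (3.42) p.397 (fourth entry), (3.23) p.394] -/
theorem liftY_bound_three_cc (hι : ∀ s : BlkY x.toKIdx, β x.toKIdx.hN x.toKIdx.D x.toKIdx.hk (ιB s) = s) {c : CCfg (CfgY 𝔸 x.toKIdx) (AfldY 𝔸 x.toKIdx)} {B₀ δ : ℝ}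
    (hB₀ : 0 ≤ B₀) (hE : EBlock (KSC P G x par C37 C38) B₀ δ c)
    (f : SiteY x.toKIdx → ℝ) (E : 𝔸) (y' : IBondY x.toKIdx) (B : ℝ) (hE1 : ‖E‖ ≤ 1) (hB : 0 ≤ B)
    (hoff : ∀ z, blkC x.toKIdx ιB z ≠ y' → f z = 0) (hbd : ∀ z, |f z| ≤ B) (z : SiteY x.toKIdx) :
    ‖((((kGeo x.toKIdx).eta ^ 2)⁻¹ • (Node00.lapSL x.toKIdx (baseY x.toKIdx c)).restrictScalars ℝ) *
        (((kGeo x.toKIdx).eta ^ 2) • (GpY x.toKIdx par (decY x.toKIdx c)).restrictScalars ℝ)) (liftY f E) z‖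
      ≤ (B₀ * 1 * Real.exp (-(δ * (geo9Y x).dist (blkC x.toKIdx ιB z) y'))) * B := by
  set η := (kGeo x.toKIdx).eta with hηdef
  have hη0 : 0 < η := B9GeoLemma21KLevelV1.geo9K_eta_pos x.toKIdx
  have hη2 : (η ^ 2 : ℝ) ≠ 0 := pow_ne_zero 2 hη0.ne'
  have key := eLatSC_le_of_eBlock_cc P G x par ιB C37 C38 hι hB₀ hE 3 f E y' B hE1 hB hoff hbd z
  have hep : epow 3 = 0 := rfl
  have hpref : B9.pref4 ((geo9Y x).len (blkC x.toKIdx ιB z)) 3 = 1 := rfl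
  rw [hep, pow_zero, one_mul, hpref] at key
  set Λ := GpY x.toKIdx par (decY x.toKIdx c) (liftY f E) with hΛ
  have hval : ((((η ^ 2))⁻¹ • (Node00.lapSL x.toKIdx (baseY x.toKIdx c)).restrictScalars ℝ) * (((η ^ 2)) • (GpY x.toKIdx par (decY x.toKIdx c)).restrictScalars ℝ)) (liftY f E) z
      = lapS x.toKIdx (baseY x.toKIdx c) Λ z := by
    rw [Module.End.mul_apply, LinearMap.smul_apply, LinearMap.restrictScalars_apply, LinearMap.smul_apply, LinearMap.restrictScalars_apply,
      real_smul_fun (η ^ 2) (GpY x.toKIdx par (decY x.toKIdx c) (liftY f E)), LinearMap.map_smul_of_tower, Node00.lapSL_apply, ← hΛ, Pi.smul_apply, Pi.smul_apply,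
      ← Complex.coe_smul, smul_smul, ← Complex.ofReal_mul, inv_mul_cancel₀ hη2, Complex.ofReal_one, one_smul]
  rw [hval]
  have h1 : ‖lapS x.toKIdx (baseY x.toKIdx c) Λ z‖ ≤ eLatSC x.toKIdx (GpY x.toKIdx par) (baseY x.toKIdx c) (decY x.toKIdx c) (liftY f E) (blkY x.toKIdx z) 3 :=
    norm_le_supBlkS x.toKIdx (blkY x.toKIdx z) (lapS x.toKIdx (baseY x.toKIdx c) Λ) rfl
  exact h1.trans key


/-! ## §2 ★ The four block-majorant families at an arbitrary coded configuration, and at a coded product -/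

/-- ★ **THE (3.42) READ OF THE AUGMENTED FAMILY AT ANY CODED CONFIGURATION**: `EBlock (KSC …) B₀ δ c` gives, over the frame's block map `blkC`, the
block majorants `M₂(Σ_j‖b_j‖)·B₀·ℓ(a)^{(2,1,1,0)}·e^{−δd(a,a′)}` of the four conjugated letters `η²G′(dec c)`, `∇♯_{base c,k}·η²G′(dec c)` (every
`k ∈ κ ⊕ κ`), `η²G′(dec c)·∇♯_{base c,k}` (every `k`), `η⁻²Δ_{base c}·η²G′(dec c)` — the reading constant `c_R = M₂·Σ_j‖b_j‖` of FILE 5.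
[cite: Balaban1985BackgroundPropagators, (3.42) p.397, (3.39) p.397; Balaban1984PropagatorsII, (2.51) p.232] -/
theorem hasMajorant_letters_cc_of_eBlock [Fintype (geo9Y x).Site] {Rr : ℝ} {Hp : Prop}
    (hι : ∀ s : BlkY x.toKIdx, β x.toKIdx.hN x.toKIdx.D x.toKIdx.hk (ιB s) = s)
    (M₂ : ℝ) (hM₂ : 0 ≤ M₂) (hrepr : ∀ (v : 𝔸) (j : ι), |b.repr v j| ≤ M₂ * ‖v‖)
    {c : CCfg (CfgY 𝔸 x.toKIdx) (AfldY 𝔸 x.toKIdx)} {B₀ δ : ℝ} (hB₀ : 0 ≤ B₀) (hE : EBlock (KSC P G x par C37 C38) B₀ δ c) :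
    HasMajorant (g := toB6 (geo9Y x) Rr Hp) (fun p : SiteY x.toKIdx × ι => blkC x.toKIdx ιB p.1)
        (conj b (((kGeo x.toKIdx).eta ^ 2) • (GpY x.toKIdx par (decY x.toKIdx c)).restrictScalars ℝ))
        (fun a a' => M₂ * (∑ j, ‖b j‖) * B₀ * (geo9Y x).len a ^ 2 * Real.exp (-(δ * (geo9Y x).dist a a'))) ∧
      (∀ k : Fin (d + 1) ⊕ Fin (d + 1), HasMajorant (g := toB6 (geo9Y x) Rr Hp) (fun p : SiteY x.toKIdx × ι => blkC x.toKIdx ιB p.1)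
        (conj b (diffLetter (shiftY x.toKIdx) (UboxY x.toKIdx (baseY x.toKIdx c)) ((((kGeo x.toKIdx).eta : ℂ))⁻¹) k) *
          conj b (((kGeo x.toKIdx).eta ^ 2) • (GpY x.toKIdx par (decY x.toKIdx c)).restrictScalars ℝ))
        (fun a a' => M₂ * (∑ j, ‖b j‖) * B₀ * (geo9Y x).len a * Real.exp (-(δ * (geo9Y x).dist a a')))) ∧
      (∀ k : Fin (d + 1) ⊕ Fin (d + 1), HasMajorant (g := toB6 (geo9Y x) Rr Hp) (fun p : SiteY x.toKIdx × ι => blkC x.toKIdx ιB p.1)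
        (conj b (((kGeo x.toKIdx).eta ^ 2) • (GpY x.toKIdx par (decY x.toKIdx c)).restrictScalars ℝ) *
          conj b (diffLetter (shiftY x.toKIdx) (UboxY x.toKIdx (baseY x.toKIdx c)) ((((kGeo x.toKIdx).eta : ℂ))⁻¹) k))
        (fun a a' => M₂ * (∑ j, ‖b j‖) * B₀ * (geo9Y x).len a * Real.exp (-(δ * (geo9Y x).dist a a')))) ∧
      HasMajorant (g := toB6 (geo9Y x) Rr Hp) (fun p : SiteY x.toKIdx × ι => blkC x.toKIdx ιB p.1)
        (conj b ((((kGeo x.toKIdx).eta ^ 2)⁻¹ • (Node00.lapSL x.toKIdx (baseY x.toKIdx c)).restrictScalars ℝ)) *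
          conj b (((kGeo x.toKIdx).eta ^ 2) • (GpY x.toKIdx par (decY x.toKIdx c)).restrictScalars ℝ))
        (fun a a' => M₂ * (∑ j, ‖b j‖) * B₀ * 1 * Real.exp (-(δ * (geo9Y x).dist a a'))) := by
  set η := (kGeo x.toKIdx).eta with hηdef
  refine ⟨?_, fun k => ?_, fun k => ?_, ?_⟩
  · have h := hasMajorant_conj_of_liftY_bound b (g := toB6 (geo9Y x) Rr Hp) (fun z => blkC x.toKIdx ιB z)
      ((η ^ 2) • (GpY x.toKIdx par (decY x.toKIdx c)).restrictScalars ℝ)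
      (fun a a' => B₀ * (geo9Y x).len a ^ 2 * Real.exp (-(δ * (geo9Y x).dist a a'))) M₂ hM₂ hrepr
      (fun f E y' B hE1 hB hoff hbd z => liftY_bound_zero_cc P G x par ιB C37 C38 hι hB₀ hE f E y' B hE1 hB hoff hbd z)
    intro y' μ B hμ p
    exact (h y' μ B hμ p).trans (le_of_eq (by ring))
  · have h := hasMajorant_conj_of_liftY_bound b (g := toB6 (geo9Y x) Rr Hp) (fun z => blkC x.toKIdx ιB z)
      (diffLetter (shiftY x.toKIdx) (UboxY x.toKIdx (baseY x.toKIdx c)) (((η : ℂ))⁻¹) k *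
        ((η ^ 2) • (GpY x.toKIdx par (decY x.toKIdx c)).restrictScalars ℝ))
      (fun a a' => B₀ * (geo9Y x).len a * Real.exp (-(δ * (geo9Y x).dist a a'))) M₂ hM₂ hrepr
      (fun f E y' B hE1 hB hoff hbd z => liftY_bound_one_cc P G x par ιB C37 C38 hι hB₀ hE k f E y' B hE1 hB hoff hbd z)
    rw [B9Eq352DivFormLetters.conj_mul] at h
    intro y' μ B hμ p
    exact (h y' μ B hμ p).trans (le_of_eq (by ring))
  · have h := hasMajorant_conj_of_liftY_bound b (g := toB6 (geo9Y x) Rr Hp) (fun z => blkC x.toKIdx ιB z)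
      (((η ^ 2) • (GpY x.toKIdx par (decY x.toKIdx c)).restrictScalars ℝ) *
        diffLetter (shiftY x.toKIdx) (UboxY x.toKIdx (baseY x.toKIdx c)) (((η : ℂ))⁻¹) k)
      (fun a a' => B₀ * (geo9Y x).len a * Real.exp (-(δ * (geo9Y x).dist a a'))) M₂ hM₂ hrepr
      (fun f E y' B hE1 hB hoff hbd z => liftY_bound_two_cc P G x par ιB C37 C38 hι hB₀ hE k f E y' B hE1 hB hoff hbd z)
    rw [B9Eq352DivFormLetters.conj_mul] at h
    intro y' μ B hμ p
    exact (h y' μ B hμ p).trans (le_of_eq (by ring))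
  · have h := hasMajorant_conj_of_liftY_bound b (g := toB6 (geo9Y x) Rr Hp) (fun z => blkC x.toKIdx ιB z)
      ((((η ^ 2))⁻¹ • (Node00.lapSL x.toKIdx (baseY x.toKIdx c)).restrictScalars ℝ) *
        ((η ^ 2) • (GpY x.toKIdx par (decY x.toKIdx c)).restrictScalars ℝ))
      (fun a a' => B₀ * 1 * Real.exp (-(δ * (geo9Y x).dist a a'))) M₂ hM₂ hrepr
      (fun f E y' B hE1 hB hoff hbd z => liftY_bound_three_cc P G x par ιB C37 C38 hι hB₀ hE f E y' B hE1 hB hoff hbd z)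
    rw [B9Eq352DivFormLetters.conj_mul] at h
    intro y' μ B hμ p
    exact (h y' μ B hμ p).trans (le_of_eq (by ring))

/-- ★★ **THE (3.42) READ AT A CODED PRODUCT `prod U a`** (`W = e^{ηa}·U`, `η = (kGeo x).eta`): `EBlock (KSC …) B₀ δ (.prod U a)` gives, over `blkC`,
the block majorants `M₂(Σ_j‖b_j‖)·B₀·ℓ(a)^{(2,1,1,0)}·e^{−δd}` of `η²G′(W)`, `∇♯_{U,k}·η²G′(W)`, `η²G′(W)·∇♯_{U,k}` (every `k ∈ κ ⊕ κ`) and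
`η⁻²Δ_U·η²G′(W)` — the block the Sect.-B frames write at the product, read back with ITS letters (at the base `U`); the input of the letter
conversion `U ↦ U′U` (`B9Eq370LetterConversion`). [cite: Balaban1985BackgroundPropagators, (3.42) p.397, Thm 3.4 p.400, p.403 l.1–9; Balaban1984PropagatorsII, (2.51) p.232] -/
theorem hasMajorant_letters_prod_of_eBlock [Fintype (geo9Y x).Site] {Rr : ℝ} {Hp : Prop}
    (hι : ∀ s : BlkY x.toKIdx, β x.toKIdx.hN x.toKIdx.D x.toKIdx.hk (ιB s) = s)
    (M₂ : ℝ) (hM₂ : 0 ≤ M₂) (hrepr : ∀ (v : 𝔸) (j : ι), |b.repr v j| ≤ M₂ * ‖v‖)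
    (U : CfgY 𝔸 x.toKIdx) (a : AfldY 𝔸 x.toKIdx) {B₀ δ : ℝ} (hB₀ : 0 ≤ B₀) (hE : EBlock (KSC P G x par C37 C38) B₀ δ (.prod U a)) :
    HasMajorant (g := toB6 (geo9Y x) Rr Hp) (fun p : SiteY x.toKIdx × ι => blkC x.toKIdx ιB p.1)
        (conj b (((kGeo x.toKIdx).eta ^ 2) • (GpY x.toKIdx par (mulY x.toKIdx (fluct (kGeo x.toKIdx).eta a) U)).restrictScalars ℝ))
        (fun a a' => M₂ * (∑ j, ‖b j‖) * B₀ * (geo9Y x).len a ^ 2 * Real.exp (-(δ * (geo9Y x).dist a a'))) ∧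
      (∀ k : Fin (d + 1) ⊕ Fin (d + 1), HasMajorant (g := toB6 (geo9Y x) Rr Hp) (fun p : SiteY x.toKIdx × ι => blkC x.toKIdx ιB p.1)
        (conj b (diffLetter (shiftY x.toKIdx) (UboxY x.toKIdx U) ((((kGeo x.toKIdx).eta : ℂ))⁻¹) k) *
          conj b (((kGeo x.toKIdx).eta ^ 2) • (GpY x.toKIdx par (mulY x.toKIdx (fluct (kGeo x.toKIdx).eta a) U)).restrictScalars ℝ))
        (fun a a' => M₂ * (∑ j, ‖b j‖) * B₀ * (geo9Y x).len a * Real.exp (-(δ * (geo9Y x).dist a a')))) ∧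
      (∀ k : Fin (d + 1) ⊕ Fin (d + 1), HasMajorant (g := toB6 (geo9Y x) Rr Hp) (fun p : SiteY x.toKIdx × ι => blkC x.toKIdx ιB p.1)
        (conj b (((kGeo x.toKIdx).eta ^ 2) • (GpY x.toKIdx par (mulY x.toKIdx (fluct (kGeo x.toKIdx).eta a) U)).restrictScalars ℝ) *
          conj b (diffLetter (shiftY x.toKIdx) (UboxY x.toKIdx U) ((((kGeo x.toKIdx).eta : ℂ))⁻¹) k))
        (fun a a' => M₂ * (∑ j, ‖b j‖) * B₀ * (geo9Y x).len a * Real.exp (-(δ * (geo9Y x).dist a a')))) ∧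
      HasMajorant (g := toB6 (geo9Y x) Rr Hp) (fun p : SiteY x.toKIdx × ι => blkC x.toKIdx ιB p.1)
        (conj b ((((kGeo x.toKIdx).eta ^ 2)⁻¹ • (Node00.lapSL x.toKIdx U).restrictScalars ℝ)) *
          conj b (((kGeo x.toKIdx).eta ^ 2) • (GpY x.toKIdx par (mulY x.toKIdx (fluct (kGeo x.toKIdx).eta a) U)).restrictScalars ℝ))
        (fun a a' => M₂ * (∑ j, ‖b j‖) * B₀ * 1 * Real.exp (-(δ * (geo9Y x).dist a a'))) := by
  have h := hasMajorant_letters_cc_of_eBlock P G x par b ιB C37 C38 (Rr := Rr) (Hp := Hp) hι M₂ hM₂ hrepr hB₀ hE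
  simp only [baseY] at h
  exact h

end Record

end Literature.MathematicalPhysics.QuantumFieldTheory.Balaban1983to89.B9SectBGpReadingsYProdR

/-!
# `Balaban1983to89.B9SectBGpTransferInYR` — THE CLASS-PARAMETRIC TWIN of `B9SectBGpTransferInY` (CASCADE-R, director-ym №279 GO-R; №277 (3) `hunitA` cure; dag-n06-d SOCKET-(α) class question)

statement-level skeleton of published theorems with citation tags; proofs where landed; nothing here is a claim about the
Yang–Mills mass gap

WHAT THIS FILE IS.  The original module `B9SectBGpTransferInY` types its objects over MODULE 3's member carrier `bg9Y 𝔸 G x` (MODULE 2's small-cube class (3.35)).  This file RE-DECLARES, with UNCHANGED NAMES inside the namespace `…B9SectBGpTransferInYR`, exactly its 8 class-dependent declarations over the CLASS-PARAMETRIC carrier `B9SectBCodedClassR.bg9YC 𝔸 G P x` (`P : RegExtraY …` = the two cube conditions of (3.35)∕(3.36) as a parameter; `bg9Y 𝔸 G x = bg9YC 𝔸 G (extraY 𝔸 G) x` by `rfl`, so every declaration here specialises definitionally to its original; at the record's reading of PRINT's class, `P := extraYPb 𝔸 G`, the displayed laws `hreg335P` ((3.35) on plaquettes) and the class-keyed `hunitA`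 become theorems).  The text is the original's VERBATIM under the token surgery `bg9Y 𝔸 G ↦ bg9YC 𝔸 G P`, `NAME ↦ NAME P` for the class-dependent names (P the first explicit argument), and — №277 — the binder `hunitA` re-keyed from «all G-valued U» to «all (3.35)-regular U of the carrier» (`∀ j α₀ U, (bg9YC 𝔸 G P (f j)).Reg335 c35 α₀ U → IsUnit (deltaAY …)`).  Class-free declarations of the original are NOT copied: they are imported and used BY NAME (`open … hiding` the re-declared ones).  Generated by dag-n06-c g16's `gen.py` (HOME `pub-ymgap-dag-n06-c/lean/g16/`); the ORIGINAL MODULE DOCUMENTATION FOLLOWS VERBATIM and describes the mathematics.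

HONEST SCOPE.  Re-typing bookkeeping; nothing of [B9] asserted beyond the original; COUNT-NEUTRAL; N06 NOT discharged; nothing continuum ∕ OS ∕ mass gap ∕ Clay.  Cell `pub-ymgap` (D-0062), Track A node N06 [B9], seat `pub-ymgap-dag-n06-c` g16, 2026-08-29.
-/

/-! Module documentation: that of the original `Balaban1983to89.B9SectBGpTransferInY` applies verbatim to this twin (not repeated here). -/

noncomputable section

namespace Literature.MathematicalPhysics.QuantumFieldTheory.Balaban1983to89.B9SectBGpTransferInYR

open Literature.MathematicalPhysics.QuantumFieldTheory.Balaban1983to89.B9SectBCodedClassR (RegExtraY bg9YC)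
open Literature.MathematicalPhysics.QuantumFieldTheory.Balaban1983to89.B9SectBGpTransferInY hiding eBlock_KSC_base ineq342_346_347_mono eBlock_of_pullK_base KSC_members_base pullK_members_base ineq343_345_congr thms_KSC_base_of_pullK hin_KSC

variable {𝔸 : Type} [NormedRing 𝔸] [NormedAlgebra ℂ 𝔸]

/-! ## §1 Writing the augmented entries from six pointwise bounds; the (3.42) block of `KSC` at a regular base -/

section Write

open Literature.MathematicalPhysics.QuantumFieldTheory.Balaban1983to89.B6KLevelCensusIndexV1 (KIdx kGeo)
open Literature.MathematicalPhysics.QuantumFieldTheory.Balaban1983to89.B6Ineq2142KLevelV1 (β)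
open Literature.MathematicalPhysics.QuantumFieldTheory.Balaban1983to89.B6Prop22KLevelCensusEta (epow)
open Literature.MathematicalPhysics.QuantumFieldTheory.Balaban1983to89.B9FromB6 (EBlock pref4_nonneg pref6_nonneg)
open Literature.MathematicalPhysics.QuantumFieldTheory.Balaban1983to89.B9SectBCodedCarrier (CCfg pullK)
open Literature.MathematicalPhysics.QuantumFieldTheory.Balaban1983to89.B9Eq360DeltaPrimeAY (AfldY blkY blkY_apply)
open Literature.MathematicalPhysics.QuantumFieldTheory.Balaban1983to89.B9PinMembersKLevelV1 (MemberY geo9Y bg9Y)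
open Literature.MathematicalPhysics.QuantumFieldTheory.Balaban1983to89.B9SectBGpLettersY (decY GVal blkC)
open Literature.MathematicalPhysics.QuantumFieldTheory.Balaban1983to89.B9SectBGpFrameCodedYR (codingYx)
open Literature.MathematicalPhysics.QuantumFieldTheory.Balaban1983to89.B9SectBGpReadingsYR (KSC)
open Literature.MathematicalPhysics.QuantumFieldTheory.Balaban1983to89.B9SectBGpReadingsY (baseY eLatSC kernelFamilySC kernelFamilySC_e_inl kernelFamilySC_e_inr supNorm_nonneg)
open Literature.MathematicalPhysics.QuantumFieldTheory.Balaban1983to89.Node00 (SiteY BlkY IBondY CfgY BallY SiteOpY SiteParY UboxY shiftY cdS cdsS lapS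
  etaS supBlkS supBlkS' kernelFamilyS liftY liftY_apply GpY)
open Literature.MathematicalPhysics.QuantumFieldTheory.Balaban1983to89.Node00.OpsYRead342 (sq_eta_mul_norm_le_of_eBlock eta_mul_norm_cdS_le_of_eBlock
  eta_mul_norm_cdsS_le_of_eBlock norm_lapS_le_of_eBlock)
open Literature.MathematicalPhysics.QuantumFieldTheory.Balaban1983to89.Node00.OpsYRead342Cross (eta_mul_norm_cdsS_O_le_of_eBlock eta_mul_norm_O_cdS_le_of_eBlock)
open Literature.MathematicalPhysics.QuantumFieldTheory.Balaban1983to89.B9SectBGpLettersY (norm_le_one_and_inv_of_mem)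
open Literature.MathematicalPhysics.QuantumFieldTheory.Balaban1983to89.B9RWSumsReadsNbr (nbr)
open Literature.MathematicalPhysics.QuantumFieldTheory.Balaban1983to89.B9GeoNormsKLevelV1 (geo9K_supNorm_nonneg geo9K_l2Norm_nonneg geo9K_wNorm_nonneg
  geo9K_cutSup_nonneg)

variable {d ℓ : ℕ} {hd : 1 ≤ d + 1} {hL : Odd (ℓ + 1) ∧ 1 < ℓ + 1} {b₀ b₁ : ℝ} {Mstar : ℕ} (P : RegExtraY d ℓ hd hL b₀ b₁ Mstar 𝔸) [CompleteSpace 𝔸]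

variable (G : Subgroup 𝔸ˣ) (x : MemberY d ℓ hd hL b₀ b₁ Mstar) (par : SiteParY 𝔸 x.toKIdx) {ι : Type} [Fintype ι]
  (b : Module.Basis ι ℝ 𝔸) (ιB : BlkY x.toKIdx → IBondY x.toKIdx) (C37 C38 : ℝ → CfgY 𝔸 x.toKIdx → AfldY 𝔸 x.toKIdx → Prop)

/-- ★★ **THE (3.42) BLOCK OF THE AUGMENTED READINGS AT A REGULAR BASE, FROM THE RECORD'S**: at a `G`-valued `U`, the record's block
`EBlock (kernelFamilyS … (GpY par) par) B₀ δ U` gives `EBlock (KSC …) (c_in·max B₀ 0) δ (base U)` with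
`c_in = L·e^{|δ|·2(d+1)} + 1 + 2M₂(Σ‖b_j‖)·mN·e^{|δ|·2(d+1)}` (an M-threshold `2(d+1) < M` and the neighbourhood count `mN` displayed).
[cite: Balaban1985BackgroundPropagators, Thm 3.1 (3.42) p.397, (3.3) p.390, (3.8) p.392; Balaban1984PropagatorsII, Lemma 2.1 (2.61) p.234, (2.51) p.232] -/
theorem eBlock_KSC_base [Fintype (geo9Y x).Site] (hι : ∀ s : BlkY x.toKIdx, β x.toKIdx.hN x.toKIdx.D x.toKIdx.hk (ιB s) = s)
    (hG1 : ∀ u : 𝔸ˣ, u ∈ G → ‖(u : 𝔸)‖ ≤ 1) {U : CfgY 𝔸 x.toKIdx} (hU : GVal G x.toKIdx U) {B₀ δ : ℝ}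
    (hE : EBlock (kernelFamilyS x.toKIdx (bg9YC 𝔸 G P x) (fun U => U) (GpY x.toKIdx par) par) B₀ δ U)
    {M₂ : ℝ} (hM₂ : 0 ≤ M₂) (hrepr : ∀ (v : 𝔸) (j : ι), |b.repr v j| ≤ M₂ * ‖v‖) (hM : 2 * ((d : ℝ) + 1) < (geo9Y x).M)
    {mN : ℕ} (hN : ∀ a : IBondY x.toKIdx, (nbr (geo9Y x) (2 * ((d : ℝ) + 1)) a).card ≤ mN) :
    EBlock (KSC P G x par C37 C38)
      ((((ℓ + 1 : ℕ) : ℝ) * Real.exp (|δ| * (2 * ((d : ℝ) + 1))) + ((mN : ℝ) * (M₂ * ∑ j, ‖b j‖) * Real.exp (|δ| * (2 * ((d : ℝ) + 1))) + 1))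
        * max B₀ 0) δ (.base U) := by
  set cL : ℝ := ((ℓ + 1 : ℕ) : ℝ) * Real.exp (|δ| * (2 * ((d : ℝ) + 1))) with hcL
  set cR : ℝ := (mN : ℝ) * (M₂ * ∑ j, ‖b j‖) * Real.exp (|δ| * (2 * ((d : ℝ) + 1))) + 1 with hcR
  set B₁ := max B₀ 0 with hB₁
  have hB₁ : 0 ≤ B₁ := le_max_right _ _
  have hE' := eBlock_mono x.toKIdx _ (le_max_left B₀ 0) hE
  have hU1 : ∀ (μ : Fin (d + 1)) (w : SiteY x.toKIdx), ‖((UboxY x.toKIdx U μ w : 𝔸ˣ) : 𝔸)‖ ≤ 1 ∧ ‖(((UboxY x.toKIdx U μ w)⁻¹ : 𝔸ˣ) : 𝔸)‖ ≤ 1 :=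
    fun μ w => norm_le_one_and_inv_of_mem G hG1 (hU μ _)
  have hSb : 0 ≤ ∑ j, ‖b j‖ := Finset.sum_nonneg fun _ _ => norm_nonneg _
  have h1L : 1 ≤ cL := by
    have h1 : (1 : ℝ) ≤ ((ℓ + 1 : ℕ) : ℝ) := by exact_mod_cast Nat.succ_le_succ (Nat.zero_le ℓ)
    have h2 : (1 : ℝ) ≤ Real.exp (|δ| * (2 * ((d : ℝ) + 1))) := Real.one_le_exp (by positivity)
    nlinarith
  have hcR1 : 0 ≤ (mN : ℝ) * (M₂ * ∑ j, ‖b j‖) * Real.exp (|δ| * (2 * ((d : ℝ) + 1))) := by positivity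
  have h1R : 1 ≤ cR := by rw [hcR]; linarith
  have hcL0 : 0 ≤ cL := zero_le_one.trans h1L
  have hcR0 : 0 ≤ cR := zero_le_one.trans h1R
  have hCR' : (mN : ℝ) * (M₂ * ∑ j, ‖b j‖) * Real.exp (|δ| * (2 * ((d : ℝ) + 1))) * B₁ ≤ (cL + cR) * B₁ := by
    rw [hcR]; nlinarith [mul_nonneg hcL0 hB₁, hB₁]
  have hC1 : B₁ ≤ (cL + cR) * B₁ := by nlinarith
  have hCL : cL * B₁ ≤ (cL + cR) * B₁ := by nlinarith
  have hCR : cR * B₁ ≤ (cL + cR) * B₁ := by nlinarith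
  intro n lam y y' hs
  have hlen : 0 ≤ (geo9Y x).len y := (B9GeoLemma21KLevelV1.geo9Y_len_pos x y).le
  have hRHS : 0 ≤ (cL + cR) * B₁ * B9.pref4 ((geo9Y x).len y) n * Real.exp (-(δ * (geo9Y x).dist y y')) * (geo9Y x).supNorm lam := by
    have := supNorm_nonneg x lam
    have := pref4_nonneg hlen n
    positivity
  cases lam with
  | inr J => rw [KSC, kernelFamilySC_e_inr]; exact hRHS
  | inl f =>
    set ex := Real.exp (-(δ * (geo9Y x).dist y y')) with hex
    set N := (geo9Y x).supNorm (.inl f) with hN'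
    have hN0 : 0 ≤ N := supNorm_nonneg x _
    have hex0 : 0 ≤ ex := (Real.exp_pos _).le
    rw [KSC]
    refine kernelFamilySC_e_le_of_pw x.toKIdx (codingYx P G x C37 C38).bg (fun c => c) (GpY x.toKIdx par) par (.base U) rfl rfl n f y
      (mul_nonneg (add_nonneg hcL0 hcR0) hB₁) hlen hex0 hN0 fun E w hw => ?_
    have hE1 : ‖(E : 𝔸)‖ ≤ 1 := mem_closedBall_zero_iff.1 E.2
    have hX : 0 ≤ (geo9Y x).len y * ex * N := by positivity
    have hX2 : 0 ≤ (geo9Y x).len y ^ 2 * ex * N := by positivity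
    have hX0 : 0 ≤ ex * N := by positivity
    refine ⟨?_, fun μ => ?_, fun μ => ?_, fun μ => ?_, fun μ => ?_, ?_⟩
    · have h := sq_eta_mul_norm_le_of_eBlock x.toKIdx b (B := bg9YC 𝔸 G P x) (fun U => U) (GpY x.toKIdx par) par (U₁ := U) (B₀ := B₁) (δ := δ) hE'
        hM₂ hrepr f y y' hs hE1 hw
      calc _ ≤ B₁ * (geo9Y x).len y ^ 2 * ex * N := h
        _ = B₁ * ((geo9Y x).len y ^ 2 * ex * N) := by ring
        _ ≤ (cL + cR) * B₁ * ((geo9Y x).len y ^ 2 * ex * N) := mul_le_mul_of_nonneg_right hC1 hX2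
        _ = _ := by ring
    · have h := eta_mul_norm_cdS_le_of_eBlock x.toKIdx b (B := bg9YC 𝔸 G P x) (fun U => U) (GpY x.toKIdx par) par (U₁ := U) (B₀ := B₁) (δ := δ) hE'
        hM₂ hrepr f y y' hs hE1 μ hw
      calc _ ≤ B₁ * (geo9Y x).len y * ex * N := h
        _ = B₁ * ((geo9Y x).len y * ex * N) := by ring
        _ ≤ (cL + cR) * B₁ * ((geo9Y x).len y * ex * N) := mul_le_mul_of_nonneg_right hC1 hX
        _ = _ := by ring
    · have h := eta_mul_norm_cdsS_O_le_of_eBlock x.toKIdx b (B := bg9YC 𝔸 G P x) (fun U => U) (GpY x.toKIdx par) par (U₁ := U) (B₀ := B₁) (δ := δ) ιB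
        hE' hB₁ hι hM₂ hrepr hU1 hM f y y' hs hE1 μ hw
      calc _ ≤ cL * (B₁ * (geo9Y x).len y * ex * N) := by rw [hcL]; exact h
        _ = cL * B₁ * ((geo9Y x).len y * ex * N) := by ring
        _ ≤ (cL + cR) * B₁ * ((geo9Y x).len y * ex * N) := mul_le_mul_of_nonneg_right hCL hX
        _ = _ := by ring
    · letI : Fintype (B9GeoNormsKLevelV1.geo9K x.toKIdx).Site := ‹Fintype (geo9Y x).Site›
      have h := eta_mul_norm_O_cdS_le_of_eBlock x.toKIdx b (B := bg9YC 𝔸 G P x) (fun U => U) (GpY x.toKIdx par) par (U₁ := U) (B₀ := B₁) (δ := δ) ιB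
        hE' hB₁ hι hM₂ hrepr hU1 hN f y y' hs hE1 μ hw
      calc _ ≤ (mN : ℝ) * (M₂ * ∑ j, ‖b j‖) * Real.exp (|δ| * (2 * ((d : ℝ) + 1))) * (B₁ * (geo9Y x).len y * ex * N) := h
        _ = (mN : ℝ) * (M₂ * ∑ j, ‖b j‖) * Real.exp (|δ| * (2 * ((d : ℝ) + 1))) * B₁ * ((geo9Y x).len y * ex * N) := by ring
        _ ≤ (cL + cR) * B₁ * ((geo9Y x).len y * ex * N) := mul_le_mul_of_nonneg_right hCR' hX
        _ = _ := by ring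
    · have h := eta_mul_norm_cdsS_le_of_eBlock x.toKIdx b (B := bg9YC 𝔸 G P x) (fun U => U) (GpY x.toKIdx par) par (U₁ := U) (B₀ := B₁) (δ := δ) hE'
        hM₂ hrepr f y y' hs hE1 μ hw
      calc _ ≤ B₁ * (geo9Y x).len y * ex * N := h
        _ = B₁ * ((geo9Y x).len y * ex * N) := by ring
        _ ≤ (cL + cR) * B₁ * ((geo9Y x).len y * ex * N) := mul_le_mul_of_nonneg_right hC1 hX
        _ = _ := by ring
    · have h := norm_lapS_le_of_eBlock x.toKIdx b (B := bg9YC 𝔸 G P x) (fun U => U) (GpY x.toKIdx par) par (U₁ := U) (B₀ := B₁) (δ := δ) hE'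
        hM₂ hrepr f y y' hs hE1 hw
      calc _ ≤ B₁ * 1 * ex * N := h
        _ = B₁ * (ex * N) := by ring
        _ ≤ (cL + cR) * B₁ * (ex * N) := mul_le_mul_of_nonneg_right hC1 hX0
        _ = _ := by ring

end Write

/-! ## §2 The `hin` estimate of the family transfer at one regular base -/

section Hin

open Literature.MathematicalPhysics.QuantumFieldTheory.Balaban1983to89.B6KLevelCensusIndexV1 (KIdx kGeo)
open Literature.MathematicalPhysics.QuantumFieldTheory.Balaban1983to89.B6Ineq2142KLevelV1 (β)
open Literature.MathematicalPhysics.QuantumFieldTheory.Balaban1983to89.B9FromB6 (EBlock pref4_nonneg pref6_nonneg)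
open Literature.MathematicalPhysics.QuantumFieldTheory.Balaban1983to89.B9SectBCodedCarrier (CCfg pullK)
open Literature.MathematicalPhysics.QuantumFieldTheory.Balaban1983to89.B9Eq360DeltaPrimeAY (AfldY)
open Literature.MathematicalPhysics.QuantumFieldTheory.Balaban1983to89.B9PinMembersKLevelV1 (MemberY geo9Y bg9Y)
open Literature.MathematicalPhysics.QuantumFieldTheory.Balaban1983to89.B9SectBGpLettersY (GVal)
open Literature.MathematicalPhysics.QuantumFieldTheory.Balaban1983to89.B9SectBGpFrameCodedYR (codingYx)
open Literature.MathematicalPhysics.QuantumFieldTheory.Balaban1983to89.B9SectBGpReadingsYR (KSC)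
open Literature.MathematicalPhysics.QuantumFieldTheory.Balaban1983to89.B9SectBGpReadingsY (supNorm_nonneg)
open Literature.MathematicalPhysics.QuantumFieldTheory.Balaban1983to89.Node00 (SiteY BlkY IBondY CfgY SiteParY kernelFamilyS GpY)
open Literature.MathematicalPhysics.QuantumFieldTheory.Balaban1983to89.B9RWSumsReadsNbr (nbr)
open Literature.MathematicalPhysics.QuantumFieldTheory.Balaban1983to89.B9GeoNormsKLevelV1 (geo9K_supNorm_nonneg geo9K_l2Norm_nonneg geo9K_wNorm_nonneg
  geo9K_cutSup_nonneg)

variable {d ℓ : ℕ} {hd : 1 ≤ d + 1} {hL : Odd (ℓ + 1) ∧ 1 < ℓ + 1} {b₀ b₁ : ℝ} {Mstar : ℕ} (P : RegExtraY d ℓ hd hL b₀ b₁ Mstar 𝔸) [CompleteSpace 𝔸]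
  (G : Subgroup 𝔸ˣ) (x : MemberY d ℓ hd hL b₀ b₁ Mstar) (par : SiteParY 𝔸 x.toKIdx) {ι : Type} [Fintype ι]
  (b : Module.Basis ι ℝ 𝔸) (ιB : BlkY x.toKIdx → IBondY x.toKIdx) (C37 C38 : ℝ → CfgY 𝔸 x.toKIdx → AfldY 𝔸 x.toKIdx → Prop)

omit [Fintype ι] in
/-- the (3.42) ∕ (3.46) ∕ (3.47) block of ANY family over the coded carrier is monotone in its constant `B₀` (all factors nonnegative at the record
geometry). [cite: Balaban1985BackgroundPropagators, (3.42) + (3.46) + (3.47) pp.397–398, bookkeeping] -/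
theorem ineq342_346_347_mono (K : B9.KernelFamily (geo9Y x) (codingYx P G x C37 C38).bg) {B₀ B₀' δ : ℝ} {c : (codingYx P G x C37 C38).bg.Cfg}
    (hle : B₀ ≤ B₀') (h : B9.Ineq342_346_347 K B₀ δ c) : B9.Ineq342_346_347 K B₀' δ c := by
  refine ⟨fun n lam y y' hs => (h.1 n lam y y' hs).trans ?_, fun n lam hh y y' hc hs => (h.2.1 n lam hh y y' hc hs).trans ?_,
    fun n lam γ h4 h4' => (h.2.2 n lam γ h4 h4').trans ?_⟩
  · have h1 : 0 ≤ B9.pref4 ((geo9Y x).len y) n := pref4_nonneg (B9GeoLemma21KLevelV1.geo9Y_len_pos x y).le n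
    have h2 : 0 ≤ (geo9Y x).supNorm lam := geo9K_supNorm_nonneg x.toKIdx lam
    have h3 := (Real.exp_pos (-(δ * (geo9Y x).dist y y'))).le
    gcongr
  · have h1 : 0 ≤ B9.pref6 ((geo9Y x).len y) n := pref6_nonneg (B9GeoLemma21KLevelV1.geo9Y_len_pos x y).le n
    have h2 : 0 ≤ (geo9Y x).l2Norm lam := geo9K_l2Norm_nonneg x.toKIdx lam
    have h3 := (Real.exp_pos (-(δ * (geo9Y x).dist y y'))).le
    have h4 : 0 ≤ (geo9Y x).cutSup hh := geo9K_cutSup_nonneg x.toKIdx hh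
    gcongr
  · have h2 : 0 ≤ (geo9Y x).wNorm γ lam := geo9K_wNorm_nonneg x.toKIdx γ lam
    gcongr

/-- the record's (3.42) block at the base, from the block of the pulled-back family at `base U` (a re-reading: `(pullK 𝔠 K).e n (base U) = K.e n U`).
[cite: Balaban1985BackgroundPropagators, (3.42) p.397, bookkeeping] -/
theorem eBlock_of_pullK_base {U : CfgY 𝔸 x.toKIdx} {B₀ δ₀ : ℝ}
    (h : EBlock (pullK (codingYx P G x C37 C38) (kernelFamilyS x.toKIdx (bg9YC 𝔸 G P x) (fun U => U) (GpY x.toKIdx par) par)) B₀ δ₀ (.base U)) :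
    EBlock (kernelFamilyS x.toKIdx (bg9YC 𝔸 G P x) (fun U => U) (GpY x.toKIdx par) par) B₀ δ₀ U := by
  intro n lam y y' hs
  exact h n lam y y' hs

/-- the five untouched members of the augmented readings ARE the record's at the decoded configuration (projections of the `with`-update).
[cite: Balaban1985BackgroundPropagators, (3.43)–(3.47) p.398, bookkeeping] -/
theorem KSC_members_base (U : CfgY 𝔸 x.toKIdx) :
    (KSC P G x par C37 C38).h1 (.base U) = (kernelFamilyS x.toKIdx (bg9YC 𝔸 G P x) (fun U => U) (GpY x.toKIdx par) par).h1 U ∧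
    (KSC P G x par C37 C38).e4 (.base U) = (kernelFamilyS x.toKIdx (bg9YC 𝔸 G P x) (fun U => U) (GpY x.toKIdx par) par).e4 U ∧
    (KSC P G x par C37 C38).h2 (.base U) = (kernelFamilyS x.toKIdx (bg9YC 𝔸 G P x) (fun U => U) (GpY x.toKIdx par) par).h2 U ∧
    (∀ n, (KSC P G x par C37 C38).l2 n (.base U) = (kernelFamilyS x.toKIdx (bg9YC 𝔸 G P x) (fun U => U) (GpY x.toKIdx par) par).l2 n U) ∧
    (∀ n, (KSC P G x par C37 C38).glob n (.base U) = (kernelFamilyS x.toKIdx (bg9YC 𝔸 G P x) (fun U => U) (GpY x.toKIdx par) par).glob n U) :=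
  ⟨rfl, rfl, rfl, fun _ => rfl, fun _ => rfl⟩

/-- the five untouched members of the pulled-back record family at a coded configuration. [cite: Balaban1985BackgroundPropagators, (3.43)–(3.47) p.398, bookkeeping] -/
theorem pullK_members_base (K : B9.KernelFamily (geo9Y x) (bg9YC 𝔸 G P x)) (U : CfgY 𝔸 x.toKIdx) :
    (pullK (codingYx P G x C37 C38) K).h1 (.base U) = K.h1 U ∧
    (pullK (codingYx P G x C37 C38) K).e4 (.base U) = K.e4 U ∧
    (pullK (codingYx P G x C37 C38) K).h2 (.base U) = K.h2 U ∧
    (∀ n, (pullK (codingYx P G x C37 C38) K).l2 n (.base U) = K.l2 n U) ∧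
    (∀ n, (pullK (codingYx P G x C37 C38) K).glob n (.base U) = K.glob n U) :=
  ⟨rfl, rfl, rfl, fun _ => rfl, fun _ => rfl⟩

omit [Fintype ι] in
/-- the Hölder block (3.43)–(3.45) only sees the members `h1`, `e4`, `h2` at the configuration: two families agreeing there satisfy it together.
[cite: Balaban1985BackgroundPropagators, (3.43)–(3.45) p.398, bookkeeping] -/
theorem ineq343_345_congr (K K' : B9.KernelFamily (geo9Y x) (codingYx P G x C37 C38).bg) {c : (codingYx P G x C37 C38).bg.Cfg}
    (hh1 : K.h1 c = K'.h1 c) (he4 : K.e4 c = K'.e4 c) (hh2 : K.h2 c = K'.h2 c) (Bβ Bε : ℝ → ℝ) (Bεβ : ℝ → ℝ → ℝ) (δ₀ : ℝ)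
    (h : B9.Ineq343_345 K Bβ Bε Bεβ δ₀ c) : B9.Ineq343_345 K' Bβ Bε Bεβ δ₀ c := by
  unfold B9.Ineq343_345 at h ⊢
  rw [← hh1, ← he4, ← hh2]
  exact h

/-- ★★ **THE `hin` ESTIMATE OF THE FAMILY TRANSFER AT ONE REGULAR BASE**: at a `G`-valued `U` (above the M-threshold `2(d+1) < M`, with the
neighbourhood count `mN`), the block `Thms31to33IneqAt` of the record's G′ family READ ALONG THE DECODING (`pullK`) at `base U` implies the same block
for the augmented readings `KSC`, with `B₀ ↦ c_in(δ₀)·max B₀ 0` and every other constant unchanged — the Hölder ∕ (3.44)–(3.45) ∕ L² ∕ global members of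
`KSC` ARE the record's at the decoded configuration, and the `GA`, `C` blocks are untouched (the former re-read at the larger constant).
[cite: Balaban1985BackgroundPropagators, Thms 3.1–3.3 (3.42)–(3.48) pp.397–399, (3.3) p.390, (3.8) p.392; Balaban1984PropagatorsII, Lemma 2.1 (2.61) p.234] -/
theorem thms_KSC_base_of_pullK [Fintype (geo9Y x).Site] (hι : ∀ s : BlkY x.toKIdx, β x.toKIdx.hN x.toKIdx.D x.toKIdx.hk (ιB s) = s)
    (hG1 : ∀ u : 𝔸ˣ, u ∈ G → ‖(u : 𝔸)‖ ≤ 1) {U : CfgY 𝔸 x.toKIdx} (hU : GVal G x.toKIdx U)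
    {M₂ : ℝ} (hM₂ : 0 ≤ M₂) (hrepr : ∀ (v : 𝔸) (j : ι), |b.repr v j| ≤ M₂ * ‖v‖) (hM : 2 * ((d : ℝ) + 1) < (geo9Y x).M)
    {mN : ℕ} (hN : ∀ a : IBondY x.toKIdx, (nbr (geo9Y x) (2 * ((d : ℝ) + 1)) a).card ≤ mN)
    (dC : ℕ) (GA : B9.KernelFamily (geo9Y x) (codingYx P G x C37 C38).bg) (Cinv : B9.SiteKernel (geo9Y x) (codingYx P G x C37 C38).bg)
    {B₀ δ₀ : ℝ} {Bβ Bε : ℝ → ℝ} {Bεβ : ℝ → ℝ → ℝ} {B₁ δ₁ : ℝ}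
    (h : B9.Thms31to33IneqAt dC (pullK (codingYx P G x C37 C38) (kernelFamilyS x.toKIdx (bg9YC 𝔸 G P x) (fun U => U) (GpY x.toKIdx par) par)) GA Cinv
      B₀ δ₀ Bβ Bε Bεβ B₁ δ₁ (.base U)) :
    B9.Thms31to33IneqAt dC (KSC P G x par C37 C38) GA Cinv
      ((((ℓ + 1 : ℕ) : ℝ) * Real.exp (|δ₀| * (2 * ((d : ℝ) + 1))) + ((mN : ℝ) * (M₂ * ∑ j, ‖b j‖) * Real.exp (|δ₀| * (2 * ((d : ℝ) + 1))) + 1))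
        * max B₀ 0) δ₀ Bβ Bε Bεβ B₁ δ₁ (.base U) := by
  set cIn : ℝ := ((ℓ + 1 : ℕ) : ℝ) * Real.exp (|δ₀| * (2 * ((d : ℝ) + 1))) + ((mN : ℝ) * (M₂ * ∑ j, ‖b j‖) * Real.exp (|δ₀| * (2 * ((d : ℝ) + 1))) + 1)
    with hcIn
  set K := kernelFamilyS x.toKIdx (bg9YC 𝔸 G P x) (fun U => U) (GpY x.toKIdx par) par with hK
  have hSb : 0 ≤ ∑ j, ‖b j‖ := Finset.sum_nonneg fun _ _ => norm_nonneg _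
  have h1 : 1 ≤ cIn := by
    have h1 : (1 : ℝ) ≤ ((ℓ + 1 : ℕ) : ℝ) := by exact_mod_cast Nat.succ_le_succ (Nat.zero_le ℓ)
    have h2 : (1 : ℝ) ≤ Real.exp (|δ₀| * (2 * ((d : ℝ) + 1))) := Real.one_le_exp (by positivity)
    have h3 : 0 ≤ (mN : ℝ) * (M₂ * ∑ j, ‖b j‖) * Real.exp (|δ₀| * (2 * ((d : ℝ) + 1))) := by positivity
    rw [hcIn]; nlinarith
  have hB : B₀ ≤ cIn * max B₀ 0 := by
    have hm : B₀ ≤ max B₀ 0 := le_max_left _ _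
    have hm0 : 0 ≤ max B₀ 0 := le_max_right _ _
    nlinarith
  obtain ⟨⟨h42, h43⟩, hC, ⟨g42, g43⟩⟩ := h
  have h42' := ineq342_346_347_mono P G x C37 C38 _ hB h42
  -- the member identities at the base: both sides are the record's members at `U`
  have mK := KSC_members_base P G x par C37 C38 U
  have mP := pullK_members_base P G x C37 C38 K U
  refine ⟨⟨⟨?_, ?_, ?_⟩, ?_⟩, hC, ⟨ineq342_346_347_mono P G x C37 C38 GA hB g42, g43⟩⟩
  · -- the (3.42) block: the two cross entries
    exact eBlock_KSC_base P G x par b ιB C37 C38 hι hG1 hU (eBlock_of_pullK_base P G x par C37 C38 h42.1) hM₂ hrepr hM hN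
  · -- (3.46): the same members
    intro n lam hh y y' hc hs
    have e1 := congrFun (congrFun (mK.2.2.2.1 n) lam) hh
    have e2 := congrFun (congrFun (mP.2.2.2.1 n) lam) hh
    rw [e1, ← e2]
    exact h42'.2.1 n lam hh y y' hc hs
  · -- (3.47): the same members
    intro n lam γ h4 h4'
    have e1 := congrFun (congrFun (mK.2.2.2.2 n) lam) γ
    have e2 := congrFun (congrFun (mP.2.2.2.2 n) lam) γ
    rw [e1, ← e2]
    exact h42'.2.2 n lam γ h4 h4'
  · -- (3.43)–(3.45): the same members
    exact ineq343_345_congr P G x C37 C38 _ _ (mP.1.trans mK.1.symm) (mP.2.1.trans mK.2.1.symm) (mP.2.2.1.trans mK.2.2.1.symm) Bβ Bε Bεβ δ₀ h43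

end Hin

/-! ## §3 The hypothesis `hin` of the family transfer, literally -/

section HinFamily

open Literature.MathematicalPhysics.QuantumFieldTheory.Balaban1983to89.B6Ineq2142KLevelV1 (β)
open Literature.MathematicalPhysics.QuantumFieldTheory.Balaban1983to89.B9SectBCodedCarrier (CCfg pullK)
open Literature.MathematicalPhysics.QuantumFieldTheory.Balaban1983to89.B9Eq360DeltaPrimeAY (AfldY)
open Literature.MathematicalPhysics.QuantumFieldTheory.Balaban1983to89.B9PinMembersKLevelV1 (MemberY geo9Y bg9Y)
open Literature.MathematicalPhysics.QuantumFieldTheory.Balaban1983to89.B9SectBGpLettersY (GVal)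
open Literature.MathematicalPhysics.QuantumFieldTheory.Balaban1983to89.B9SectBGpFrameCodedYR (codingYx)
open Literature.MathematicalPhysics.QuantumFieldTheory.Balaban1983to89.B9SectBGpReadingsYR (KSC)
open Literature.MathematicalPhysics.QuantumFieldTheory.Balaban1983to89.Node00 (SiteY BlkY IBondY CfgY SiteParY kernelFamilyS GpY)
open Literature.MathematicalPhysics.QuantumFieldTheory.Balaban1983to89.B9GeoNbrCountKLevelV1 (exists_card_nbr_geo9Y_le_of_M)

variable {d ℓ : ℕ} {hd : 1 ≤ d + 1} {hL : Odd (ℓ + 1) ∧ 1 < ℓ + 1} {b₀ b₁ : ℝ} {Mstar : ℕ} (P : RegExtraY d ℓ hd hL b₀ b₁ Mstar 𝔸) [CompleteSpace 𝔸]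

/-- ★★★ **THE HYPOTHESIS `hin` OF `sectBStepPrinted_of_family`, LITERALLY**, for `Gp₁ := KSC` (augmented readings) and `Gp₂ :=` the record's G′
family read along the decoding, over def-Y's members and the coded carriers: for all input constants there are an M-threshold (the neighbourhood count's
`ML` ∨ `2(d+1)+1`), a vacuous `α₀`-cap `1`, and the constants `(c_in(δ₀)·max B₀ 0, δ₀, B_β, B_ε, B_εβ, B₁, δ₁)` such that at every regular coded
configuration (necessarily `base U` with `U` `G`-valued) the record's block implies the augmented one.  Structural data displayed: `G` of unit norms
(`hG1`), a real basis `b` with coordinate constant `M₂`, block labels `ιB` (sections of `β`).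
[cite: Balaban1985BackgroundPropagators, Thms 3.1–3.3 (3.42)–(3.48) pp.397–399, (3.35) p.396, p.403 l.1–9; Balaban1984PropagatorsII, Lemma 2.1 (2.61) p.234] -/
theorem hin_KSC [∀ x : MemberY d ℓ hd hL b₀ b₁ Mstar, Fintype (geo9Y x).Site] (G : Subgroup 𝔸ˣ) (hG1 : ∀ u : 𝔸ˣ, u ∈ G → ‖(u : 𝔸)‖ ≤ 1)
    (par : ∀ x : MemberY d ℓ hd hL b₀ b₁ Mstar, SiteParY 𝔸 x.toKIdx) {ι : Type} [Fintype ι] (b : Module.Basis ι ℝ 𝔸)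
    {M₂ : ℝ} (hM₂ : 0 ≤ M₂) (hrepr : ∀ (v : 𝔸) (j : ι), |b.repr v j| ≤ M₂ * ‖v‖)
    (ιB : ∀ x : MemberY d ℓ hd hL b₀ b₁ Mstar, BlkY x.toKIdx → IBondY x.toKIdx)
    (hι : ∀ (x : MemberY d ℓ hd hL b₀ b₁ Mstar) (s : BlkY x.toKIdx), β x.toKIdx.hN x.toKIdx.D x.toKIdx.hk (ιB x s) = s)
    (C37 C38 : ∀ x : MemberY d ℓ hd hL b₀ b₁ Mstar, ℝ → CfgY 𝔸 x.toKIdx → AfldY 𝔸 x.toKIdx → Prop) (c35 : ℝ) (dC : ℕ)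
    (GA : ∀ x : MemberY d ℓ hd hL b₀ b₁ Mstar, B9.KernelFamily (geo9Y x) (codingYx P G x (C37 x) (C38 x)).bg)
    (Cinv : ∀ x : MemberY d ℓ hd hL b₀ b₁ Mstar, B9.SiteKernel (geo9Y x) (codingYx P G x (C37 x) (C38 x)).bg) :
    ∀ (B₀ δ₀ : ℝ) (Bβ Bε : ℝ → ℝ) (Bεβ : ℝ → ℝ → ℝ) (B₁ δ₁ : ℝ),
      ∃ (Mi ai B₀' δ₀' : ℝ) (Bβ' Bε' : ℝ → ℝ) (Bεβ' : ℝ → ℝ → ℝ) (B₁' δ₁' : ℝ), 0 < ai ∧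
        ∀ x : MemberY d ℓ hd hL b₀ b₁ Mstar, Mi ≤ (geo9Y x).M → ∀ α₀ : ℝ, 0 < α₀ → (geo9Y x).M * α₀ ≤ ai →
          ∀ c : (codingYx P G x (C37 x) (C38 x)).bg.Cfg, (codingYx P G x (C37 x) (C38 x)).bg.Reg335 c35 α₀ c →
          B9.Thms31to33IneqAt dC (pullK (codingYx P G x (C37 x) (C38 x))
              (kernelFamilyS x.toKIdx (bg9YC 𝔸 G P x) (fun U => U) (GpY x.toKIdx (par x)) (par x))) (GA x) (Cinv x) B₀ δ₀ Bβ Bε Bεβ B₁ δ₁ c →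
          B9.Thms31to33IneqAt dC (KSC P G x (par x) (C37 x) (C38 x)) (GA x) (Cinv x) B₀' δ₀' Bβ' Bε' Bεβ' B₁' δ₁' c := by
  intro B₀ δ₀ Bβ Bε Bεβ B₁ δ₁
  obtain ⟨ML, mN, hcnt⟩ := exists_card_nbr_geo9Y_le_of_M (d := d) (ℓ := ℓ) (hd := hd) (hL := hL) (b₀ := b₀) (b₁ := b₁) (2 * ((d : ℝ) + 1))
  refine ⟨max ML (2 * ((d : ℝ) + 1) + 1), 1,
    (((ℓ + 1 : ℕ) : ℝ) * Real.exp (|δ₀| * (2 * ((d : ℝ) + 1))) + ((mN : ℝ) * (M₂ * ∑ j, ‖b j‖) * Real.exp (|δ₀| * (2 * ((d : ℝ) + 1))) + 1))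
      * max B₀ 0, δ₀, Bβ, Bε, Bεβ, B₁, δ₁, one_pos, fun x hM α₀ _ _ c hreg hT => ?_⟩
  obtain ⟨U, rfl, hU335⟩ := (codingYx P G x (C37 x) (C38 x)).exists_of_bg_Reg335 hreg
  have hU : GVal G x.toKIdx U := hU335.1.1
  have hM2 : 2 * ((d : ℝ) + 1) < (geo9Y x).M := by
    have := le_trans (le_max_right _ _) hM
    linarith
  have hML : ML ≤ (geo9Y x).M := le_trans (le_max_left _ _) hM
  exact thms_KSC_base_of_pullK P G x (par x) b (ιB x) (C37 x) (C38 x) (hι x) hG1 hU hM₂ hrepr hM2 (fun a => hcnt Mstar x hML a) dC (GA x) (Cinv x) hT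

end HinFamily

end Literature.MathematicalPhysics.QuantumFieldTheory.Balaban1983to89.B9SectBGpTransferInYR

/-!
# `Balaban1983to89.B9SectBGpTransferOutYR` — THE CLASS-PARAMETRIC TWIN of `B9SectBGpTransferOutY` (CASCADE-R, director-ym №279 GO-R; №277 (3) `hunitA` cure; dag-n06-d SOCKET-(α) class question)

statement-level skeleton of published theorems with citation tags; proofs where landed; nothing here is a claim about the
Yang–Mills mass gap

WHAT THIS FILE IS.  The original module `B9SectBGpTransferOutY` types its objects over MODULE 3's member carrier `bg9Y 𝔸 G x` (MODULE 2's small-cube class (3.35)).  This file RE-DECLARES, with UNCHANGED NAMES inside the namespace `…B9SectBGpTransferOutYR`, exactly its 5 class-dependent declarations over the CLASS-PARAMETRIC carrier `B9SectBCodedClassR.bg9YC 𝔸 G P x` (`P : RegExtraY …` = the two cube conditions of (3.35)∕(3.36) as a parameter; `bg9Y 𝔸 G x = bg9YC 𝔸 G (extraY 𝔸 G) x` by `rfl`, so every declaration here specialises definitionally to its original; at the record's reading of PRINT's class, `P := extraYPb 𝔸 G`, the displayed laws `hreg335P` ((3.35) on plaquettes) and the class-keyed `hunitA` become theorems).  The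 text is the original's VERBATIM under the token surgery `bg9Y 𝔸 G ↦ bg9YC 𝔸 G P`, `NAME ↦ NAME P` for the class-dependent names (P the first explicit argument), and — №277 — the binder `hunitA` re-keyed from «all G-valued U» to «all (3.35)-regular U of the carrier» (`∀ j α₀ U, (bg9YC 𝔸 G P (f j)).Reg335 c35 α₀ U → IsUnit (deltaAY …)`).  Class-free declarations of the original are NOT copied: they are imported and used BY NAME (`open … hiding` the re-declared ones).  Generated by dag-n06-c g16's `gen.py` (HOME `pub-ymgap-dag-n06-c/lean/g16/`); the ORIGINAL MODULE DOCUMENTATION FOLLOWS VERBATIM and describes the mathematics.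

HONEST SCOPE.  Re-typing bookkeeping; nothing of [B9] asserted beyond the original; COUNT-NEUTRAL; N06 NOT discharged; nothing continuum ∕ OS ∕ mass gap ∕ Clay.  Cell `pub-ymgap` (D-0062), Track A node N06 [B9], seat `pub-ymgap-dag-n06-c` g16, 2026-08-29.
-/

/-! Module documentation: that of the original `Balaban1983to89.B9SectBGpTransferOutY` applies verbatim to this twin (not repeated here). -/

noncomputable section

namespace Literature.MathematicalPhysics.QuantumFieldTheory.Balaban1983to89.B9SectBGpTransferOutYR

open Literature.MathematicalPhysics.QuantumFieldTheory.Balaban1983to89.B9SectBCodedClassR (RegExtraY bg9YC)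
open Literature.MathematicalPhysics.QuantumFieldTheory.Balaban1983to89.B9SectBGpTransferOutY hiding KSC_members_prod pullK_members_prod ineq342_346_347_weaken ineq343_345_antitone thms_pullK_prod_of_KSC

open Literature.MathematicalPhysics.QuantumFieldTheory.Balaban1983to89.B6KLevelCensusIndexV1 (KIdx kGeo)
open Literature.MathematicalPhysics.QuantumFieldTheory.Balaban1983to89.B6Ineq2142KLevelV1 (β)
open Literature.MathematicalPhysics.QuantumFieldTheory.Balaban1983to89.B9FromB6 (EBlock pref4_nonneg pref6_nonneg)
open Literature.MathematicalPhysics.QuantumFieldTheory.Balaban1983to89.B9Eq39Adjoint (fluct)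
open Literature.MathematicalPhysics.QuantumFieldTheory.Balaban1983to89.B9SectBCodedCarrier (CCfg pullK)
open Literature.MathematicalPhysics.QuantumFieldTheory.Balaban1983to89.B9Eq360DeltaPrimeAY (AfldY mulY)
open Literature.MathematicalPhysics.QuantumFieldTheory.Balaban1983to89.B9PinMembersKLevelV1 (MemberY geo9Y bg9Y)
open Literature.MathematicalPhysics.QuantumFieldTheory.Balaban1983to89.B9SectBGpFrameCodedYR (codingYx)
open Literature.MathematicalPhysics.QuantumFieldTheory.Balaban1983to89.B9SectBGpReadingsYR (KSC)
open Literature.MathematicalPhysics.QuantumFieldTheory.Balaban1983to89.B9SectBGpTransferInYR (ineq342_346_347_mono ineq343_345_congr)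
open Literature.MathematicalPhysics.QuantumFieldTheory.Balaban1983to89.Node00 (SiteY BlkY IBondY CfgY SiteParY kernelFamilyS GpY)
open Literature.MathematicalPhysics.QuantumFieldTheory.Balaban1983to89.B9GeoNormsKLevelV1 (geo9K_supNorm_nonneg geo9K_l2Norm_nonneg geo9K_wNorm_nonneg
  geo9K_cutSup_nonneg geo9K_dist_nonneg)

variable {𝔸 : Type} [NormedRing 𝔸] [NormedAlgebra ℂ 𝔸] [CompleteSpace 𝔸]
variable {d ℓ : ℕ} {hd : 1 ≤ d + 1} {hL : Odd (ℓ + 1) ∧ 1 < ℓ + 1} {b₀ b₁ : ℝ} {Mstar : ℕ} (P : RegExtraY d ℓ hd hL b₀ b₁ Mstar 𝔸)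
  (G : Subgroup 𝔸ˣ) (x : MemberY d ℓ hd hL b₀ b₁ Mstar) (par : SiteParY 𝔸 x.toKIdx) (C37 C38 : ℝ → CfgY 𝔸 x.toKIdx → AfldY 𝔸 x.toKIdx → Prop)

/-! ## §1 The members at a coded product ARE the record's at `W = U′U` -/

/-- the five untouched members of the augmented readings at the coded product `prod U a` are the record's at `W = e^{ηa}·U`.
[cite: Balaban1985BackgroundPropagators, (3.43)–(3.47) p.398, Thm 3.4 p.400, bookkeeping] -/
theorem KSC_members_prod (U : CfgY 𝔸 x.toKIdx) (a : AfldY 𝔸 x.toKIdx) :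
    (KSC P G x par C37 C38).h1 (.prod U a)
        = (kernelFamilyS x.toKIdx (bg9YC 𝔸 G P x) (fun U => U) (GpY x.toKIdx par) par).h1 (mulY x.toKIdx (fluct (kGeo x.toKIdx).eta a) U) ∧
    (KSC P G x par C37 C38).e4 (.prod U a)
        = (kernelFamilyS x.toKIdx (bg9YC 𝔸 G P x) (fun U => U) (GpY x.toKIdx par) par).e4 (mulY x.toKIdx (fluct (kGeo x.toKIdx).eta a) U) ∧
    (KSC P G x par C37 C38).h2 (.prod U a)
        = (kernelFamilyS x.toKIdx (bg9YC 𝔸 G P x) (fun U => U) (GpY x.toKIdx par) par).h2 (mulY x.toKIdx (fluct (kGeo x.toKIdx).eta a) U) ∧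
    (∀ n, (KSC P G x par C37 C38).l2 n (.prod U a)
        = (kernelFamilyS x.toKIdx (bg9YC 𝔸 G P x) (fun U => U) (GpY x.toKIdx par) par).l2 n (mulY x.toKIdx (fluct (kGeo x.toKIdx).eta a) U)) ∧
    (∀ n, (KSC P G x par C37 C38).glob n (.prod U a)
        = (kernelFamilyS x.toKIdx (bg9YC 𝔸 G P x) (fun U => U) (GpY x.toKIdx par) par).glob n (mulY x.toKIdx (fluct (kGeo x.toKIdx).eta a) U)) :=
  ⟨rfl, rfl, rfl, fun _ => rfl, fun _ => rfl⟩

/-- the members (all six) of the record family read along the decoding at the coded product `prod U a` are its members at `W = e^{ηa}·U`.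
[cite: Balaban1985BackgroundPropagators, (3.42)–(3.47) pp.397–398, Thm 3.4 p.400, bookkeeping] -/
theorem pullK_members_prod (K : B9.KernelFamily (geo9Y x) (bg9YC 𝔸 G P x)) (U : CfgY 𝔸 x.toKIdx) (a : AfldY 𝔸 x.toKIdx) :
    (∀ n, (pullK (codingYx P G x C37 C38) K).e n (.prod U a) = K.e n (mulY x.toKIdx (fluct (kGeo x.toKIdx).eta a) U)) ∧
    (pullK (codingYx P G x C37 C38) K).h1 (.prod U a) = K.h1 (mulY x.toKIdx (fluct (kGeo x.toKIdx).eta a) U) ∧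
    (pullK (codingYx P G x C37 C38) K).e4 (.prod U a) = K.e4 (mulY x.toKIdx (fluct (kGeo x.toKIdx).eta a) U) ∧
    (pullK (codingYx P G x C37 C38) K).h2 (.prod U a) = K.h2 (mulY x.toKIdx (fluct (kGeo x.toKIdx).eta a) U) ∧
    (∀ n, (pullK (codingYx P G x C37 C38) K).l2 n (.prod U a) = K.l2 n (mulY x.toKIdx (fluct (kGeo x.toKIdx).eta a) U)) ∧
    (∀ n, (pullK (codingYx P G x C37 C38) K).glob n (.prod U a) = K.glob n (mulY x.toKIdx (fluct (kGeo x.toKIdx).eta a) U)) :=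
  ⟨fun _ => rfl, rfl, rfl, rfl, fun _ => rfl, fun _ => rfl⟩

/-! ## §2 `hout` reduced to the letter conversion of the (3.42) block -/

/-- the (3.42) ∕ (3.46) ∕ (3.47) block is monotone in `B₀ ≥ 0` upward AND in the rate `δ₀` downward (distances are nonnegative).
[cite: Balaban1985BackgroundPropagators, (3.42) + (3.46) + (3.47) pp.397–398, bookkeeping] -/
theorem ineq342_346_347_weaken (K : B9.KernelFamily (geo9Y x) (codingYx P G x C37 C38).bg) {B₀ B₀' δ δ' : ℝ} {c : (codingYx P G x C37 C38).bg.Cfg}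
    (hB0 : 0 ≤ B₀) (hle : B₀ ≤ B₀') (hδ : δ' ≤ δ) (h : B9.Ineq342_346_347 K B₀ δ c) : B9.Ineq342_346_347 K B₀' δ' c := by
  have hB0' : 0 ≤ B₀' := hB0.trans hle
  have hexp : ∀ y y' : IBondY x.toKIdx, Real.exp (-(δ * (geo9Y x).dist y y')) ≤ Real.exp (-(δ' * (geo9Y x).dist y y')) := fun y y' =>
    Real.exp_le_exp.2 (by
      have hD : 0 ≤ (geo9Y x).dist y y' := geo9K_dist_nonneg x.toKIdx y y'
      nlinarith [mul_le_mul_of_nonneg_right hδ hD])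
  refine ⟨fun n lam y y' hs => (h.1 n lam y y' hs).trans ?_, fun n lam hh y y' hc hs => (h.2.1 n lam hh y y' hc hs).trans ?_,
    (ineq342_346_347_mono P G x C37 C38 K hle h).2.2⟩
  · have h1 : 0 ≤ B9.pref4 ((geo9Y x).len y) n := pref4_nonneg (B9GeoLemma21KLevelV1.geo9Y_len_pos x y).le n
    have h2 : 0 ≤ (geo9Y x).supNorm lam := geo9K_supNorm_nonneg x.toKIdx lam
    have h3 := hexp y y'
    have h4 := (Real.exp_pos (-(δ * (geo9Y x).dist y y'))).le
    have h5 : 0 ≤ B₀' * B9.pref4 ((geo9Y x).len y) n := mul_nonneg hB0' h1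
    gcongr
  · have h1 : 0 ≤ B9.pref6 ((geo9Y x).len y) n := pref6_nonneg (B9GeoLemma21KLevelV1.geo9Y_len_pos x y).le n
    have h2 : 0 ≤ (geo9Y x).l2Norm lam := geo9K_l2Norm_nonneg x.toKIdx lam
    have h3 := hexp y y'
    have h4 : 0 ≤ (geo9Y x).cutSup hh := geo9K_cutSup_nonneg x.toKIdx hh
    have h5 := (Real.exp_pos (-(δ * (geo9Y x).dist y y'))).le
    have h6 : 0 ≤ B₀' * B9.pref6 ((geo9Y x).len y) n * (geo9Y x).cutSup hh := mul_nonneg (mul_nonneg hB0' h1) h4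
    gcongr

/-- the Hölder block (3.43)–(3.45) is antitone in the rate `δ₀` for a family with NONNEGATIVE members at the configuration (distances are nonnegative;
the sign of the constants is forced by the members). [cite: Balaban1985BackgroundPropagators, (3.43)–(3.45) p.398, bookkeeping] -/
theorem ineq343_345_antitone (K : B9.KernelFamily (geo9Y x) (codingYx P G x C37 C38).bg) {c : (codingYx P G x C37 C38).bg.Cfg}
    (hn1 : ∀ lam β' ζ, 0 ≤ K.h1 c lam β' ζ) (hn4 : ∀ lam y, 0 ≤ K.e4 c lam y) (hn2 : ∀ lam β' ζ, 0 ≤ K.h2 c lam β' ζ)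
    {δ δ' : ℝ} (hδ : δ' ≤ δ) (Bβ Bε : ℝ → ℝ) (Bεβ : ℝ → ℝ → ℝ) (h : B9.Ineq343_345 K Bβ Bε Bεβ δ c) :
    B9.Ineq343_345 K Bβ Bε Bεβ δ' c := by
  have hexp : ∀ y y' : IBondY x.toKIdx, Real.exp (-(δ * (geo9Y x).dist y y')) ≤ Real.exp (-(δ' * (geo9Y x).dist y y')) := fun y y' =>
    Real.exp_le_exp.2 (by
      have hD : 0 ≤ (geo9Y x).dist y y' := geo9K_dist_nonneg x.toKIdx y y'
      nlinarith [mul_le_mul_of_nonneg_right hδ hD])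
  refine ⟨fun β' lam ζ y y' hb hb' hc hs => ?_, fun ε lam y y' hε hε' hs => ?_, fun ε β' lam ζ y y' hε hε' hb hb' hc hs => ?_⟩
  · have h1 := h.1 β' lam ζ y y' hb hb' hc hs
    exact h1.trans (mul_exp_mono (Real.exp_pos _) (hexp y y') ((hn1 lam β' ζ).trans h1))
  · have h1 := h.2.1 ε lam y y' hε hε' hs
    have h2 : Bε ε * Real.exp (-(δ * (geo9Y x).dist y y')) * ((geo9Y x).holder ε lam + (geo9Y x).supNorm lam)
        ≤ Bε ε * Real.exp (-(δ' * (geo9Y x).dist y y')) * ((geo9Y x).holder ε lam + (geo9Y x).supNorm lam) :=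
      mul_exp_mono (Real.exp_pos _) (hexp y y') ((hn4 lam y).trans h1)
    exact h1.trans h2
  · have h1 := h.2.2 ε β' lam ζ y y' hε hε' hb hb' hc hs
    exact h1.trans (mul_exp_mono (Real.exp_pos _) (hexp y y') ((hn2 lam β' ζ).trans h1))

/-- ★★ **`hout` REDUCED TO THE LETTER CONVERSION OF THE (3.42) BLOCK**: at a coded product `prod U a` (`W = e^{ηa}·U`), the block `Thms31to33IneqAt` of
the augmented readings `KSC` with constants `(B₀, δ₀, …)` (`B₀ ≥ 0`) together with the record's (3.42) block AT `W` WITH LETTERS AT `W`,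
`EBlock (kernelFamilyS … (GpY par) par) B″ δ″ W` (`B″ ≥ 0`) — the converted block, the one analytic input — give the block of the record's family read along
the decoding at `prod U a` with constants `(max B₀ B″, min δ₀ δ″, B_β, B_ε, B_εβ, B₁, δ₁)` (the Hölder members of the `GA` family are assumed nonnegative at
the configuration — true for every reading by suprema, e.g. `kernelFamilyS_members_nonneg`).
[cite: Balaban1985BackgroundPropagators, Thm 3.4 p.400, p.403 («of course with different constants»), p.403 l.1–9, (3.42)–(3.48) pp.397–399] -/
theorem thms_pullK_prod_of_KSC (dC : ℕ) (GA : B9.KernelFamily (geo9Y x) (codingYx P G x C37 C38).bg)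
    (Cinv : B9.SiteKernel (geo9Y x) (codingYx P G x C37 C38).bg) {U : CfgY 𝔸 x.toKIdx} {a : AfldY 𝔸 x.toKIdx}
    (hGA1 : ∀ lam β' ζ, 0 ≤ GA.h1 (.prod U a) lam β' ζ) (hGA4 : ∀ lam y, 0 ≤ GA.e4 (.prod U a) lam y) (hGA2 : ∀ lam β' ζ, 0 ≤ GA.h2 (.prod U a) lam β' ζ)
    {B₀ δ₀ : ℝ} {Bβ Bε : ℝ → ℝ} {Bεβ : ℝ → ℝ → ℝ} {B₁ δ₁ : ℝ} (hB₀ : 0 ≤ B₀)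
    (h : B9.Thms31to33IneqAt dC (KSC P G x par C37 C38) GA Cinv B₀ δ₀ Bβ Bε Bεβ B₁ δ₁ (.prod U a))
    {B'' δ'' : ℝ} (hB'' : 0 ≤ B'')
    (hconv : EBlock (kernelFamilyS x.toKIdx (bg9YC 𝔸 G P x) (fun U => U) (GpY x.toKIdx par) par) B'' δ'' (mulY x.toKIdx (fluct (kGeo x.toKIdx).eta a) U)) :
    B9.Thms31to33IneqAt dC (pullK (codingYx P G x C37 C38) (kernelFamilyS x.toKIdx (bg9YC 𝔸 G P x) (fun U => U) (GpY x.toKIdx par) par)) GA Cinv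
      (max B₀ B'') (min δ₀ δ'') Bβ Bε Bεβ B₁ δ₁ (.prod U a) := by
  set K := kernelFamilyS x.toKIdx (bg9YC 𝔸 G P x) (fun U => U) (GpY x.toKIdx par) par with hK
  set W := mulY x.toKIdx (fluct (kGeo x.toKIdx).eta a) U with hW
  obtain ⟨⟨h42, h43⟩, hC, ⟨g42, g43⟩⟩ := h
  have mK := KSC_members_prod P G x par C37 C38 U a
  have mP := pullK_members_prod P G x C37 C38 K U a
  have h42' := ineq342_346_347_weaken P G x C37 C38 _ hB₀ (le_max_left B₀ B'') (min_le_left δ₀ δ'') h42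
  have hnn := kernelFamilyS_members_nonneg x par (B := bg9YC 𝔸 G P x) (fun U => U) (GpY x.toKIdx par) W
  -- the Hölder block of the pulled-back family: the same members as `KSC`'s, then the smaller rate
  have h43P : B9.Ineq343_345 (pullK (codingYx P G x C37 C38) K) Bβ Bε Bεβ δ₀ (.prod U a) :=
    ineq343_345_congr P G x C37 C38 _ _ (mK.1.trans mP.2.1.symm) (mK.2.1.trans mP.2.2.1.symm) (mK.2.2.1.trans mP.2.2.2.1.symm) Bβ Bε Bεβ δ₀ h43
  have hP1 : ∀ lam β' ζ, 0 ≤ (pullK (codingYx P G x C37 C38) K).h1 (.prod U a) lam β' ζ := fun lam β' ζ => by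
    show 0 ≤ K.h1 W lam β' ζ; exact hnn.1 lam β' ζ
  have hP4 : ∀ lam y, 0 ≤ (pullK (codingYx P G x C37 C38) K).e4 (.prod U a) lam y := fun lam y => by
    show 0 ≤ K.e4 W lam y; exact hnn.2.1 lam y
  have hP2 : ∀ lam β' ζ, 0 ≤ (pullK (codingYx P G x C37 C38) K).h2 (.prod U a) lam β' ζ := fun lam β' ζ => by
    show 0 ≤ K.h2 W lam β' ζ; exact hnn.2.2 lam β' ζ
  refine ⟨⟨⟨?_, ?_, ?_⟩, ineq343_345_antitone P G x C37 C38 _ hP1 hP4 hP2 (min_le_left δ₀ δ'') Bβ Bε Bεβ h43P⟩, hC,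
    ⟨ineq342_346_347_weaken P G x C37 C38 GA hB₀ (le_max_left _ _) (min_le_left _ _) g42,
      ineq343_345_antitone P G x C37 C38 GA hGA1 hGA4 hGA2 (min_le_left δ₀ δ'') Bβ Bε Bεβ g43⟩⟩
  · -- (3.42): the converted block, re-read along the decoding and weakened to the common constants
    intro n lam y y' hs
    show K.e n W lam y ≤ _
    refine (hconv n lam y y' hs).trans ?_
    have h1 : 0 ≤ B9.pref4 ((geo9Y x).len y) n := pref4_nonneg (B9GeoLemma21KLevelV1.geo9Y_len_pos x y).le n
    have h2 : 0 ≤ (geo9Y x).supNorm lam := geo9K_supNorm_nonneg x.toKIdx lam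
    have h3 : Real.exp (-(δ'' * (geo9Y x).dist y y')) ≤ Real.exp (-(min δ₀ δ'' * (geo9Y x).dist y y')) :=
      Real.exp_le_exp.2 (by
        have hD : 0 ≤ (geo9Y x).dist y y' := geo9K_dist_nonneg x.toKIdx y y'
        nlinarith [mul_le_mul_of_nonneg_right (min_le_right δ₀ δ'') hD])
    have h4 := (Real.exp_pos (-(δ'' * (geo9Y x).dist y y'))).le
    have h5 : B'' ≤ max B₀ B'' := le_max_right _ _
    have h6 : 0 ≤ max B₀ B'' * B9.pref4 ((geo9Y x).len y) n := mul_nonneg (hB''.trans h5) h1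
    show B'' * B9.pref4 ((geo9Y x).len y) n * Real.exp (-(δ'' * (geo9Y x).dist y y')) * (geo9Y x).supNorm lam
        ≤ max B₀ B'' * B9.pref4 ((geo9Y x).len y) n * Real.exp (-(min δ₀ δ'' * (geo9Y x).dist y y')) * (geo9Y x).supNorm lam
    gcongr
  · intro n lam hh y y' hc hs
    show K.l2 n W lam hh ≤ _
    have e1 := congrFun (congrFun (mK.2.2.2.1 n) lam) hh
    rw [← e1]
    exact h42'.2.1 n lam hh y y' hc hs
  · intro n lam γ h4 h4'
    show K.glob n W lam γ ≤ _
    have e1 := congrFun (congrFun (mK.2.2.2.2 n) lam) γ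
    rw [← e1]
    exact h42'.2.2 n lam γ h4 h4'

/-! ## §3 The left letter at `W = U′U` against the left letter at `U`, pointwise ((3.70), first step of the conversion) -/

section LeftLetter

open Literature.MathematicalPhysics.QuantumFieldTheory.Balaban1983to89.B9Eq39Adjoint (R R_mul)
open Literature.MathematicalPhysics.QuantumFieldTheory.Balaban1983to89.B9SectBGpLettersY (GVal norm_le_one_and_inv_of_mem)
open Literature.MathematicalPhysics.QuantumFieldTheory.Balaban1983to89.Node00 (UboxY shiftY cdS)

end LeftLetter

end Literature.MathematicalPhysics.QuantumFieldTheory.Balaban1983to89.B9SectBGpTransferOutYR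

/-!
# `Balaban1983to89.B9SectBGpTransferConvYR` — THE CLASS-PARAMETRIC TWIN of `B9SectBGpTransferConvY` (CASCADE-R, director-ym №279 GO-R; №277 (3) `hunitA` cure; dag-n06-d SOCKET-(α) class question)

statement-level skeleton of published theorems with citation tags; proofs where landed; nothing here is a claim about the
Yang–Mills mass gap

WHAT THIS FILE IS.  The original module `B9SectBGpTransferConvY` types its objects over MODULE 3's member carrier `bg9Y 𝔸 G x` (MODULE 2's small-cube class (3.35)).  This file RE-DECLARES, with UNCHANGED NAMES inside the namespace `…B9SectBGpTransferConvYR`, exactly its 3 class-dependent declarations over the CLASS-PARAMETRIC carrier `B9SectBCodedClassR.bg9YC 𝔸 G P x` (`P : RegExtraY …` = the two cube conditions of (3.35)∕(3.36) as a parameter; `bg9Y 𝔸 G x = bg9YC 𝔸 G (extraY 𝔸 G) x` by `rfl`, so every declaration here specialises definitionally to its original; at the record's reading of PRINT's class, `P := extraYPb 𝔸 G`, the displayed laws `hreg335P` ((3.35) on plaquettes) and the class-keyed `hunitA` become theorems).  The text is the original's VERBATIM under the token surgery `bg9Y 𝔸 G ↦ bg9YC 𝔸 G P`, `NAME ↦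 NAME P` for the class-dependent names (P the first explicit argument), and — №277 — the binder `hunitA` re-keyed from «all G-valued U» to «all (3.35)-regular U of the carrier» (`∀ j α₀ U, (bg9YC 𝔸 G P (f j)).Reg335 c35 α₀ U → IsUnit (deltaAY …)`).  Class-free declarations of the original are NOT copied: they are imported and used BY NAME (`open … hiding` the re-declared ones).  Generated by dag-n06-c g16's `gen.py` (HOME `pub-ymgap-dag-n06-c/lean/g16/`); the ORIGINAL MODULE DOCUMENTATION FOLLOWS VERBATIM and describes the mathematics.

HONEST SCOPE.  Re-typing bookkeeping; nothing of [B9] asserted beyond the original; COUNT-NEUTRAL; N06 NOT discharged; nothing continuum ∕ OS ∕ mass gap ∕ Clay.  Cell `pub-ymgap` (D-0062), Track A node N06 [B9], seat `pub-ymgap-dag-n06-c` g16, 2026-08-29.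
-/

/-! Module documentation: that of the original `Balaban1983to89.B9SectBGpTransferConvY` applies verbatim to this twin (not repeated here). -/

noncomputable section

namespace Literature.MathematicalPhysics.QuantumFieldTheory.Balaban1983to89.B9SectBGpTransferConvYR

open Literature.MathematicalPhysics.QuantumFieldTheory.Balaban1983to89.B9SectBCodedClassR (RegExtraY bg9YC)
open Literature.MathematicalPhysics.QuantumFieldTheory.Balaban1983to89.B9SectBGpTransferConvY hiding hconv_at hconv_KSC hout_KSC

open Literature.MathematicalPhysics.QuantumFieldTheory.Balaban1983to89.B6KLevelCensusIndexV1 (KIdx kGeo)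
open Literature.MathematicalPhysics.QuantumFieldTheory.Balaban1983to89.B6Ineq2142KLevelV1 (β)
open Literature.MathematicalPhysics.QuantumFieldTheory.Balaban1983to89.B6RandomWalk (HasMajorant hasMajorant_mono Triangle254 Ineq261)
open Literature.MathematicalPhysics.QuantumFieldTheory.Balaban1983to89.B9Thm34Ext (toB6)
open Literature.MathematicalPhysics.QuantumFieldTheory.Balaban1983to89.B9Ineq347 (ScaleTransfer)
open Literature.MathematicalPhysics.QuantumFieldTheory.Balaban1983to89.B9FromB6 (EBlock)
open Literature.MathematicalPhysics.QuantumFieldTheory.Balaban1983to89.B9Eq39Adjoint (fluct prodCfg covD covDstar)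
open Literature.MathematicalPhysics.QuantumFieldTheory.Balaban1983to89.B9Eq352DivForm (tauB)
open Literature.MathematicalPhysics.QuantumFieldTheory.Balaban1983to89.B9Eq352DivFormLetters (conj)
open Literature.MathematicalPhysics.QuantumFieldTheory.Balaban1983to89.B9Eq352GradLetters (V1pOp diffLetter)
open Literature.MathematicalPhysics.QuantumFieldTheory.Balaban1983to89.B9Ineq385VG (kappa385 kappa385_nonneg)
open Literature.MathematicalPhysics.QuantumFieldTheory.Balaban1983to89.B9SectBCodedCarrier (CCfg pullK)
open Literature.MathematicalPhysics.QuantumFieldTheory.Balaban1983to89.B9Eq360DeltaPrimeAY (AfldY mulY chartA UboxY_mulY_fluct lapSL_mulY_fluct)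
open Literature.MathematicalPhysics.QuantumFieldTheory.Balaban1983to89.B9PinMembersKLevelV1 (MemberY geo9Y bg9Y)
open Literature.MathematicalPhysics.QuantumFieldTheory.Balaban1983to89.B9SectBGpLettersY (GVal coordC expAC blkC norm_le_one_and_inv_of_mem
  letters_base_of_gVal stencilF_blkC stencilB_blkC stencil0_geo9K)
open Literature.MathematicalPhysics.QuantumFieldTheory.Balaban1983to89.B9SectBGpFrameCodedYR (codingYx)
open Literature.MathematicalPhysics.QuantumFieldTheory.Balaban1983to89.B9SectBGpFrameCodedY (CplxLettersY exists_d261)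
open Literature.MathematicalPhysics.QuantumFieldTheory.Balaban1983to89.B9SectBGpReadingsYR (KSC)
open Literature.MathematicalPhysics.QuantumFieldTheory.Balaban1983to89.B9SectBGpReadingsY (etaS_eq_eta)
open Literature.MathematicalPhysics.QuantumFieldTheory.Balaban1983to89.B9SectBGpReadingsYProdR (hasMajorant_letters_prod_of_eBlock)
open Literature.MathematicalPhysics.QuantumFieldTheory.Balaban1983to89.B9SectBGpTransferOutYR (thms_pullK_prod_of_KSC)
open Literature.MathematicalPhysics.QuantumFieldTheory.Balaban1983to89.B9Eq370LetterConversion (hasMajorant_diffLetter_prodCfg_mul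
  hasMajorant_mul_diffLetter_prodCfg hasMajorant_lap_prodCfg_mul)
open Literature.MathematicalPhysics.QuantumFieldTheory.Balaban1983to89.B9Ineq366CPrime (hasMajorant_rate_mono)
open Literature.MathematicalPhysics.QuantumFieldTheory.Balaban1983to89.B9RWSums347DefiniteFacesWindow (scaleTransfer6_window_geo9Y geo9Y_dist_nonneg)
open Literature.MathematicalPhysics.QuantumFieldTheory.Balaban1983to89.B9GeoLemma21KLevelV1 (geo9Y_len_pos geo9Y_dist_triangle geo9K_eta_pos geo9K_one_le_L)
open Literature.MathematicalPhysics.QuantumFieldTheory.Balaban1983to89.Node00 (SiteY BlkY IBondY CfgY SiteParY UboxY shiftY kernelFamilyS GpY lapSL etaS)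
open Literature.MathematicalPhysics.QuantumFieldTheory.Balaban1983to89.Node00.OpsYRead342 (eBlock_kernelFamilyS_of_hasMajorant)

variable {𝔸 : Type} [NormedRing 𝔸] [NormedAlgebra ℂ 𝔸] [CompleteSpace 𝔸] [FiniteDimensional ℝ 𝔸]
variable {d ℓ : ℕ} {hd : 1 ≤ d + 1} {hL : Odd (ℓ + 1) ∧ 1 < ℓ + 1} {b₀ b₁ : ℝ} {Mstar : ℕ} (P : RegExtraY d ℓ hd hL b₀ b₁ Mstar 𝔸)

/-! ## §1 The Laplacian letters at `U′U` and the (3.37) letters at a `G`-valued base -/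

section Letters

variable (G : Subgroup 𝔸ˣ) (x : MemberY d ℓ hd hL b₀ b₁ Mstar) (par : SiteParY 𝔸 x.toKIdx) {ι : Type} [Fintype ι] (b : Module.Basis ι ℝ 𝔸)
  (ιB : BlkY x.toKIdx → IBondY x.toKIdx)

end Letters

/-! ## §2 ★★ The conversion at one member, thresholds and Lemma-2.1 data given -/

section Member

variable (G : Subgroup 𝔸ˣ) (x : MemberY d ℓ hd hL b₀ b₁ Mstar) (par : SiteParY 𝔸 x.toKIdx) {ι : Type} [Fintype ι] (b : Module.Basis ι ℝ 𝔸)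
  (ιB : BlkY x.toKIdx → IBondY x.toKIdx) [Fintype (geo9Y x).Site] (C37 C38 : ℝ → CfgY 𝔸 x.toKIdx → AfldY 𝔸 x.toKIdx → Prop)

/-- ★★ **THE LETTER CONVERSION `hconv` AT ONE MEMBER.**  Data: unit-norm structure group (`hG1`), a section `ιB` of `β` (`hι`), a real basis with coordinate
constant `M₂`, the coded-class dictionary `hC37`; Lemma 2.1 of [4] at the input rate `δ₀` and exponent `1/4` (`h261`) with exponent `dL`, and the scale
transfers of `ℓ, ℓ², ℓ⁻¹` at `(δ₀, 1/4)` with constant `Λ ≧ 0` (`hT1 hT2 hTi`).  Then for `(U, a)` in the coded class at `0 < α₁ ≦ 1/4` and `B₀ ≧ 0`: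
`EBlock (KSC …) B₀ δ₀ (.prod U a)` ⇒ the record's (3.42) block AT `W = e^{ηa}·U` with letters AT `W`, constant `c_R·B_conv` and rate `δ₀/2`, where
`c_R = M₂Σ‖b_j‖` and `B_conv = B_in + B_L + B_R + B_Δ` is the sum of the four converted constants (`B_in = c_R·B₀`; `B_L`, `B_R` from
`hasMajorant_diffLetter_prodCfg_mul ∕ hasMajorant_mul_diffLetter_prodCfg` at `α₁ := 1/4`, `ρu := 1`, `d₀ := 2(d+1)`; `B_Δ` from `hasMajorant_lap_prodCfg_mul`).
[cite: Balaban1985BackgroundPropagators, p.403 l.1–9, (3.70) p.404, (3.74) p.405, (3.53) p.400, (3.42) p.397, (3.37) p.396; Balaban1984PropagatorsII, Lemma 2.1 p.234, (2.51)–(2.55) p.232] -/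
theorem hconv_at (hι : ∀ s : BlkY x.toKIdx, β x.toKIdx.hN x.toKIdx.D x.toKIdx.hk (ιB s) = s)
    (hG1 : ∀ u : 𝔸ˣ, u ∈ G → ‖(u : 𝔸)‖ ≤ 1) {M₂ : ℝ} (hM₂ : 0 ≤ M₂) (hrepr : ∀ (v : 𝔸) (j : ι), |b.repr v j| ≤ M₂ * ‖v‖)
    {Cq : ℝ} (hC37 : ∀ β' U a, C37 β' U a → GVal G x.toKIdx U ∧ CplxLettersY G x par ιB Cq β' U a)
    {δ₀ : ℝ} (hδ₀ : 0 < δ₀) {dL : ℕ} (h261 : Ineq261 dL (toB6 (geo9Y x) (0 : ℝ) True) δ₀ (1 / 4)) {Λ : ℝ} (hΛ : 0 ≤ Λ)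
    (hT1 : ScaleTransfer (geo9Y x) δ₀ (1 / 4) Λ (fun a => (geo9Y x).len a))
    (hT2 : ScaleTransfer (geo9Y x) δ₀ (1 / 4) Λ (fun a => (geo9Y x).len a ^ 2))
    (hTi : ScaleTransfer (geo9Y x) δ₀ (1 / 4) Λ (fun a => ((geo9Y x).len a)⁻¹))
    {B₀ : ℝ} (hB₀ : 0 ≤ B₀) {U : CfgY 𝔸 x.toKIdx} {a : AfldY 𝔸 x.toKIdx} {α₁ : ℝ} (hα₁c : α₁ ≤ 1 / 4) (hC : C37 α₁ U a)
    (hE : EBlock (KSC P G x par C37 C38) B₀ δ₀ (.prod U a)) :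
    EBlock (kernelFamilyS x.toKIdx (bg9YC 𝔸 G P x) (fun U => U) (GpY x.toKIdx par) par)
      (M₂ * (∑ j, ‖b j‖) *
        ((M₂ * (∑ j, ‖b j‖) * B₀)
          + (1 + (4 * (1 : ℝ) ^ 2 * M₂ * (∑ j, ‖b j‖) * Real.exp (δ₀ * (2 * ((d : ℝ) + 1)))) * (1 / 4) * Λ * B6.c1 dL δ₀ (1 / 4)) *
              (M₂ * (∑ j, ‖b j‖) * B₀)
          + (1 + (4 * (1 : ℝ) ^ 2 * M₂ * (∑ j, ‖b j‖) * Real.exp (δ₀ / 2 * (2 * ((d : ℝ) + 1)))) * (1 / 4) * Λ * B6.c1 dL δ₀ (1 / 4)) *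
              (M₂ * (∑ j, ‖b j‖) * B₀)
          + ((M₂ * (∑ j, ‖b j‖) * B₀)
              + kappa385 (M₂ * (∑ j, ‖b j‖) * B₀)
                  ((((2 + 8 * (1 : ℝ) ^ 2 * (1 / 4)) * Fintype.card (Fin (d + 1)) + 2 * Fintype.card (Fin (d + 1)) * 2) * M₂ * (∑ j, ‖b j‖) *
                    Real.exp (δ₀ * (2 * ((d : ℝ) + 1))))) 0 0 Λ (B6.c1 dL δ₀ (1 / 4)) * (1 / 4))))
      (δ₀ / 2) (mulY x.toKIdx (fluct (kGeo x.toKIdx).eta a) U) := by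
  -- names for the constants
  set cR : ℝ := M₂ * (∑ j, ‖b j‖) with hcR
  set Bin : ℝ := cR * B₀ with hBin
  set d₀ : ℝ := 2 * ((d : ℝ) + 1) with hd₀
  set c₁ : ℝ := B6.c1 dL δ₀ (1 / 4) with hc₁
  set BL : ℝ := (1 + (4 * (1 : ℝ) ^ 2 * M₂ * (∑ j, ‖b j‖) * Real.exp (δ₀ * d₀)) * (1 / 4) * Λ * c₁) * Bin with hBL
  set BR : ℝ := (1 + (4 * (1 : ℝ) ^ 2 * M₂ * (∑ j, ‖b j‖) * Real.exp (δ₀ / 2 * d₀)) * (1 / 4) * Λ * c₁) * Bin with hBR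
  set cV : ℝ := (((2 + 8 * (1 : ℝ) ^ 2 * (1 / 4)) * Fintype.card (Fin (d + 1)) + 2 * Fintype.card (Fin (d + 1)) * 2) * M₂ * (∑ j, ‖b j‖) *
    Real.exp (δ₀ * d₀)) with hcV
  set BΔ : ℝ := Bin + kappa385 Bin cV 0 0 Λ c₁ * (1 / 4) with hBΔ
  set η : ℝ := (kGeo x.toKIdx).eta with hηdef
  set W : CfgY 𝔸 x.toKIdx := mulY x.toKIdx (fluct η a) U with hW
  -- signs
  have hSb : 0 ≤ ∑ j, ‖b j‖ := Finset.sum_nonneg fun j _ => norm_nonneg _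
  have hcR0 : 0 ≤ cR := mul_nonneg hM₂ hSb
  have hBin0 : 0 ≤ Bin := mul_nonneg hcR0 hB₀
  have hc₁0 : 0 ≤ c₁ := B6RandomWalk.c1_nonneg dL δ₀ (1 / 4)
  have hcard : (0 : ℝ) ≤ Fintype.card (Fin (d + 1)) := Nat.cast_nonneg _
  have hBL0 : 0 ≤ BL := by positivity
  have hBR0 : 0 ≤ BR := by positivity
  have hcV0 : 0 ≤ cV := by positivity
  have hκ0 : 0 ≤ kappa385 Bin cV 0 0 Λ c₁ := kappa385_nonneg hBin0 hcV0 le_rfl le_rfl hΛ hc₁0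
  have hBΔ0 : 0 ≤ BΔ := by positivity
  -- geometry of the member
  have hη0 : 0 < η := geo9K_eta_pos x.toKIdx
  have hdnn : ∀ y y' : (geo9Y x).Site, 0 ≤ (geo9Y x).dist y y' := geo9Y_dist_nonneg x
  have htri : Triangle254 (toB6 (geo9Y x) (0 : ℝ) True) := fun p q r => geo9Y_dist_triangle x p q r
  have hlen : ∀ y : (geo9Y x).Site, 0 < (geo9Y x).len y := geo9Y_len_pos x
  have hd₀F : ∀ (μ : Fin (d + 1)) (z : SiteY x.toKIdx), (geo9Y x).dist (blkC x.toKIdx ιB z) (blkC x.toKIdx ιB (shiftY x.toKIdx μ z)) ≤ d₀ ∧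
      (geo9Y x).dist (blkC x.toKIdx ιB z) (blkC x.toKIdx ιB ((shiftY x.toKIdx μ).symm z)) ≤ d₀ :=
    fun μ z => ⟨stencilF_blkC x.toKIdx ιB hι μ z, stencilB_blkC x.toKIdx ιB hι μ z⟩
  have hd₀0 : ∀ y : (geo9Y x).Site, (geo9Y x).dist y y ≤ d₀ := fun y => stencil0_geo9K x.toKIdx y
  -- the class: `U` is `G`-valued, the (3.37) letters at `α₁ ≤ 1/4`
  obtain ⟨hU, hcl⟩ := hC37 α₁ U a hC
  obtain ⟨hA, h337s⟩ := letters337_of_cplxLettersY G x par ιB hα₁c hU hcl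
  have hρu : ∀ (μ : Fin (d + 1)) (z : SiteY x.toKIdx), ‖((UboxY x.toKIdx U μ z : 𝔸ˣ) : 𝔸)‖ ≤ 1 ∧ ‖(((UboxY x.toKIdx U μ z)⁻¹ : 𝔸ˣ) : 𝔸)‖ ≤ 1 :=
    fun μ z => norm_le_one_and_inv_of_mem G hG1 (hU μ _ : UboxY x.toKIdx U μ z ∈ G)
  have hsmall : ∀ y : (geo9Y x).Site, η * ((1 / 4 : ℝ) * ((geo9Y x).len y)⁻¹) ≤ 1 / 4 := by
    intro y
    have hηle : η ≤ (geo9Y x).len y := by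
      show (geo9Y x).eta ≤ (geo9Y x).L ^ (geo9Y x).scale y * (geo9Y x).eta
      exact le_mul_of_one_le_left (geo9K_eta_pos x.toKIdx).le (one_le_pow₀ (geo9K_one_le_L x.toKIdx))
    have hl := hlen y
    rw [show η * ((1 / 4 : ℝ) * ((geo9Y x).len y)⁻¹) = (1 / 4) * (η / (geo9Y x).len y) by ring]
    have : η / (geo9Y x).len y ≤ 1 := (div_le_one hl).mpr hηle
    linarith
  -- READ: the four block majorants at the product, letters at `U`, rate δ₀, constant `Bin`
  obtain ⟨h0, h1, h2, h3⟩ := hasMajorant_letters_prod_of_eBlock P G x par b ιB C37 C38 (Rr := (0 : ℝ)) (Hp := True) hι M₂ hM₂ hrepr U a hB₀ hE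
  -- rates
  have hρ : 0 ≤ δ₀ / 2 := by linarith
  have hr : δ₀ / 2 + (1 / 4 + 1 / 4) * δ₀ ≤ δ₀ := by linarith
  have hρδ : δ₀ / 2 ≤ δ₀ := by linarith
  -- CONVERT, left: `∇_{W,μ}·η²G′(W)` for every `k` (only `inl` is written)
  have hLeft : ∀ k : Fin (d + 1) ⊕ Fin (d + 1), HasMajorant (g := toB6 (geo9Y x) (0 : ℝ) True) (fun p : SiteY x.toKIdx × ι => blkC x.toKIdx ιB p.1)
      (conj b (diffLetter (shiftY x.toKIdx) (prodCfg (UboxY x.toKIdx U) η (chartA x.toKIdx a)) (((η : ℂ))⁻¹) k) *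
        conj b ((η ^ 2) • (GpY x.toKIdx par W).restrictScalars ℝ))
      (fun p q => BL * (geo9Y x).len p * Real.exp (-(δ₀ / 2 * (geo9Y x).dist p q))) := fun k => by
    refine hasMajorant_diffLetter_prodCfg_mul b (shiftY x.toKIdx) (UboxY x.toKIdx U) (Rr := (0 : ℝ)) (H := True) (g := geo9Y x)
      (fun z => blkC x.toKIdx ιB z) dL hη0
      (chartA x.toKIdx a) 1 d₀ M₂ (1 / 4) δ₀ δ₀ (1 / 4) (1 / 4) (δ₀ / 2) Λ Bin (by norm_num) hδ₀.le hM₂ hBin0 hΛ hρ hr hρδ hrepr hdnn htri hlen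
      h261 hT2 hsmall hA hρu hd₀F k (Gp := conj b ((η ^ 2) • (GpY x.toKIdx par W).restrictScalars ℝ)) ?_ ?_
    · exact h0
    · exact h1 k
  -- CONVERT, right: `η²G′(W)·∇♯_{W,k}`
  have hRight : ∀ k : Fin (d + 1) ⊕ Fin (d + 1), HasMajorant (g := toB6 (geo9Y x) (0 : ℝ) True) (fun p : SiteY x.toKIdx × ι => blkC x.toKIdx ιB p.1)
      (conj b ((η ^ 2) • (GpY x.toKIdx par W).restrictScalars ℝ) *
        conj b (diffLetter (shiftY x.toKIdx) (prodCfg (UboxY x.toKIdx U) η (chartA x.toKIdx a)) (((η : ℂ))⁻¹) k))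
      (fun p q => BR * (geo9Y x).len p * Real.exp (-(δ₀ / 2 * (geo9Y x).dist p q))) := fun k => by
    refine hasMajorant_mul_diffLetter_prodCfg b (shiftY x.toKIdx) (UboxY x.toKIdx U) (Rr := (0 : ℝ)) (H := True) (g := geo9Y x)
      (fun z => blkC x.toKIdx ιB z) dL hη0
      (chartA x.toKIdx a) 1 d₀ M₂ (1 / 4) δ₀ δ₀ (1 / 4) (1 / 4) (δ₀ / 2) Λ Bin (by norm_num) hM₂ hBin0 hΛ hρ hr hρδ hrepr hdnn htri hlen
      h261 hTi hsmall hA hρu hd₀F k (Gp := conj b ((η ^ 2) • (GpY x.toKIdx par W).restrictScalars ℝ)) ?_ ?_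
    · exact h0
    · exact h2 k
  -- CONVERT, Laplacian: `η⁻²Δ_W·η²G′(W)`
  have hLap : HasMajorant (g := toB6 (geo9Y x) (0 : ℝ) True) (fun p : SiteY x.toKIdx × ι => blkC x.toKIdx ιB p.1)
      (conj b ((η ^ 2)⁻¹ • (lapSL x.toKIdx W).restrictScalars ℝ) * conj b ((η ^ 2) • (GpY x.toKIdx par W).restrictScalars ℝ))
      (fun p q => BΔ * 1 * Real.exp (-(δ₀ / 2 * (geo9Y x).dist p q))) := by
    refine hasMajorant_lap_prodCfg_mul b (shiftY x.toKIdx) (UboxY x.toKIdx U) (Rr := (0 : ℝ)) (H := True) (g := geo9Y x)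
      (fun z => blkC x.toKIdx ιB z) dL hη0
      (chartA x.toKIdx a) 1 d₀ M₂ (1 / 4) δ₀ δ₀ (1 / 4) (1 / 4) (δ₀ / 2) Λ Bin (by norm_num) hδ₀.le hM₂ hBin0 hΛ hρ (by norm_num) (by norm_num) hδ₀.le
      hr hrepr hdnn htri hlen h261 hT1 hT2 hsmall hA h337s hρu hd₀F hd₀0
      (Gp := conj b ((η ^ 2) • (GpY x.toKIdx par W).restrictScalars ℝ))
      (LU := (η ^ 2)⁻¹ • (lapSL x.toKIdx U).restrictScalars ℝ) (LW := (η ^ 2)⁻¹ • (lapSL x.toKIdx W).restrictScalars ℝ)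
      (lapLetter_mulY_fluct x a U) ?_ (fun k => ?_) ?_
    · exact h0
    · exact h1 k
    · exact h3
  -- entry 0 at the smaller rate
  have hZero : HasMajorant (g := toB6 (geo9Y x) (0 : ℝ) True) (fun p : SiteY x.toKIdx × ι => blkC x.toKIdx ιB p.1)
      (conj b ((η ^ 2) • (GpY x.toKIdx par W).restrictScalars ℝ))
      (fun p q => Bin * (geo9Y x).len p ^ 2 * Real.exp (-(δ₀ / 2 * (geo9Y x).dist p q))) :=
    hasMajorant_rate_mono (R := (0 : ℝ)) (H := True) (g := geo9Y x) _ Bin (fun p => (geo9Y x).len p ^ 2) hBin0 (fun p => sq_nonneg _) hρδ hdnn h0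
  -- the common constant
  set Bc : ℝ := Bin + BL + BR + BΔ with hBc
  have hBc0 : 0 ≤ Bc := by positivity
  have hle0 : Bin ≤ Bc := by rw [hBc]; linarith
  have hleL : BL ≤ Bc := by rw [hBc]; linarith
  have hleR : BR ≤ Bc := by rw [hBc]; linarith
  have hleΔ : BΔ ≤ Bc := by rw [hBc]; linarith
  have mono : ∀ {T : Module.End ℝ (SiteY x.toKIdx × ι → ℝ)} {B : ℝ} (w : (geo9Y x).Site → ℝ), (∀ p, 0 ≤ w p) → B ≤ Bc →
      HasMajorant (g := toB6 (geo9Y x) (0 : ℝ) True) (fun p : SiteY x.toKIdx × ι => blkC x.toKIdx ιB p.1) T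
        (fun p q => B * w p * Real.exp (-(δ₀ / 2 * (geo9Y x).dist p q))) →
      HasMajorant (g := toB6 (geo9Y x) (0 : ℝ) True) (fun p : SiteY x.toKIdx × ι => blkC x.toKIdx ιB p.1) T
        (fun p q => Bc * w p * Real.exp (-(δ₀ / 2 * (geo9Y x).dist p q))) := by
    intro T B w hw hB h
    exact hasMajorant_mono (g := toB6 (geo9Y x) (0 : ℝ) True) _ h fun p q =>
      mul_le_mul_of_nonneg_right (mul_le_mul_of_nonneg_right hB (hw p)) (Real.exp_nonneg _)
  -- WRITE at `W` (def-Y), `cfg := id`, `Uc := prodCfg (UboxY U) η (chartA a) = UboxY W`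
  letI : Fintype (B9GeoNormsKLevelV1.geo9K x.toKIdx).Site := ‹Fintype (geo9Y x).Site›
  have hwrite := eBlock_kernelFamilyS_of_hasMajorant x.toKIdx b (B := bg9YC 𝔸 G P x) (cfg := fun V => V) (O := GpY x.toKIdx par) (par := par)
    (U₁ := W) (Rr := (0 : ℝ)) (Hp := True) ιB hι hM₂ hrepr (η := η) (by rw [hηdef, etaS_eq_eta])
    (Uc := prodCfg (UboxY x.toKIdx U) η (chartA x.toKIdx a)) (by rw [hW, hηdef, UboxY_mulY_fluct])
    ((η ^ 2) • (GpY x.toKIdx par W).restrictScalars ℝ) ((η ^ 2)⁻¹ • (lapSL x.toKIdx W).restrictScalars ℝ) (fun Λ' => rfl)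
    (fun Λ' => by rw [LinearMap.smul_apply, LinearMap.restrictScalars_apply, Node00.lapSL_apply]) hBc0
    (mono (fun p => (geo9Y x).len p ^ 2) (fun p => sq_nonneg _) hle0 hZero)
    (fun μ => mono (fun p => (geo9Y x).len p) (fun p => (hlen p).le) hleL (hLeft (Sum.inl μ)))
    (fun μ => mono (fun p => (geo9Y x).len p) (fun p => (hlen p).le) hleR (hRight (Sum.inr μ)))
    (mono (fun _ => (1 : ℝ)) (fun _ => zero_le_one) hleΔ hLap)
  simpa only [hBc, hBin, hBL, hBR, hBΔ, hcV, hc₁, hd₀, hcR] using hwrite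

end Member

/-! ## §3 ★★ The conversion at the family level: thresholds and Lemma-2.1 data from n06-k's suppliers -/

section Family

variable [∀ x : MemberY d ℓ hd hL b₀ b₁ Mstar, Fintype (geo9Y x).Site] (G : Subgroup 𝔸ˣ)
  (par : ∀ x : MemberY d ℓ hd hL b₀ b₁ Mstar, SiteParY 𝔸 x.toKIdx) {ι : Type} [Fintype ι] (b : Module.Basis ι ℝ 𝔸)
  (ιB : ∀ x : MemberY d ℓ hd hL b₀ b₁ Mstar, BlkY x.toKIdx → IBondY x.toKIdx)
  (C37 C38 : ∀ x : MemberY d ℓ hd hL b₀ b₁ Mstar, ℝ → CfgY 𝔸 x.toKIdx → AfldY 𝔸 x.toKIdx → Prop)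

/-- ★★ **`hconv` AT THE FAMILY LEVEL**: for every `B₀ ≧ 0` and input rate `δ₀ > 0` there are an M-threshold `Mo(δ₀)` (n06-k's (2.61) threshold `M261 δ₀` ∨ the
scale-transfer size condition `16·log(ℓ+1)∕δ₀`) and a constant `B″ ≧ 0`, UNIFORM IN THE MEMBER, such that at every member above `Mo`, every `(U, a)` in the
coded class at `α₁ ≦ 1/4`: `EBlock (KSC …) B₀ δ₀ (.prod U a) → EBlock (kernelFamilyS … (GpY par) par) B″ (δ₀/2) (e^{ηa}·U)` — the displayed hypothesis
`hconv` of `B9SectBGpTransferOutY.thms_pullK_prod_of_KSC`, proved on the corner-free lineage.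
[cite: Balaban1985BackgroundPropagators, p.403 l.1–9, (3.70) p.404, (3.74) p.405, (3.53) p.400, (3.42) p.397; Balaban1984PropagatorsII, Lemma 2.1 (2.59)–(2.61) pp.233–234] -/
theorem hconv_KSC (hG1 : ∀ u : 𝔸ˣ, u ∈ G → ‖(u : 𝔸)‖ ≤ 1) {M₂ : ℝ} (hM₂ : 0 ≤ M₂) (hrepr : ∀ (v : 𝔸) (j : ι), |b.repr v j| ≤ M₂ * ‖v‖)
    (hι : ∀ (x : MemberY d ℓ hd hL b₀ b₁ Mstar) (s : BlkY x.toKIdx), β x.toKIdx.hN x.toKIdx.D x.toKIdx.hk (ιB x s) = s)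
    {Cq : ℝ} (hC37 : ∀ x β' U a, C37 x β' U a → GVal G x.toKIdx U ∧ CplxLettersY G x (par x) (ιB x) Cq β' U a) :
    ∀ (B₀ δ₀ : ℝ), 0 ≤ B₀ → 0 < δ₀ → ∃ (Mo B'' : ℝ), 0 ≤ B'' ∧
      ∀ x : MemberY d ℓ hd hL b₀ b₁ Mstar, Mo ≤ (geo9Y x).M → ∀ (U : CfgY 𝔸 x.toKIdx) (a : AfldY 𝔸 x.toKIdx) (α₁ : ℝ), α₁ ≤ 1 / 4 → C37 x α₁ U a →
        EBlock (KSC P G x (par x) (C37 x) (C38 x)) B₀ δ₀ (.prod U a) →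
        EBlock (kernelFamilyS x.toKIdx (bg9YC 𝔸 G P x) (fun U => U) (GpY x.toKIdx (par x)) (par x)) B'' (δ₀ / 2)
          (mulY x.toKIdx (fluct (kGeo x.toKIdx).eta a) U) := by
  obtain ⟨d261, M261, h261f⟩ := exists_d261 (d := d) (ℓ := ℓ) (hd := hd) (hL := hL) (b₀ := b₀) (b₁ := b₁) (Mstar := Mstar)
  intro B₀ δ₀ hB₀ hδ₀
  have hκlo : 0 < 1 / 4 * δ₀ := by positivity
  refine ⟨max (M261 δ₀) (4 * Real.log ((ℓ : ℝ) + 1) / (1 / 4 * δ₀)), ?_, ?_, ?_⟩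
  pick_goal 3
  · intro x hM U a α₁ hα₁c hC hE
    have hM1 : M261 δ₀ ≤ (geo9Y x).M := le_trans (le_max_left _ _) hM
    have hM2 : 4 * Real.log ((ℓ : ℝ) + 1) / (1 / 4 * δ₀) ≤ (geo9Y x).M := le_trans (le_max_right _ _) hM
    have h261 := h261f x δ₀ (1 / 4) hδ₀ (by norm_num) (by norm_num) hM1
    have hST := scaleTransfer6_window_geo9Y hκlo x (δ := δ₀) (α := 1 / 4) le_rfl hM2
    exact hconv_at P G x (par x) b (ιB x) (C37 x) (C38 x) (hι x) hG1 hM₂ hrepr (hC37 x) hδ₀ h261 (Λ := ((ℓ : ℝ) + 1) ^ 4) (by positivity)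
      hST.1 hST.2.1 hST.2.2.1 hB₀ hα₁c hC hE
  · have hSb : 0 ≤ ∑ j, ‖b j‖ := Finset.sum_nonneg fun j _ => norm_nonneg _
    have hc₁ : 0 ≤ B6.c1 (d261 δ₀) δ₀ (1 / 4) := B6RandomWalk.c1_nonneg _ _ _
    have hcard : (0 : ℝ) ≤ Fintype.card (Fin (d + 1)) := Nat.cast_nonneg _
    have hΛ : (0 : ℝ) ≤ ((ℓ : ℝ) + 1) ^ 4 := by positivity
    have hk : 0 ≤ kappa385 (M₂ * (∑ j, ‖b j‖) * B₀)
        ((((2 + 8 * (1 : ℝ) ^ 2 * (1 / 4)) * Fintype.card (Fin (d + 1)) + 2 * Fintype.card (Fin (d + 1)) * 2) * M₂ * (∑ j, ‖b j‖) *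
          Real.exp (δ₀ * (2 * ((d : ℝ) + 1))))) 0 0 (((ℓ : ℝ) + 1) ^ 4) (B6.c1 (d261 δ₀) δ₀ (1 / 4)) :=
      kappa385_nonneg (by positivity) (by positivity) le_rfl le_rfl hΛ hc₁
    positivity

/-! ## §4 ★★★ The hypothesis `hout` of the family transfer, assembled -/

/-- ★★★ **THE HYPOTHESIS `hout` OF `B9SectBStepFamilyTransfer.sectBStepPrinted_of_family`, LITERALLY**, for `Gp₁ := KSC` (augmented coded readings) and
`Gp₂ :=` the record's `G′` family read along the decoding (`pullK … (kernelFamilyS … (GpY par) par)`), any shared `G`-family `GA` whose Hölder ∕ (3.44) ∕ (3.45)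
members are nonnegative (every reading by suprema) and any shared `Cinv`: for all input constants and every cap `a > 0` there are the M-threshold `Mo` of
`hconv_KSC`, the caps `ao = 1`, `a′ = min a (1/4)`, and the output constants `(max B₀ B″, min δ₀ (δ₀/2), B_β, B_ε, B_εβ, B₁, δ₁)` such that at every
coded product over a regular base with the multiplier in the coded class, the block of `KSC` gives the block of the record family (`hconv_KSC` ∘
`thms_pullK_prod_of_KSC`).  With `hin_KSC` (`B9SectBGpTransferInY`) this completes the two analytic inputs of the family transfer; `hAn` is the consumer's.
[cite: Balaban1985BackgroundPropagators, Thm 3.4 p.400, p.403 l.1–9 («of course with different constants»), (3.35)–(3.37) p.396, (3.42)–(3.48) pp.397–399] -/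
theorem hout_KSC (hG1 : ∀ u : 𝔸ˣ, u ∈ G → ‖(u : 𝔸)‖ ≤ 1) {M₂ : ℝ} (hM₂ : 0 ≤ M₂) (hrepr : ∀ (v : 𝔸) (j : ι), |b.repr v j| ≤ M₂ * ‖v‖)
    (hι : ∀ (x : MemberY d ℓ hd hL b₀ b₁ Mstar) (s : BlkY x.toKIdx), β x.toKIdx.hN x.toKIdx.D x.toKIdx.hk (ιB x s) = s)
    {Cq : ℝ} (hC37 : ∀ x β' U a, C37 x β' U a → GVal G x.toKIdx U ∧ CplxLettersY G x (par x) (ιB x) Cq β' U a) (c35 : ℝ) (dC : ℕ)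
    (GA : ∀ x : MemberY d ℓ hd hL b₀ b₁ Mstar, B9.KernelFamily (geo9Y x) (codingYx P G x (C37 x) (C38 x)).bg)
    (Cinv : ∀ x : MemberY d ℓ hd hL b₀ b₁ Mstar, B9.SiteKernel (geo9Y x) (codingYx P G x (C37 x) (C38 x)).bg)
    (hGA : ∀ (x : MemberY d ℓ hd hL b₀ b₁ Mstar) (c : (codingYx P G x (C37 x) (C38 x)).bg.Cfg),
      (∀ lam β' ζ, 0 ≤ (GA x).h1 c lam β' ζ) ∧ (∀ lam y, 0 ≤ (GA x).e4 c lam y) ∧ (∀ lam β' ζ, 0 ≤ (GA x).h2 c lam β' ζ)) :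
    ∀ (B₀ δ₀ : ℝ) (Bβ Bε : ℝ → ℝ) (Bεβ : ℝ → ℝ → ℝ) (B₁ δ₁ : ℝ) (acap : ℝ), 0 < B₀ → 0 < δ₀ → 0 < B₁ → 0 < δ₁ → 0 < acap →
      ∃ (Mo ao a' B₀' δ₀' : ℝ) (Bβ' Bε' : ℝ → ℝ) (Bεβ' : ℝ → ℝ → ℝ) (B₁' δ₁' : ℝ),
        0 < ao ∧ 0 < a' ∧ a' ≤ acap ∧ 0 < B₀' ∧ 0 < δ₀' ∧ 0 < B₁' ∧ 0 < δ₁' ∧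
        ∀ x : MemberY d ℓ hd hL b₀ b₁ Mstar, Mo ≤ (geo9Y x).M → ∀ α₀ : ℝ, 0 < α₀ → (geo9Y x).M * α₀ ≤ ao →
          ∀ c : (codingYx P G x (C37 x) (C38 x)).bg.Cfg, (codingYx P G x (C37 x) (C38 x)).bg.Reg335 c35 α₀ c →
          ∀ α₁ : ℝ, 0 < α₁ → α₁ ≤ a' → ∀ c' : (codingYx P G x (C37 x) (C38 x)).bg.Cfg, (codingYx P G x (C37 x) (C38 x)).bg.Cplx337 α₁ c c' →
          B9.Thms31to33IneqAt dC (KSC P G x (par x) (C37 x) (C38 x)) (GA x) (Cinv x) B₀ δ₀ Bβ Bε Bεβ B₁ δ₁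
              ((codingYx P G x (C37 x) (C38 x)).bg.mul c' c) →
          B9.Thms31to33IneqAt dC (pullK (codingYx P G x (C37 x) (C38 x))
              (kernelFamilyS x.toKIdx (bg9YC 𝔸 G P x) (fun U => U) (GpY x.toKIdx (par x)) (par x))) (GA x) (Cinv x)
              B₀' δ₀' Bβ' Bε' Bεβ' B₁' δ₁' ((codingYx P G x (C37 x) (C38 x)).bg.mul c' c) := by
  intro B₀ δ₀ Bβ Bε Bεβ B₁ δ₁ acap hB₀ hδ₀ hB₁ hδ₁ hacap
  obtain ⟨Mo, B'', hB'', H⟩ := hconv_KSC P G par b ιB C37 C38 hG1 hM₂ hrepr hι hC37 B₀ δ₀ hB₀.le hδ₀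
  refine ⟨Mo, 1, min acap (1 / 4), max B₀ B'', min δ₀ (δ₀ / 2), Bβ, Bε, Bεβ, B₁, δ₁, one_pos, lt_min hacap (by norm_num), min_le_left _ _,
    lt_max_of_lt_left hB₀, lt_min hδ₀ (by linarith), hB₁, hδ₁, fun x hM α₀ _ _ c _ α₁ _ hα₁a c' h37 hT => ?_⟩
  obtain ⟨U, a, rfl, rfl, hC⟩ := (codingYx P G x (C37 x) (C38 x)).exists_of_bg_Cplx337 h37
  have hα₁c : α₁ ≤ 1 / 4 := le_trans hα₁a (min_le_right _ _)
  have hE : EBlock (KSC P G x (par x) (C37 x) (C38 x)) B₀ δ₀ (.prod U a) := hT.1.1.1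
  exact thms_pullK_prod_of_KSC P G x (par x) (C37 x) (C38 x) dC (GA x) (Cinv x) (hGA x _).1 (hGA x _).2.1 (hGA x _).2.2 hB₀.le hT hB''
    (H x hM U a α₁ hα₁c hC hE)

end Family

end Literature.MathematicalPhysics.QuantumFieldTheory.Balaban1983to89.B9SectBGpTransferConvYR

/-!
# `Balaban1983to89.B9SectBCodedChainOnSubfamilyR` — THE CLASS-PARAMETRIC TWIN of `B9SectBCodedChainOnSubfamily` (CASCADE-R, director-ym №279 GO-R; №277 (3) `hunitA` cure; dag-n06-d SOCKET-(α) class question)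

statement-level skeleton of published theorems with citation tags; proofs where landed; nothing here is a claim about the
Yang–Mills mass gap

WHAT THIS FILE IS.  The original module `B9SectBCodedChainOnSubfamily` types its objects over MODULE 3's member carrier `bg9Y 𝔸 G x` (MODULE 2's small-cube class (3.35)).  This file RE-DECLARES, with UNCHANGED NAMES inside the namespace `…B9SectBCodedChainOnSubfamilyR`, exactly its 7 class-dependent declarations over the CLASS-PARAMETRIC carrier `B9SectBCodedClassR.bg9YC 𝔸 G P x` (`P : RegExtraY …` = the two cube conditions of (3.35)∕(3.36) as a parameter; `bg9Y 𝔸 G x = bg9YC 𝔸 G (extraY 𝔸 G) x` by `rfl`, so every declaration here specialises definitionally to its original; at the record's reading of PRINT's class, `P := extraYPb 𝔸 G`, the displayed laws `hreg335P` ((3.35) on plaquettes) and the class-keyed `hunitA` become theorems).  The text is the original's VERBATIM under the token surgery `bg9Y 𝔸 G ↦ bg9YC 𝔸 G P`, `NAME ↦ NAME P` for the class-dependent names (P the first explicit argument), and — №277 — the binder `hunitA` re-keyed from «all G-valued U» to «all (3.35)-regular U of the carrier» (`∀ j α₀ U, (bg9YC 𝔸 G P (f j)).Reg335 c35 α₀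 U → IsUnit (deltaAY …)`).  Class-free declarations of the original are NOT copied: they are imported and used BY NAME (`open … hiding` the re-declared ones).  Generated by dag-n06-c g16's `gen.py` (HOME `pub-ymgap-dag-n06-c/lean/g16/`); the ORIGINAL MODULE DOCUMENTATION FOLLOWS VERBATIM and describes the mathematics.

HONEST SCOPE.  Re-typing bookkeeping; nothing of [B9] asserted beyond the original; COUNT-NEUTRAL; N06 NOT discharged; nothing continuum ∕ OS ∕ mass gap ∕ Clay.  Cell `pub-ymgap` (D-0062), Track A node N06 [B9], seat `pub-ymgap-dag-n06-c` g16, 2026-08-29.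
-/

/-! Module documentation: that of the original `Balaban1983to89.B9SectBCodedChainOnSubfamily` applies verbatim to this twin (not repeated here). -/

namespace Literature.MathematicalPhysics.QuantumFieldTheory.Balaban1983to89.B9SectBCodedChainOnSubfamilyR

open Literature.MathematicalPhysics.QuantumFieldTheory.Balaban1983to89.B9SectBCodedClassR (RegExtraY bg9YC)
open Literature.MathematicalPhysics.QuantumFieldTheory.Balaban1983to89.B9SectBCodedChainOnSubfamily hiding gpFrame₂CodedOn hin_KSC_on hconv_KSC_on hout_KSC_on sectBStepPrinted_on_of_KSC gpFrame₂CodedCornerFree sectBStepPrinted_cornerFree_of_KSC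

open Literature.MathematicalPhysics.QuantumFieldTheory.Balaban1983to89
open Literature.MathematicalPhysics.QuantumFieldTheory.Balaban1983to89.B6KLevelCensusIndexV1 (KIdx kGeo)
open Literature.MathematicalPhysics.QuantumFieldTheory.Balaban1983to89.B6Ineq2142KLevelV1 (β)
open Literature.MathematicalPhysics.QuantumFieldTheory.Balaban1983to89.B6RandomWalk (HasMajorant Ineq261)
open Literature.MathematicalPhysics.QuantumFieldTheory.Balaban1983to89.B9Thm34Ext (toB6)
open Literature.MathematicalPhysics.QuantumFieldTheory.Balaban1983to89.B9FromB6 (EBlock)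
open Literature.MathematicalPhysics.QuantumFieldTheory.Balaban1983to89.B9Eq39Adjoint (fluct)
open Literature.MathematicalPhysics.QuantumFieldTheory.Balaban1983to89.B9Ineq385VG (kappa385 kappa385_nonneg)
open Literature.MathematicalPhysics.QuantumFieldTheory.Balaban1983to89.B9SectBCodedCarrier (CCfg Coding pullK pullS pullAn sectBStepPrinted_of_coded)
open Literature.MathematicalPhysics.QuantumFieldTheory.Balaban1983to89.B9SectBStepFamilyTransfer (sectBStepPrinted_of_family)
open Literature.MathematicalPhysics.QuantumFieldTheory.Balaban1983to89.B9SectBGpStepAtLettersV2 (GpFrame₂)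
open Literature.MathematicalPhysics.QuantumFieldTheory.Balaban1983to89.B9Eq360DeltaPrimeAY (AfldY mulY)
open Literature.MathematicalPhysics.QuantumFieldTheory.Balaban1983to89.B9PinMembersKLevelV1 (MemberY geo9Y bg9Y)
open Literature.MathematicalPhysics.QuantumFieldTheory.Balaban1983to89.B9SectBGpLettersY
open Literature.MathematicalPhysics.QuantumFieldTheory.Balaban1983to89.B9SectBGpFrameCodedYR (codingYx Read342Y Write342Y)
open Literature.MathematicalPhysics.QuantumFieldTheory.Balaban1983to89.B9SectBGpFrameCodedY (CplxLettersY exists_d261)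
open Literature.MathematicalPhysics.QuantumFieldTheory.Balaban1983to89.B9SectBGpReadingsYR (KSC)
open Literature.MathematicalPhysics.QuantumFieldTheory.Balaban1983to89.B9SectBGpTransferInYR (thms_KSC_base_of_pullK)
open Literature.MathematicalPhysics.QuantumFieldTheory.Balaban1983to89.B9SectBGpTransferOutYR (thms_pullK_prod_of_KSC)
open Literature.MathematicalPhysics.QuantumFieldTheory.Balaban1983to89.B9SectBGpTransferConvYR (hconv_at)
open Literature.MathematicalPhysics.QuantumFieldTheory.Balaban1983to89.B9RWSums347DefiniteFacesWindow (scaleTransfer6_window_geo9Y geo9Y_dist_nonneg)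
open Literature.MathematicalPhysics.QuantumFieldTheory.Balaban1983to89.B9GeoLemma21KLevelV1 (geo9Y_dist_self geo9Y_dist_comm geo9Y_dist_triangle geo9Y_len_pos
  geo9K_eta_pos geo9K_one_le_L)
open Literature.MathematicalPhysics.QuantumFieldTheory.Balaban1983to89.B9GeoNbrCountKLevelV1 (exists_card_nbr_geo9Y_le_of_M)
open Literature.MathematicalPhysics.QuantumFieldTheory.Balaban1983to89.Node00 (SiteY BlkY IBondY CfgY SiteParY shiftY deltaPrimeAY kernelFamilyS GpY)

variable {d ℓ : ℕ} {hd : 1 ≤ d + 1} {hL : Odd (ℓ + 1) ∧ 1 < ℓ + 1} {b₀ b₁ : ℝ} {Mstar : ℕ}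
variable {𝔸 : Type} [NormedRing 𝔸] (P : RegExtraY d ℓ hd hL b₀ b₁ Mstar 𝔸) [NormedAlgebra ℂ 𝔸] [CompleteSpace 𝔸]

/-! ## §1 The root frame on a subfamily -/

section RootFrame

variable [NormOneClass 𝔸] {J : Type} (f : J → MemberY d ℓ hd hL b₀ b₁ Mstar)
  (c35 : ℝ) (G : Subgroup 𝔸ˣ) {ι : Type} [Fintype ι] [DecidableEq ι] (b : Module.Basis ι ℝ 𝔸)
  [∀ x : MemberY d ℓ hd hL b₀ b₁ Mstar, Fintype (geo9Y x).Site] [instDS : ∀ x : MemberY d ℓ hd hL b₀ b₁ Mstar, DecidableEq (geo9Y x).Site]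
  [∀ x : MemberY d ℓ hd hL b₀ b₁ Mstar, Nonempty (geo9Y x).Site]
  (C37 C38 : ∀ j : J, ℝ → CfgY 𝔸 (f j).toKIdx → AfldY 𝔸 (f j).toKIdx → Prop)
  (par : ∀ j : J, SiteParY 𝔸 (f j).toKIdx)
  (ιB : ∀ j : J, BlkY (f j).toKIdx → IBondY (f j).toKIdx)
  (KC : ∀ j : J, B9.KernelFamily (geo9Y (f j)) (codingYx P G (f j) (C37 j) (C38 j)).bg)

/-- ★ **THE ROOT SECT.-B FRAME `GpFrame₂` OVER THE CODED CARRIERS OF A SUBFAMILY `f : J → MemberY`** — the construction of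
`B9SectBGpFrameCodedY.gpFrame₂Coded` at the members `x := f j`, the section binder `hι` asked AT THOSE MEMBERS ONLY; data, constants and field lemmas exactly
as there (NODE 00's letters `kQC sQC kFC sFC wC cfunC expAC ΔpC GopC LapC`, `a₀ = 1`, `d₀ = 2(d+1)`, `δcap = 1`, `Λf = L⁴`, n06-k's `(d261, M261)` and scale
transfers; `hC37`, `hread`, `hwrite` displayed). [cite: Balaban1985BackgroundPropagators, Thm 3.4 p.400, (3.60) p.402, Thm 3.1 (3.42) p.397, (3.19) p.393, (3.35)–(3.37) p.396, p.399 (the family); Balaban1984PropagatorsII, Lemma 2.1 p.234, (2.51) p.232] -/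
noncomputable def gpFrame₂CodedOn (hι : ∀ (j : J) (s : BlkY (f j).toKIdx), β (f j).toKIdx.hN (f j).toKIdx.D (f j).toKIdx.hk (ιB j s) = s)
    (hG1 : ∀ u : 𝔸ˣ, u ∈ G → ‖(u : 𝔸)‖ ≤ 1) (hpar : ∀ j (U : CfgY 𝔸 (f j).toKIdx), GVal G (f j).toKIdx U → ∀ z w, par j U z w ∈ G)
    (hunit : ∀ j (U : CfgY 𝔸 (f j).toKIdx), GVal G (f j).toKIdx U → IsUnit (deltaPrimeAY (f j).toKIdx (par j) U))
    (dB : ℕ) (M₂ : ℝ) (hM₂ : 0 ≤ M₂) (hrepr : ∀ (v : 𝔸) (j : ι), |b.repr v j| ≤ M₂ * ‖v‖)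
    (Cq : ℝ) (hCq : 0 ≤ Cq) (hC37 : ∀ j β' U a, C37 j β' U a → GVal G (f j).toKIdx U ∧ CplxLettersY G (f j) (par j) (ιB j) Cq β' U a)
    (cR : ℝ) (hcR : 0 < cR) (wBf : ℝ → ℝ → ℝ) (hwBf : ∀ B δ : ℝ, 0 ≤ B → 0 < δ → 0 < wBf B δ) (wδf : ℝ → ℝ) (hwδf : ∀ δ : ℝ, 0 < δ → 0 < wδf δ)
    (MInv aInv aW : ℝ) (hMInv : 0 < MInv) (haInv : 0 < aInv) (haW : 0 < aW)
    (hread : ∀ j, Read342Y P G (f j) (par j) b (ιB j) (C37 j) (C38 j) (KC j) c35 cR MInv aInv 0 True)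
    (hwrite : ∀ j, Write342Y P G (f j) (par j) b (ιB j) (C37 j) (C38 j) (KC j) wBf wδf aW 0 True) :
    GpFrame₂ c35 (fun j => geo9Y (f j)) (fun j => (codingYx P G (f j) (C37 j) (C38 j)).bg) KC b (Fin (d + 1)) (fun j => SiteY (f j).toKIdx) where
  dB := dB
  Cq := Cq
  a₀ := 1
  d₀ := 2 * ((d : ℝ) + 1)
  M₂ := M₂
  Λf := fun _ _ => ((ℓ : ℝ) + 1) ^ 4
  cR := cR
  wB := wBf
  wδ := wδf
  MInv := MInv
  aInv := aInv
  aW := aW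
  δcap := 1
  M261 := Classical.choose (Classical.choose_spec (exists_d261 (d := d) (ℓ := ℓ) (hd := hd) (hL := hL) (b₀ := b₀) (b₁ := b₁) (Mstar := Mstar)))
  MST := fun δ => 4 * Real.log ((ℓ : ℝ) + 1) / (9 / 5000 * δ)
  d261 := Classical.choose (exists_d261 (d := d) (ℓ := ℓ) (hd := hd) (hL := hL) (b₀ := b₀) (b₁ := b₁) (Mstar := Mstar))
  Cq_nonneg := hCq
  a₀_nonneg := zero_le_one
  M₂_nonneg := hM₂
  Λf_one_le := fun _ _ _ _ => one_le_pow₀ (by have : (0 : ℝ) ≤ ℓ := Nat.cast_nonneg _; linarith)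
  cR_pos := hcR
  wB_pos := hwBf
  wδ_pos := hwδf
  MInv_pos := hMInv
  aInv_pos := haInv
  aW_pos := haW
  δcap_pos := one_pos
  hrepr := hrepr
  T := fun j => shiftY (f j).toKIdx
  blk := fun j => blkC (f j).toKIdx (ιB j)
  Rr := fun _ => 0
  Hp := fun _ => True
  coord := fun j => coordC G (f j).toKIdx
  kQ := fun j => kQC G (f j).toKIdx (par j)
  sQ := fun j => sQC G (f j).toKIdx (par j)
  w := fun j => wC (f j).toKIdx
  cfun := fun j => cfunC (f j).toKIdx
  expA := fun j => expAC (f j).toKIdx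
  kF := fun j => kFC (f j).toKIdx (par j)
  sF := fun j => sFC (f j).toKIdx (par j)
  Δp := fun j => ΔpC (f j).toKIdx (par j) b
  Gop := fun j => GopC (f j).toKIdx (par j) b
  Lap := fun j => LapC (f j).toKIdx b
  dist_nonneg := fun j => geo9Y_dist_nonneg (f j)
  triangle := fun j => fun a bb c => geo9Y_dist_triangle (f j) a bb c
  dist_self := fun j => geo9Y_dist_self (f j)
  dist_comm := fun j => geo9Y_dist_comm (f j)
  len_pos := fun j => geo9Y_len_pos (f j)
  eta_le_len := fun j y => by
    show (geo9Y (f j)).eta ≤ (geo9Y (f j)).L ^ (geo9Y (f j)).scale y * (geo9Y (f j)).eta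
    exact le_mul_of_one_le_left (geo9K_eta_pos (f j).toKIdx).le (one_le_pow₀ (geo9K_one_le_L (f j).toKIdx))
  eta_pos := fun j => geo9K_eta_pos (f j).toKIdx
  h261 := fun j δ α hδ _ hα hα1 hM =>
    Classical.choose_spec (Classical.choose_spec (exists_d261 (d := d) (ℓ := ℓ) (hd := hd) (hL := hL) (b₀ := b₀) (b₁ := b₁) (Mstar := Mstar)))
      (f j) δ α hδ hα hα1.le hM
  hST := fun j δ α hδ _ hα hM => by
    have hκlo : 0 < 9 / 5000 * δ := by positivity
    have hκ : 9 / 5000 * δ ≤ α * δ := mul_le_mul_of_nonneg_right hα hδ.le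
    exact scaleTransfer6_window_geo9Y hκlo (f j) hκ hM
  unitary := fun j c m z => coordC_unitary G (f j).toKIdx hG1 c m z
  stencilB := fun j μ z => stencilB_blkC (f j).toKIdx (ιB j) (hι j) μ z
  stencilF := fun j μ z => stencilF_blkC (f j).toKIdx (ιB j) (hι j) μ z
  stencil0 := fun j y => stencil0_geo9K (f j).toKIdx y
  w_nonneg := fun j c y => wC_nonneg (f j).toKIdx c y
  card_w := fun j c y => card_blkC_mul_wC_le (f j).toKIdx (ιB j) (instD := instDS (f j)) (hι j) c y
  hkQ := fun j c y z _ => kQC_norm_le G (f j).toKIdx (par j) hG1 (hpar j) c y z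
  hsQ := fun j c z => sQC_norm_le G (f j).toKIdx (par j) hG1 (hpar j) c z
  hcfun := fun j y => cfunC_abs_le (f j).toKIdx y
  gop_eq := fun j c D X hD hDX hXD => gopC_eq (f j).toKIdx (par j) b c D X hD hDX hXD
  reg_inv := fun j α₀ c _ _ _ hreg => by
    obtain ⟨U, rfl, hU⟩ := (codingYx P G (f j) (C37 j) (C38 j)).exists_of_bg_Reg335 hreg
    exact ΔpC_mul_GopC (f j).toKIdx (par j) b (.base U) (hunit j U hU.1.1)
  cplx := fun j α₁ c c' _ h37 => by
    obtain ⟨U, a, rfl, rfl, hC⟩ := (codingYx P G (f j) (C37 j) (C38 j)).exists_of_bg_Cplx337 h37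
    exact (hC37 j α₁ U a hC).2
  mul_law := fun j α₁ c c' _ h37 => by
    obtain ⟨U, a, rfl, rfl, hC⟩ := (codingYx P G (f j) (C37 j) (C38 j)).exists_of_bg_Cplx337 h37
    exact ΔpC_mul_law G (f j).toKIdx (par j) b (ιB j) (instD := instDS (f j)) (hι j) (hC37 j α₁ U a hC).1 a
  read342 := fun j α₀ c B₀ δ hM hα₀ hMa hreg hB₀ hδ hE => by
    obtain ⟨U, rfl, hU⟩ := (codingYx P G (f j) (C37 j) (C38 j)).exists_of_bg_Reg335 hreg
    exact hread j α₀ U B₀ δ hM hα₀ hMa hU hB₀ hδ hE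
  write342 := fun j c c' α₁ B δ hα₁ hα₁W h37 hB hδ hG hDG hGD hLG => by
    obtain ⟨U, a, rfl, rfl, hC⟩ := (codingYx P G (f j) (C37 j) (C38 j)).exists_of_bg_Cplx337 h37
    exact hwrite j U a α₁ B δ hα₁ hα₁W hC hB hδ hG hDG hGD hLG

end RootFrame

/-! ## §2 ★ `hin` on a subfamily -/

section Hin

variable {J : Type} (f : J → MemberY d ℓ hd hL b₀ b₁ Mstar) [∀ x : MemberY d ℓ hd hL b₀ b₁ Mstar, Fintype (geo9Y x).Site]
  (G : Subgroup 𝔸ˣ) (par : ∀ j : J, SiteParY 𝔸 (f j).toKIdx) {ι : Type} [Fintype ι] (b : Module.Basis ι ℝ 𝔸)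
  (ιB : ∀ j : J, BlkY (f j).toKIdx → IBondY (f j).toKIdx)
  (C37 C38 : ∀ j : J, ℝ → CfgY 𝔸 (f j).toKIdx → AfldY 𝔸 (f j).toKIdx → Prop)

/-- ★ **THE HYPOTHESIS `hin` OF `sectBStepPrinted_of_family` ON A SUBFAMILY**, for `Gp₁ := KSC` and `Gp₂ :=` the record's `G′` read along the decoding:
M-threshold `max ML (2(d+1)+1)` (neighbourhood count of the member type, uniform), cap `1`, constants `(c_in(δ₀)·max B₀ 0, δ₀, B_β, B_ε, B_εβ, B₁, δ₁)` —
`B9SectBGpTransferInY.thms_KSC_base_of_pullK` at the members `f j`. [cite: Balaban1985BackgroundPropagators, Thms 3.1–3.3 (3.42)–(3.48) pp.397–399, (3.35) p.396, p.403 l.1–9; Balaban1984PropagatorsII, Lemma 2.1 (2.61) p.234] -/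
theorem hin_KSC_on (hι : ∀ (j : J) (s : BlkY (f j).toKIdx), β (f j).toKIdx.hN (f j).toKIdx.D (f j).toKIdx.hk (ιB j s) = s)
    (hG1 : ∀ u : 𝔸ˣ, u ∈ G → ‖(u : 𝔸)‖ ≤ 1) {M₂ : ℝ} (hM₂ : 0 ≤ M₂) (hrepr : ∀ (v : 𝔸) (j : ι), |b.repr v j| ≤ M₂ * ‖v‖) (c35 : ℝ) (dC : ℕ)
    (GA : ∀ j : J, B9.KernelFamily (geo9Y (f j)) (codingYx P G (f j) (C37 j) (C38 j)).bg)
    (Cinv : ∀ j : J, B9.SiteKernel (geo9Y (f j)) (codingYx P G (f j) (C37 j) (C38 j)).bg) :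
    ∀ (B₀ δ₀ : ℝ) (Bβ Bε : ℝ → ℝ) (Bεβ : ℝ → ℝ → ℝ) (B₁ δ₁ : ℝ),
      ∃ (Mi ai B₀' δ₀' : ℝ) (Bβ' Bε' : ℝ → ℝ) (Bεβ' : ℝ → ℝ → ℝ) (B₁' δ₁' : ℝ), 0 < ai ∧
        ∀ j : J, Mi ≤ (geo9Y (f j)).M → ∀ α₀ : ℝ, 0 < α₀ → (geo9Y (f j)).M * α₀ ≤ ai →
          ∀ c : (codingYx P G (f j) (C37 j) (C38 j)).bg.Cfg, (codingYx P G (f j) (C37 j) (C38 j)).bg.Reg335 c35 α₀ c →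
          B9.Thms31to33IneqAt dC (pullK (codingYx P G (f j) (C37 j) (C38 j))
              (kernelFamilyS (f j).toKIdx (bg9YC 𝔸 G P (f j)) (fun U => U) (GpY (f j).toKIdx (par j)) (par j))) (GA j) (Cinv j) B₀ δ₀ Bβ Bε Bεβ B₁ δ₁ c →
          B9.Thms31to33IneqAt dC (KSC P G (f j) (par j) (C37 j) (C38 j)) (GA j) (Cinv j) B₀' δ₀' Bβ' Bε' Bεβ' B₁' δ₁' c := by
  intro B₀ δ₀ Bβ Bε Bεβ B₁ δ₁
  obtain ⟨ML, mN, hcnt⟩ := exists_card_nbr_geo9Y_le_of_M (d := d) (ℓ := ℓ) (hd := hd) (hL := hL) (b₀ := b₀) (b₁ := b₁) (2 * ((d : ℝ) + 1))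
  refine ⟨max ML (2 * ((d : ℝ) + 1) + 1), 1,
    (((ℓ + 1 : ℕ) : ℝ) * Real.exp (|δ₀| * (2 * ((d : ℝ) + 1))) + ((mN : ℝ) * (M₂ * ∑ j, ‖b j‖) * Real.exp (|δ₀| * (2 * ((d : ℝ) + 1))) + 1))
      * max B₀ 0, δ₀, Bβ, Bε, Bεβ, B₁, δ₁, one_pos, fun j hM α₀ _ _ c hreg hT => ?_⟩
  obtain ⟨U, rfl, hU335⟩ := (codingYx P G (f j) (C37 j) (C38 j)).exists_of_bg_Reg335 hreg
  have hU : GVal G (f j).toKIdx U := hU335.1.1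
  have hM2 : 2 * ((d : ℝ) + 1) < (geo9Y (f j)).M := by
    have := le_trans (le_max_right _ _) hM
    linarith
  have hML : ML ≤ (geo9Y (f j)).M := le_trans (le_max_left _ _) hM
  exact thms_KSC_base_of_pullK P G (f j) (par j) b (ιB j) (C37 j) (C38 j) (hι j) hG1 hU hM₂ hrepr hM2 (fun a => hcnt Mstar (f j) hML a) dC (GA j)
    (Cinv j) hT

end Hin

/-! ## §3 ★ `hconv` and `hout` on a subfamily -/

section Hout

variable [FiniteDimensional ℝ 𝔸] {J : Type} (f : J → MemberY d ℓ hd hL b₀ b₁ Mstar) [∀ x : MemberY d ℓ hd hL b₀ b₁ Mstar, Fintype (geo9Y x).Site]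
  (G : Subgroup 𝔸ˣ) (par : ∀ j : J, SiteParY 𝔸 (f j).toKIdx) {ι : Type} [Fintype ι] (b : Module.Basis ι ℝ 𝔸)
  (ιB : ∀ j : J, BlkY (f j).toKIdx → IBondY (f j).toKIdx)
  (C37 C38 : ∀ j : J, ℝ → CfgY 𝔸 (f j).toKIdx → AfldY 𝔸 (f j).toKIdx → Prop)

/-- ★ **`hconv` ON A SUBFAMILY**: M-threshold `max (M261 δ₀) (16 log(ℓ+1)∕δ₀)`, a constant `B″ ≧ 0` uniform in the member — `B9SectBGpTransferConvY.hconv_at` at the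
members `f j`. [cite: Balaban1985BackgroundPropagators, p.403 l.1–9, (3.70) p.404, (3.74) p.405, (3.42) p.397; Balaban1984PropagatorsII, Lemma 2.1 (2.59)–(2.61) pp.233–234] -/
theorem hconv_KSC_on (hG1 : ∀ u : 𝔸ˣ, u ∈ G → ‖(u : 𝔸)‖ ≤ 1) {M₂ : ℝ} (hM₂ : 0 ≤ M₂) (hrepr : ∀ (v : 𝔸) (j : ι), |b.repr v j| ≤ M₂ * ‖v‖)
    (hι : ∀ (j : J) (s : BlkY (f j).toKIdx), β (f j).toKIdx.hN (f j).toKIdx.D (f j).toKIdx.hk (ιB j s) = s)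
    {Cq : ℝ} (hC37 : ∀ j β' U a, C37 j β' U a → GVal G (f j).toKIdx U ∧ CplxLettersY G (f j) (par j) (ιB j) Cq β' U a) :
    ∀ (B₀ δ₀ : ℝ), 0 ≤ B₀ → 0 < δ₀ → ∃ (Mo B'' : ℝ), 0 ≤ B'' ∧
      ∀ j : J, Mo ≤ (geo9Y (f j)).M → ∀ (U : CfgY 𝔸 (f j).toKIdx) (a : AfldY 𝔸 (f j).toKIdx) (α₁ : ℝ), α₁ ≤ 1 / 4 → C37 j α₁ U a →
        EBlock (KSC P G (f j) (par j) (C37 j) (C38 j)) B₀ δ₀ (.prod U a) →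
        EBlock (kernelFamilyS (f j).toKIdx (bg9YC 𝔸 G P (f j)) (fun U => U) (GpY (f j).toKIdx (par j)) (par j)) B'' (δ₀ / 2)
          (mulY (f j).toKIdx (fluct (kGeo (f j).toKIdx).eta a) U) := by
  obtain ⟨d261, M261, h261f⟩ := exists_d261 (d := d) (ℓ := ℓ) (hd := hd) (hL := hL) (b₀ := b₀) (b₁ := b₁) (Mstar := Mstar)
  intro B₀ δ₀ hB₀ hδ₀
  have hκlo : 0 < 1 / 4 * δ₀ := by positivity
  refine ⟨max (M261 δ₀) (4 * Real.log ((ℓ : ℝ) + 1) / (1 / 4 * δ₀)), ?_, ?_, ?_⟩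
  pick_goal 3
  · intro j hM U a α₁ hα₁c hC hE
    have hM1 : M261 δ₀ ≤ (geo9Y (f j)).M := le_trans (le_max_left _ _) hM
    have hM2 : 4 * Real.log ((ℓ : ℝ) + 1) / (1 / 4 * δ₀) ≤ (geo9Y (f j)).M := le_trans (le_max_right _ _) hM
    have h261 := h261f (f j) δ₀ (1 / 4) hδ₀ (by norm_num) (by norm_num) hM1
    have hST := scaleTransfer6_window_geo9Y hκlo (f j) (δ := δ₀) (α := 1 / 4) le_rfl hM2
    exact hconv_at P G (f j) (par j) b (ιB j) (C37 j) (C38 j) (hι j) hG1 hM₂ hrepr (hC37 j) hδ₀ h261 (Λ := ((ℓ : ℝ) + 1) ^ 4) (by positivity)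
      hST.1 hST.2.1 hST.2.2.1 hB₀ hα₁c hC hE
  · have hSb : 0 ≤ ∑ j, ‖b j‖ := Finset.sum_nonneg fun j _ => norm_nonneg _
    have hc₁ : 0 ≤ B6.c1 (d261 δ₀) δ₀ (1 / 4) := B6RandomWalk.c1_nonneg _ _ _
    have hcard : (0 : ℝ) ≤ Fintype.card (Fin (d + 1)) := Nat.cast_nonneg _
    have hΛ : (0 : ℝ) ≤ ((ℓ : ℝ) + 1) ^ 4 := by positivity
    have hk : 0 ≤ kappa385 (M₂ * (∑ j, ‖b j‖) * B₀)
        ((((2 + 8 * (1 : ℝ) ^ 2 * (1 / 4)) * Fintype.card (Fin (d + 1)) + 2 * Fintype.card (Fin (d + 1)) * 2) * M₂ * (∑ j, ‖b j‖) *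
          Real.exp (δ₀ * (2 * ((d : ℝ) + 1))))) 0 0 (((ℓ : ℝ) + 1) ^ 4) (B6.c1 (d261 δ₀) δ₀ (1 / 4)) :=
      kappa385_nonneg (by positivity) (by positivity) le_rfl le_rfl hΛ hc₁
    positivity

/-- ★ **THE HYPOTHESIS `hout` OF `sectBStepFamilyTransfer.sectBStepPrinted_of_family` ON A SUBFAMILY** (`hconv_KSC_on` ∘ `thms_pullK_prod_of_KSC`): caps
`ao = 1`, `a′ = min a (1/4)`, output constants `(max B₀ B″, min δ₀ (δ₀/2), B_β, B_ε, B_εβ, B₁, δ₁)`; the shared `GA` has nonnegative Hölder ∕ (3.44) ∕ (3.45)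
members. [cite: Balaban1985BackgroundPropagators, Thm 3.4 p.400, p.403 l.1–9, (3.35)–(3.37) p.396, (3.42)–(3.48) pp.397–399] -/
theorem hout_KSC_on (hG1 : ∀ u : 𝔸ˣ, u ∈ G → ‖(u : 𝔸)‖ ≤ 1) {M₂ : ℝ} (hM₂ : 0 ≤ M₂) (hrepr : ∀ (v : 𝔸) (j : ι), |b.repr v j| ≤ M₂ * ‖v‖)
    (hι : ∀ (j : J) (s : BlkY (f j).toKIdx), β (f j).toKIdx.hN (f j).toKIdx.D (f j).toKIdx.hk (ιB j s) = s)
    {Cq : ℝ} (hC37 : ∀ j β' U a, C37 j β' U a → GVal G (f j).toKIdx U ∧ CplxLettersY G (f j) (par j) (ιB j) Cq β' U a) (c35 : ℝ) (dC : ℕ)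
    (GA : ∀ j : J, B9.KernelFamily (geo9Y (f j)) (codingYx P G (f j) (C37 j) (C38 j)).bg)
    (Cinv : ∀ j : J, B9.SiteKernel (geo9Y (f j)) (codingYx P G (f j) (C37 j) (C38 j)).bg)
    (hGA : ∀ (j : J) (c : (codingYx P G (f j) (C37 j) (C38 j)).bg.Cfg),
      (∀ lam β' ζ, 0 ≤ (GA j).h1 c lam β' ζ) ∧ (∀ lam y, 0 ≤ (GA j).e4 c lam y) ∧ (∀ lam β' ζ, 0 ≤ (GA j).h2 c lam β' ζ)) :
    ∀ (B₀ δ₀ : ℝ) (Bβ Bε : ℝ → ℝ) (Bεβ : ℝ → ℝ → ℝ) (B₁ δ₁ : ℝ) (acap : ℝ), 0 < B₀ → 0 < δ₀ → 0 < B₁ → 0 < δ₁ → 0 < acap →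
      ∃ (Mo ao a' B₀' δ₀' : ℝ) (Bβ' Bε' : ℝ → ℝ) (Bεβ' : ℝ → ℝ → ℝ) (B₁' δ₁' : ℝ),
        0 < ao ∧ 0 < a' ∧ a' ≤ acap ∧ 0 < B₀' ∧ 0 < δ₀' ∧ 0 < B₁' ∧ 0 < δ₁' ∧
        ∀ j : J, Mo ≤ (geo9Y (f j)).M → ∀ α₀ : ℝ, 0 < α₀ → (geo9Y (f j)).M * α₀ ≤ ao →
          ∀ c : (codingYx P G (f j) (C37 j) (C38 j)).bg.Cfg, (codingYx P G (f j) (C37 j) (C38 j)).bg.Reg335 c35 α₀ c →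
          ∀ α₁ : ℝ, 0 < α₁ → α₁ ≤ a' → ∀ c' : (codingYx P G (f j) (C37 j) (C38 j)).bg.Cfg, (codingYx P G (f j) (C37 j) (C38 j)).bg.Cplx337 α₁ c c' →
          B9.Thms31to33IneqAt dC (KSC P G (f j) (par j) (C37 j) (C38 j)) (GA j) (Cinv j) B₀ δ₀ Bβ Bε Bεβ B₁ δ₁
              ((codingYx P G (f j) (C37 j) (C38 j)).bg.mul c' c) →
          B9.Thms31to33IneqAt dC (pullK (codingYx P G (f j) (C37 j) (C38 j))
              (kernelFamilyS (f j).toKIdx (bg9YC 𝔸 G P (f j)) (fun U => U) (GpY (f j).toKIdx (par j)) (par j))) (GA j) (Cinv j)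
              B₀' δ₀' Bβ' Bε' Bεβ' B₁' δ₁' ((codingYx P G (f j) (C37 j) (C38 j)).bg.mul c' c) := by
  intro B₀ δ₀ Bβ Bε Bεβ B₁ δ₁ acap hB₀ hδ₀ hB₁ hδ₁ hacap
  obtain ⟨Mo, B'', hB'', H⟩ := hconv_KSC_on P f G par b ιB C37 C38 hG1 hM₂ hrepr hι hC37 B₀ δ₀ hB₀.le hδ₀
  refine ⟨Mo, 1, min acap (1 / 4), max B₀ B'', min δ₀ (δ₀ / 2), Bβ, Bε, Bεβ, B₁, δ₁, one_pos, lt_min hacap (by norm_num), min_le_left _ _,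
    lt_max_of_lt_left hB₀, lt_min hδ₀ (by linarith), hB₁, hδ₁, fun j hM α₀ _ _ c _ α₁ _ hα₁a c' h37 hT => ?_⟩
  obtain ⟨U, a, rfl, rfl, hC⟩ := (codingYx P G (f j) (C37 j) (C38 j)).exists_of_bg_Cplx337 h37
  have hα₁c : α₁ ≤ 1 / 4 := le_trans hα₁a (min_le_right _ _)
  have hE : EBlock (KSC P G (f j) (par j) (C37 j) (C38 j)) B₀ δ₀ (.prod U a) := hT.1.1.1
  exact thms_pullK_prod_of_KSC P G (f j) (par j) (C37 j) (C38 j) dC (GA j) (Cinv j) (hGA j _).1 (hGA j _).2.1 (hGA j _).2.2 hB₀.le hT hB''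
    (H j hM U a α₁ hα₁c hC hE)

/-! ## §4 ★★ The composed transfer on a subfamily -/

/-- ★★ **THE CODED-CARRIER CHAIN, COMPOSED, ON A SUBFAMILY**: let `f : J → MemberY …` carry sections `ιB j` of `β`, a unit-norm structure group `G` (`hG1`),
transporters `par`, a real basis `b` with coordinate constant `M₂`, coded classes `C37 j` implying «`U` `G`-valued and `CplxLettersY`» (`hC37`), record
families `GA`, `Cinv` (Hölder ∕ (3.44) ∕ (3.45) members of `GA` nonnegative — every reading by suprema) and analyticity predicates `IsAnK` (coded side),
`IsAn` (record side) with the transport `hAn`, and the class implication `hclass` (record's (3.37) at `α₁ ≦ αcap` ⇒ coded class at `r·α₁`, above `Mc`).  IF the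
Sect.-B step holds for the augmented coded readings `(KSC, pullK GA, pullS Cinv, IsAnK)` over the coded carriers on `J` (the letters-level frames' output),
THEN the Sect.-B step holds FOR THE RECORD — `G′` read by `kernelFamilyS (GpY par) par`, `GA`, `Cinv`, `IsAn` over `bg9Y` — on `J`
(`sectBStepPrinted_of_coded ∘ sectBStepPrinted_of_family (hin_KSC_on) (hout_KSC_on) (hAn)`).
[cite: Balaban1985BackgroundPropagators, Thm 3.4 p.400, Sect. B pp.400–407, p.403 l.1–9, (3.35)–(3.37) p.396, p.399 (the family)] -/
theorem sectBStepPrinted_on_of_KSC (hG1 : ∀ u : 𝔸ˣ, u ∈ G → ‖(u : 𝔸)‖ ≤ 1) {M₂ : ℝ} (hM₂ : 0 ≤ M₂)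
    (hrepr : ∀ (v : 𝔸) (j : ι), |b.repr v j| ≤ M₂ * ‖v‖)
    (hι : ∀ (j : J) (s : BlkY (f j).toKIdx), β (f j).toKIdx.hN (f j).toKIdx.D (f j).toKIdx.hk (ιB j s) = s)
    {Cq : ℝ} (hC37 : ∀ j β' U a, C37 j β' U a → GVal G (f j).toKIdx U ∧ CplxLettersY G (f j) (par j) (ιB j) Cq β' U a) (c35 : ℝ) (dC : ℕ)
    (GA : ∀ j : J, B9.KernelFamily (geo9Y (f j)) (bg9YC 𝔸 G P (f j))) (Cinv : ∀ j : J, B9.SiteKernel (geo9Y (f j)) (bg9YC 𝔸 G P (f j)))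
    (hGA : ∀ (j : J) (U : (bg9YC 𝔸 G P (f j)).Cfg),
      (∀ lam β' ζ, 0 ≤ (GA j).h1 U lam β' ζ) ∧ (∀ lam y, 0 ≤ (GA j).e4 U lam y) ∧ (∀ lam β' ζ, 0 ≤ (GA j).h2 U lam β' ζ))
    (IsAnK : ∀ j : J, B9.KernelFamily (geo9Y (f j)) (codingYx P G (f j) (C37 j) (C38 j)).bg → (codingYx P G (f j) (C37 j) (C38 j)).bg.Cfg → ℝ → Prop)
    (IsAn : ∀ j : J, B9.KernelFamily (geo9Y (f j)) (bg9YC 𝔸 G P (f j)) → (bg9YC 𝔸 G P (f j)).Cfg → ℝ → Prop)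
    {r αcap Mc ac : ℝ} (hr : 0 < r) (hcap : 0 < αcap) (hac : 0 < ac)
    (hAn : ∀ (j : J) (c : (codingYx P G (f j) (C37 j) (C38 j)).bg.Cfg) (α : ℝ),
      (IsAnK j (KSC P G (f j) (par j) (C37 j) (C38 j)) c α →
        pullAn (codingYx P G (f j) (C37 j) (C38 j)) r (IsAn j)
          (pullK (codingYx P G (f j) (C37 j) (C38 j)) (kernelFamilyS (f j).toKIdx (bg9YC 𝔸 G P (f j)) (fun U => U) (GpY (f j).toKIdx (par j)) (par j))) c α) ∧
      (IsAnK j (pullK (codingYx P G (f j) (C37 j) (C38 j)) (GA j)) c α →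
        pullAn (codingYx P G (f j) (C37 j) (C38 j)) r (IsAn j) (pullK (codingYx P G (f j) (C37 j) (C38 j)) (GA j)) c α))
    (hclass : ∀ (j : J) (α₀ α₁ : ℝ) (U U' : (bg9YC 𝔸 G P (f j)).Cfg), Mc ≤ (geo9Y (f j)).M → 0 < α₀ → (geo9Y (f j)).M * α₀ ≤ ac →
      (bg9YC 𝔸 G P (f j)).Reg335 c35 α₀ U → 0 < α₁ → α₁ ≤ αcap → (bg9YC 𝔸 G P (f j)).Cplx337 α₁ U U' →
      ∃ a : (codingYx P G (f j) (C37 j) (C38 j)).A,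
        (codingYx P G (f j) (C37 j) (C38 j)).decA a = U' ∧ (codingYx P G (f j) (C37 j) (C38 j)).C37 (r * α₁) U a)
    (h : B9.SectBStepPrinted dC c35 (fun j => geo9Y (f j)) (fun j => (codingYx P G (f j) (C37 j) (C38 j)).bg)
      (fun j => KSC P G (f j) (par j) (C37 j) (C38 j)) (fun j => pullK (codingYx P G (f j) (C37 j) (C38 j)) (GA j))
      (fun j => pullS (codingYx P G (f j) (C37 j) (C38 j)) (Cinv j)) IsAnK) :
    B9.SectBStepPrinted dC c35 (fun j => geo9Y (f j)) (fun j => bg9YC 𝔸 G P (f j))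
      (fun j => kernelFamilyS (f j).toKIdx (bg9YC 𝔸 G P (f j)) (fun U => U) (GpY (f j).toKIdx (par j)) (par j)) GA Cinv IsAn := by
  refine sectBStepPrinted_of_coded dC c35 (fun j => geo9Y (f j)) (fun j => bg9YC 𝔸 G P (f j)) (fun j => codingYx P G (f j) (C37 j) (C38 j))
    (fun j => kernelFamilyS (f j).toKIdx (bg9YC 𝔸 G P (f j)) (fun U => U) (GpY (f j).toKIdx (par j)) (par j)) GA Cinv IsAn hr hcap hac hclass ?_
  exact sectBStepPrinted_of_family dC c35 (fun j => geo9Y (f j)) (fun j => (codingYx P G (f j) (C37 j) (C38 j)).bg)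
    (fun j => KSC P G (f j) (par j) (C37 j) (C38 j))
    (fun j => pullK (codingYx P G (f j) (C37 j) (C38 j)) (kernelFamilyS (f j).toKIdx (bg9YC 𝔸 G P (f j)) (fun U => U) (GpY (f j).toKIdx (par j)) (par j)))
    (fun j => pullK (codingYx P G (f j) (C37 j) (C38 j)) (GA j)) (fun j => pullK (codingYx P G (f j) (C37 j) (C38 j)) (GA j))
    (fun j => pullS (codingYx P G (f j) (C37 j) (C38 j)) (Cinv j)) IsAnK
    (fun j => pullAn (codingYx P G (f j) (C37 j) (C38 j)) r (IsAn j))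
    (hin_KSC_on P f G par b ιB C37 C38 hι hG1 hM₂ hrepr c35 dC _ _)
    (hout_KSC_on P f G par b ιB C37 C38 hG1 hM₂ hrepr hι hC37 c35 dC _ _ fun j c => hGA j _) hAn h

end Hout

/-! ## §5 Corner-free subfamilies: canonical sections, no binder left -/

section CornerFree

variable [NormOneClass 𝔸] [FiniteDimensional ℝ 𝔸] {J : Type} (f : J → MemberY d ℓ hd hL b₀ b₁ Mstar)
  (hf : ∀ j : J, Function.Surjective (β (f j).toKIdx.hN (f j).toKIdx.D (f j).toKIdx.hk))
  [∀ x : MemberY d ℓ hd hL b₀ b₁ Mstar, Fintype (geo9Y x).Site]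
  [instDS : ∀ x : MemberY d ℓ hd hL b₀ b₁ Mstar, DecidableEq (geo9Y x).Site] [∀ x : MemberY d ℓ hd hL b₀ b₁ Mstar, Nonempty (geo9Y x).Site]
  (c35 : ℝ) (G : Subgroup 𝔸ˣ) {ι : Type} [Fintype ι] [DecidableEq ι] (b : Module.Basis ι ℝ 𝔸)
  (C37 C38 : ∀ j : J, ℝ → CfgY 𝔸 (f j).toKIdx → AfldY 𝔸 (f j).toKIdx → Prop)
  (par : ∀ j : J, SiteParY 𝔸 (f j).toKIdx)

/-- ★ **THE ROOT FRAME ON A CORNER-FREE SUBFAMILY, NO SECTION BINDER**: `gpFrame₂CodedOn f` with `ιB j := Function.surjInv (hf j)`.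
[cite: Balaban1985BackgroundPropagators, Thm 3.4 p.400, Thm 3.1 (3.42) p.397, p.399 (the family); Balaban1984PropagatorsII, (2.45) p.231, Lemma 2.1 p.234] -/
noncomputable def gpFrame₂CodedCornerFree
    (KC : ∀ j : J, B9.KernelFamily (geo9Y (f j)) (codingYx P G (f j) (C37 j) (C38 j)).bg)
    (hG1 : ∀ u : 𝔸ˣ, u ∈ G → ‖(u : 𝔸)‖ ≤ 1) (hpar : ∀ j (U : CfgY 𝔸 (f j).toKIdx), GVal G (f j).toKIdx U → ∀ z w, par j U z w ∈ G)
    (hunit : ∀ j (U : CfgY 𝔸 (f j).toKIdx), GVal G (f j).toKIdx U → IsUnit (deltaPrimeAY (f j).toKIdx (par j) U))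
    (dB : ℕ) (M₂ : ℝ) (hM₂ : 0 ≤ M₂) (hrepr : ∀ (v : 𝔸) (j : ι), |b.repr v j| ≤ M₂ * ‖v‖)
    (Cq : ℝ) (hCq : 0 ≤ Cq)
    (hC37 : ∀ j β' U a, C37 j β' U a → GVal G (f j).toKIdx U ∧ CplxLettersY G (f j) (par j) (fun s => Function.surjInv (hf j) s) Cq β' U a)
    (cR : ℝ) (hcR : 0 < cR) (wBf : ℝ → ℝ → ℝ) (hwBf : ∀ B δ : ℝ, 0 ≤ B → 0 < δ → 0 < wBf B δ) (wδf : ℝ → ℝ) (hwδf : ∀ δ : ℝ, 0 < δ → 0 < wδf δ)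
    (MInv aInv aW : ℝ) (hMInv : 0 < MInv) (haInv : 0 < aInv) (haW : 0 < aW)
    (hread : ∀ j, Read342Y P G (f j) (par j) b (fun s => Function.surjInv (hf j) s) (C37 j) (C38 j) (KC j) c35 cR MInv aInv 0 True)
    (hwrite : ∀ j, Write342Y P G (f j) (par j) b (fun s => Function.surjInv (hf j) s) (C37 j) (C38 j) (KC j) wBf wδf aW 0 True) :
    GpFrame₂ c35 (fun j => geo9Y (f j)) (fun j => (codingYx P G (f j) (C37 j) (C38 j)).bg) KC b (Fin (d + 1)) (fun j => SiteY (f j).toKIdx) :=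
  gpFrame₂CodedOn P f c35 G b C37 C38 par (fun j s => Function.surjInv (hf j) s) KC (fun j s => Function.surjInv_eq (hf j) s) hG1 hpar hunit dB M₂ hM₂
    hrepr Cq hCq hC37 cR hcR wBf hwBf wδf hwδf MInv aInv aW hMInv haInv haW hread hwrite

omit [NormOneClass 𝔸] instDS [∀ x : MemberY d ℓ hd hL b₀ b₁ Mstar, Nonempty (geo9Y x).Site] [DecidableEq ι] in
/-- ★★ **THE CODED-CARRIER CHAIN ON A CORNER-FREE SUBFAMILY, NO SECTION BINDER**: `sectBStepPrinted_on_of_KSC f` with the canonical sections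
`Function.surjInv (hf j)` — the Sect.-B step for the augmented coded readings over corner-free members gives the Sect.-B step for the record's families over
those members, given `hclass` and `hAn` there. [cite: Balaban1985BackgroundPropagators, Thm 3.4 p.400, Sect. B pp.400–407, p.403 l.1–9, (3.35)–(3.37) p.396, p.399; Balaban1984PropagatorsII, (2.45) p.231] -/
theorem sectBStepPrinted_cornerFree_of_KSC (hG1 : ∀ u : 𝔸ˣ, u ∈ G → ‖(u : 𝔸)‖ ≤ 1) {M₂ : ℝ} (hM₂ : 0 ≤ M₂)
    (hrepr : ∀ (v : 𝔸) (j : ι), |b.repr v j| ≤ M₂ * ‖v‖)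
    {Cq : ℝ} (hC37 : ∀ j β' U a, C37 j β' U a → GVal G (f j).toKIdx U ∧ CplxLettersY G (f j) (par j) (fun s => Function.surjInv (hf j) s) Cq β' U a)
    (dC : ℕ) (GA : ∀ j : J, B9.KernelFamily (geo9Y (f j)) (bg9YC 𝔸 G P (f j))) (Cinv : ∀ j : J, B9.SiteKernel (geo9Y (f j)) (bg9YC 𝔸 G P (f j)))
    (hGA : ∀ (j : J) (U : (bg9YC 𝔸 G P (f j)).Cfg),
      (∀ lam β' ζ, 0 ≤ (GA j).h1 U lam β' ζ) ∧ (∀ lam y, 0 ≤ (GA j).e4 U lam y) ∧ (∀ lam β' ζ, 0 ≤ (GA j).h2 U lam β' ζ))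
    (IsAnK : ∀ j : J, B9.KernelFamily (geo9Y (f j)) (codingYx P G (f j) (C37 j) (C38 j)).bg → (codingYx P G (f j) (C37 j) (C38 j)).bg.Cfg → ℝ → Prop)
    (IsAn : ∀ j : J, B9.KernelFamily (geo9Y (f j)) (bg9YC 𝔸 G P (f j)) → (bg9YC 𝔸 G P (f j)).Cfg → ℝ → Prop)
    {r αcap Mc ac : ℝ} (hr : 0 < r) (hcap : 0 < αcap) (hac : 0 < ac)
    (hAn : ∀ (j : J) (c : (codingYx P G (f j) (C37 j) (C38 j)).bg.Cfg) (α : ℝ),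
      (IsAnK j (KSC P G (f j) (par j) (C37 j) (C38 j)) c α →
        pullAn (codingYx P G (f j) (C37 j) (C38 j)) r (IsAn j)
          (pullK (codingYx P G (f j) (C37 j) (C38 j)) (kernelFamilyS (f j).toKIdx (bg9YC 𝔸 G P (f j)) (fun U => U) (GpY (f j).toKIdx (par j)) (par j))) c α) ∧
      (IsAnK j (pullK (codingYx P G (f j) (C37 j) (C38 j)) (GA j)) c α →
        pullAn (codingYx P G (f j) (C37 j) (C38 j)) r (IsAn j) (pullK (codingYx P G (f j) (C37 j) (C38 j)) (GA j)) c α))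
    (hclass : ∀ (j : J) (α₀ α₁ : ℝ) (U U' : (bg9YC 𝔸 G P (f j)).Cfg), Mc ≤ (geo9Y (f j)).M → 0 < α₀ → (geo9Y (f j)).M * α₀ ≤ ac →
      (bg9YC 𝔸 G P (f j)).Reg335 c35 α₀ U → 0 < α₁ → α₁ ≤ αcap → (bg9YC 𝔸 G P (f j)).Cplx337 α₁ U U' →
      ∃ a : (codingYx P G (f j) (C37 j) (C38 j)).A,
        (codingYx P G (f j) (C37 j) (C38 j)).decA a = U' ∧ (codingYx P G (f j) (C37 j) (C38 j)).C37 (r * α₁) U a)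
    (h : B9.SectBStepPrinted dC c35 (fun j => geo9Y (f j)) (fun j => (codingYx P G (f j) (C37 j) (C38 j)).bg)
      (fun j => KSC P G (f j) (par j) (C37 j) (C38 j)) (fun j => pullK (codingYx P G (f j) (C37 j) (C38 j)) (GA j))
      (fun j => pullS (codingYx P G (f j) (C37 j) (C38 j)) (Cinv j)) IsAnK) :
    B9.SectBStepPrinted dC c35 (fun j => geo9Y (f j)) (fun j => bg9YC 𝔸 G P (f j))
      (fun j => kernelFamilyS (f j).toKIdx (bg9YC 𝔸 G P (f j)) (fun U => U) (GpY (f j).toKIdx (par j)) (par j)) GA Cinv IsAn :=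
  sectBStepPrinted_on_of_KSC P f G par b (fun j s => Function.surjInv (hf j) s) C37 C38 hG1 hM₂ hrepr (fun j s => Function.surjInv_eq (hf j) s) hC37 c35 dC
    GA Cinv hGA IsAnK IsAn hr hcap hac hAn hclass h

end CornerFree

end Literature.MathematicalPhysics.QuantumFieldTheory.Balaban1983to89.B9SectBCodedChainOnSubfamilyR

/-!
# `Balaban1983to89.B9SectBCodedClassYR` — THE CLASS-PARAMETRIC TWIN of `B9SectBCodedClassY` (CASCADE-R, director-ym №279 GO-R; №277 (3) `hunitA` cure; dag-n06-d SOCKET-(α) class question)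

statement-level skeleton of published theorems with citation tags; proofs where landed; nothing here is a claim about the
Yang–Mills mass gap

WHAT THIS FILE IS.  The original module `B9SectBCodedClassY` types its objects over MODULE 3's member carrier `bg9Y 𝔸 G x` (MODULE 2's small-cube class (3.35)).  This file RE-DECLARES, with UNCHANGED NAMES inside the namespace `…B9SectBCodedClassYR`, exactly its 2 class-dependent declarations over the CLASS-PARAMETRIC carrier `B9SectBCodedClassR.bg9YC 𝔸 G P x` (`P : RegExtraY …` = the two cube conditions of (3.35)∕(3.36) as a parameter; `bg9Y 𝔸 G x = bg9YC 𝔸 G (extraY 𝔸 G) x` by `rfl`, so every declaration here specialises definitionally to its original; at the record's reading of PRINT's class, `P := extraYPb 𝔸 G`, the displayed laws `hreg335P` ((3.35) on plaquettes) and the class-keyed `hunitA` become theorems).  The text is the original's VERBATIM under the token surgery `bg9Y 𝔸 G ↦ bg9YC 𝔸 G P`, `NAME ↦ NAME P` for the class-dependent names (P the first explicit argument), and — №277 — the binder `hunitA` re-keyed from «all G-valued U» to «all (3.35)-regular U of the carrier» (`∀ j α₀ U, (bg9YC 𝔸 G P (f j)).Reg335 c35 α₀ U → IsUnit (deltaAY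 …)`).  Class-free declarations of the original are NOT copied: they are imported and used BY NAME (`open … hiding` the re-declared ones).  Generated by dag-n06-c g16's `gen.py` (HOME `pub-ymgap-dag-n06-c/lean/g16/`); the ORIGINAL MODULE DOCUMENTATION FOLLOWS VERBATIM and describes the mathematics.

HONEST SCOPE.  Re-typing bookkeeping; nothing of [B9] asserted beyond the original; COUNT-NEUTRAL; N06 NOT discharged; nothing continuum ∕ OS ∕ mass gap ∕ Clay.  Cell `pub-ymgap` (D-0062), Track A node N06 [B9], seat `pub-ymgap-dag-n06-c` g16, 2026-08-29.
-/

/-! Module documentation: that of the original `Balaban1983to89.B9SectBCodedClassY` applies verbatim to this twin (not repeated here). -/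

noncomputable section

namespace Literature.MathematicalPhysics.QuantumFieldTheory.Balaban1983to89.B9SectBCodedClassYR

open Literature.MathematicalPhysics.QuantumFieldTheory.Balaban1983to89.B9SectBCodedClassR (RegExtraY bg9YC)
open Literature.MathematicalPhysics.QuantumFieldTheory.Balaban1983to89.B9SectBCodedClassY hiding hclass_C37Y_at hclass_C37Y

open Complex
open T4RelativeLadder (UnitaryLike)
open B4Reflection242 (boxDom)
open B6MultiLevelBoxOperator (N0)
open B6Geom246MultiLevelBox (bset blkOf blkOf_val)
open B6GlobalChartV1 (PV toBox boxEquiv toBox_apply boxEquiv_apply)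
open B6KLevelCensusIndexV1 (KIdx kGeo)
open B6Ineq2142KLevelV1 (β lvl beta_level)
open B9BackgroundsKLevelV1 (CfgV1 shiftsV1 levV1 Cplx337Body)
open B9Eq39Adjoint (R covD covDstar fluct R_inv_R R_sub R_neg R_smul)
open B9Eq352DivForm (tauB)
open B9Eq370Expansion (norm_R_le)
open B9Eq371Composition (covDstar_eq_neg_R_covD)
open B9Eq335RegularityClasses (Cplx337 OnOmega)
open LatticeNorms (scaleLen)
open B9Eq360DeltaPrimeAY (kQY sQY kFY sFY mulY AfldY chartA blkY blkY_apply)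
open B9PinMembersKLevelV1 (MemberY geo9Y bg9Y)
open B9SectBCodedCarrier (CCfg)
open B9SectBGpLettersY (GVal coordC expAC blkC kFC sFC wC norm_le_one_and_inv_of_mem letters_base_of_gVal stencilB_blkC)
open B9SectBGpFrameCodedYR (codingYx)
open B9SectBGpFrameCodedY (CplxLettersY)
open B9Eq358TaxiLettersY (norm_kFY_parSymY_le norm_sFY_parSymY_le)
open B9RWSumsCompleteGeo9YNbr (len_le_of_dist_lt_M_geo9K)
open B9GeoLemma21KLevelV1 (geo9Y_len_pos geo9K_eta_pos geo9K_one_le_L)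
open Node00 (SiteY BlkY IBondY CfgY SiteParY UboxY shiftY blkCornerY parSymY boxEquiv_symm_shiftY)

variable {𝔸 : Type} [NormedRing 𝔸] [NormedAlgebra ℂ 𝔸] [CompleteSpace 𝔸]
variable {d ℓ : ℕ} {hd : 1 ≤ d + 1} {hL : Odd (ℓ + 1) ∧ 1 < ℓ + 1} {b₀ b₁ : ℝ} {Mstar : ℕ} (P : RegExtraY d ℓ hd hL b₀ b₁ Mstar 𝔸)

/-! ## §1 Chart transports and the level ∕ length dictionary -/

section Chart

variable (i : KIdx d ℓ hd hL b₀ b₁)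

variable (ιB : BlkY i → IBondY i)

end Chart

/-! ## §2 ★★ The seven letter bounds from the record's class (3.37) -/

section Letters

variable [NormOneClass 𝔸] (G : Subgroup 𝔸ˣ) (x : MemberY d ℓ hd hL b₀ b₁ Mstar) (ιB : BlkY x.toKIdx → IBondY x.toKIdx)

end Letters

/-! ## §3 The coded class `C37` and the dictionary `hC37` -/

section Class

variable [NormOneClass 𝔸] (G : Subgroup 𝔸ˣ) (x : MemberY d ℓ hd hL b₀ b₁ Mstar) (ιB : BlkY x.toKIdx → IBondY x.toKIdx)

/-! ## §4 ★★ The class hypothesis `hclass` of `sectBStepPrinted_of_coded` -/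

/-- ★★ **`hclass` AT ONE MEMBER**: above `2(d+1) < M`, every `U′` of the record's class (3.37) at a (3.35)-regular `U` and exponent `0 < α₁ ≤ 1∕4` has the
code `a := A′` (`U′ = e^{iηA′}`) in the coded class `C37Y` at exponent `L⁴α₁` — the section `ιB` of this member given (`hι`).
[cite: Balaban1985BackgroundPropagators, (3.37) p.396, (3.35) p.396, Thm 3.4 p.400] -/
theorem hclass_C37Y_at (hι : ∀ s : BlkY x.toKIdx, β x.toKIdx.hN x.toKIdx.D x.toKIdx.hk (ιB s) = s)
    (hG1 : ∀ u : 𝔸ˣ, u ∈ G → ‖(u : 𝔸)‖ ≤ 1) (hdM : 2 * ((d : ℝ) + 1) < (geo9Y x).M) {c35 α₀ α₁ : ℝ} {U U' : (bg9YC 𝔸 G P x).Cfg}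
    (hreg : (bg9YC 𝔸 G P x).Reg335 c35 α₀ U) (hα₁ : 0 < α₁) (hα₁4 : α₁ ≤ 1 / 4) (h37 : (bg9YC 𝔸 G P x).Cplx337 α₁ U U') :
    ∃ a : AfldY 𝔸 x.toKIdx, fluct (kGeo x.toKIdx).eta a = U' ∧
      C37Y G x ιB (4 * ((d : ℝ) + 1) * Real.exp (3 * (((d : ℝ) + 1) / 2))) ((((ℓ : ℝ) + 1) ^ 4) * α₁) U a := by
  obtain ⟨A', hU', hcl⟩ := h37
  exact ⟨A', hU'.symm, hreg.1.1, cplxLettersY_of_cplx337 G x ιB hι hG1 hdM hreg.1.1 hα₁ hα₁4 hcl⟩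

/-- ★★ **THE CLASS HYPOTHESIS `hclass` OF `B9SectBCodedCarrier.sectBStepPrinted_of_coded`, LITERALLY**, for the codings `codingYx G x (C37Y …) (C38 x)` of the
member family: `r := L⁴`, `αcap := 1∕4`, `Mc := 2(d+1)+1`, any `ac`.  (Family-level: carries the ∀x-section binder `hι`, see HONEST SCOPE.)
[cite: Balaban1985BackgroundPropagators, (3.37) p.396, Thm 3.4 p.400] -/
theorem hclass_C37Y [∀ x : MemberY d ℓ hd hL b₀ b₁ Mstar, Fintype (geo9Y x).Site]
    (ιBf : ∀ x : MemberY d ℓ hd hL b₀ b₁ Mstar, BlkY x.toKIdx → IBondY x.toKIdx)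
    (hι : ∀ (x : MemberY d ℓ hd hL b₀ b₁ Mstar) (s : BlkY x.toKIdx), β x.toKIdx.hN x.toKIdx.D x.toKIdx.hk (ιBf x s) = s)
    (hG1 : ∀ u : 𝔸ˣ, u ∈ G → ‖(u : 𝔸)‖ ≤ 1) (C38 : ∀ x : MemberY d ℓ hd hL b₀ b₁ Mstar, ℝ → CfgY 𝔸 x.toKIdx → AfldY 𝔸 x.toKIdx → Prop)
    (c35 ac : ℝ) :
    ∀ (x : MemberY d ℓ hd hL b₀ b₁ Mstar) (α₀ α₁ : ℝ) (U U' : (bg9YC 𝔸 G P x).Cfg), 2 * ((d : ℝ) + 1) + 1 ≤ (geo9Y x).M → 0 < α₀ → (geo9Y x).M * α₀ ≤ ac →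
      (bg9YC 𝔸 G P x).Reg335 c35 α₀ U → 0 < α₁ → α₁ ≤ 1 / 4 → (bg9YC 𝔸 G P x).Cplx337 α₁ U U' →
      ∃ a : (codingYx P G x (C37Y G x (ιBf x) (4 * ((d : ℝ) + 1) * Real.exp (3 * (((d : ℝ) + 1) / 2)))) (C38 x)).A,
        (codingYx P G x (C37Y G x (ιBf x) (4 * ((d : ℝ) + 1) * Real.exp (3 * (((d : ℝ) + 1) / 2)))) (C38 x)).decA a = U' ∧
        (codingYx P G x (C37Y G x (ιBf x) (4 * ((d : ℝ) + 1) * Real.exp (3 * (((d : ℝ) + 1) / 2)))) (C38 x)).C37 ((((ℓ : ℝ) + 1) ^ 4) * α₁) U a := by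
  intro x α₀ α₁ U U' hM _ _ hreg hα₁ hα₁4 h37
  exact hclass_C37Y_at P G x (ιBf x) (hι x) hG1 (by linarith) hreg hα₁ hα₁4 h37

end Class

/-! ## §5 The per-member section hypothesis `hι` is satisfiable: corner-free members exist -/

section CornerFree


end CornerFree

end Literature.MathematicalPhysics.QuantumFieldTheory.Balaban1983to89.B9SectBCodedClassYR
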